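import Mathlib
import Literature.NumberTheory.EllipticCurves.ZpCorankCyclotomicPrimePow
import Literature.NumberTheory.EllipticCurves.IwasawaAlgebra
import Literature.NumberTheory.EllipticCurves.Rubin1991.TwoVariableMainConjecture
import Literature.NumberTheory.EllipticCurves.Kobayashi2003.SignedPAdicLFunctionConstantTermProofs
import Literature.NumberTheory.EllipticCurves.Kobayashi2003.SignedColemanKatoZetaJoint
import Literature.NumberTheory.EllipticCurves.KatoFineSelmerDualTorsion
import Literature.NumberTheory.EllipticCurves.Kato2004.IwasawaH1LambdaTorsionFreeProofs
import Literature.NumberTheory.IwasawaTheory.IwasawaAlgebraTwoVarRegularProofs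
import Literature.NumberTheory.EllipticCurves.IwasawaAlgebraUnitTwistPair
import Summits.BirchSwinnertonDyer.BirchSwinnertonDyer.Theorems.SignedBaseChangeAnticyclotomicEisensteinDivisibilitySpecializationHerbrand
import Summits.BirchSwinnertonDyer.BirchSwinnertonDyer.Theorems.ErratumRoadFiveCharIdealTransferTorsion
import Literature.NumberTheory.EllipticCurves.IwasawaAlgebraEisensteinCoefficientRingProofs

/-!
# QtameDoor5O v1.1 (g22) — DOOR 5 OVER AN ABSOLUTELY UNRAMIFIED COMPLETE DVR `𝒪` ((G0-ur)(ii) of `Door5.md` §2)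
(crux `TwoVariableEulerSystemDivisibility`, stmt-BirchSwinnertonDyer-20728, route SignedBaseChange; ideator bsd-idea-14 g22; the
COEFFICIENT-GENERIC companion of `QtameDoor5.lean` v1.1 (ce3d6538a2e0) + `QtameRootData.lean` (f6784b8b971a); an idea workfile,
NOT a registered skeleton — the line of record stays `Lines/ratlift.lean` v4; dossier `Door5.md`; the algebra of the coefficient
seam is `QtameBaseChange.lean`).

SETTING. `[CommRing 𝒪] [IsDomain 𝒪] [IsDiscreteValuationRing 𝒪] [IsAdicComplete (maximalIdeal 𝒪) 𝒪] [CharZero 𝒪] [Fact p.Prime]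
[Fact (Irreducible (p : 𝒪))]` — absolutely unramified (`𝔪_𝒪 = (p)`): `ℤ_p`, `W(k)` for `k` perfect of characteristic `p` (§E17; in
particular `Ŵ′ = W(𝔽̄_p)`), unramified `𝒪_L`. `Lam₁ 𝒪 = 𝒪⟦T⟧`, `Lam₂ 𝒪 = 𝒪⟦T₁⟧⟦T₂⟧`. No finiteness / perfectness of the residue
field and no compactness of `𝒪` is used.

CONTENT = `QtameDoor5.lean` v1.1 VERBATIM under `ℤ_[p] ↦ 𝒪`, `IwasawaAlgebra p ↦ Lam₁ 𝒪`, `IwasawaAlgebra₂ p ↦ Lam₂ 𝒪` (same names,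
§ headers, statements; build recipe HOME `door5-build/make_O.py`, a pure text transform; deviations: §0 `Coeff` uniformiser one-liners;
§E10 p-adic-analytic root data REPLACED by the algebraic §E10' = `QtameRootData.lean` under `namespace RD`, `rootDatumS` re-typed for
the Eisenstein shape `T^d + p·h` (its one use, §E14.8); `algebraMap_injectiveS` / `not_dvd_C` re-proved `p`-freely; `Visible 𝒪 F` lost
its unused parameter `p`; long section notes cut to their first line — read them in `QtameDoor5.lean` v1.1) PLUS the new §§E16–E17:
 * §E16 `patchingTarget_holds 𝒪 p X G` (final patching over the UFD `Λ_{2,𝒪}`, every f.g. `X`, every `G`) and the HYPOTHESIS-FREE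
   `door5 D 𝓟₁ 𝓟₂ X G : IsTorsion X → ClassicalFibreBounds 𝒪 p 𝓟₂ X G → ClassicalFibreBounds 𝒪 p 𝓟₁ (Twist D.Θ X) (D.Θ G) →
   ∃ a, span {(p : Lam₂ 𝒪)^a * G} ≤ Module.charIdeal (Lam₂ 𝒪) X`, `door5_cyclotomic_transpose`;
 * §E16.2 (v1.1) the OPTIMAL EXPONENT: `engine_door5Θ_dvd` (what the engine proves at every height-one `𝔓 ∌ p`: `𝔓^{ℓ_𝔓(X)} ∣ (G)`),
   `Patch.span_pow_mul_le_finprod_of_prime`, `door5_explicit : … → span {p ^ ℓ_{(p)}(X) * G} ≤ ch(X)` with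
   `ℓ_{(p)}(X) = Module.lengthAt (Lam₂ 𝒪) X (primeP 𝒪 p)` the `μ`-type multiplicity of `X` at `(p)`, and
   `door5_mu_zero : … → ℓ_{(p)}(X) = 0 → span {G} ≤ ch(X)` — the shape of crux 20728 AS TYPED (no `p`-power);
 * §E17 the coefficient class is INHABITED by `WittVector p k` (`k` perfect, char `p`): `door5_wittVector`, `door5_explicit_wittVector`.
`ClassicalFibreBounds 𝒪 p 𝓟 X G` quantifies over complete DVRs `S` of characteristic zero FINITE over `𝒪` and roots `u₀ ∈ 𝔪_S` of the
members `P_n`; root data exist for every member (`rootDatumS`).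

OWED (`Door5.md` §§2,4): (G0)(i) the arithmetic frame over `Λ_{2,Ŵ′}`; (bc-1) flatness of `Λ₂ → Λ_{2,Ŵ′}` + (bc-4) (inputs of
`QtameBaseChange.charIdeal_baseChange_eq`); (V2)/(V1) at classical points, `ψ`-uniformly, with exact control; torsion of `X_Gr₂`;
for the crux AS TYPED `μ_{(p)} = 0` for `X_Gr₂ ⊗ Λ_{2,Ŵ′}` (ratlift MU0's analogue). Nothing arithmetic is proved here. Self-contained
by necessity (`Cruxes/**` is not importable on the farm; cap 200 000 B). Axioms `propext · Classical.choice · Quot.sound`; NO `sorry`.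
BSD is not proved by this file; no summit statement is proved by this seat.
-/

set_option autoImplicit false
set_option linter.dupNamespace false
set_option linter.unusedSectionVars false

open scoped Pointwise TensorProduct

namespace Summit.BirchSwinnertonDyer.BirchSwinnertonDyer.Cruxes.TwoVariableEulerSystemDivisibility.QtameDoor5O

open Literature.NumberTheory.EllipticCurves

/-! ## 0. (door 5 generic) COEFFICIENTS: an absolutely unramified complete DVR `𝒪` of residue characteristic `p`  … (full section note: `QtameDoor5.lean` v1.1) -/

/-- `Λ_{1,𝒪} = 𝒪⟦T⟧`. -/
abbrev Lam₁ (𝒪 : Type) [CommRing 𝒪] : Type := PowerSeries 𝒪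

/-- `Λ_{2,𝒪} = 𝒪⟦T₁⟧⟦T₂⟧` (outer variable `T₁`, inner `T₂`). -/
abbrev Lam₂ (𝒪 : Type) [CommRing 𝒪] : Type := PowerSeries (PowerSeries 𝒪)

section Coeff

variable {𝒪 : Type} [CommRing 𝒪] [IsDomain 𝒪] [IsDiscreteValuationRing 𝒪] {p : ℕ}
  [hϖ : Fact (Irreducible (p : 𝒪))]

theorem irreducible_p𝒪 : Irreducible (p : 𝒪) := hϖ.out

theorem prime_p𝒪 : Prime (p : 𝒪) := hϖ.out.prime

theorem maximalIdeal_eq_span_p𝒪 : IsLocalRing.maximalIdeal 𝒪 = Ideal.span {(p : 𝒪)} := hϖ.out.maximalIdeal_eq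

theorem not_isUnit_p𝒪 : ¬ IsUnit (p : 𝒪) := hϖ.out.not_isUnit

theorem natCast_p𝒪_ne_zero : (p : 𝒪) ≠ 0 := hϖ.out.ne_zero

theorem eq_unit_mul_pow_p𝒪 {c : 𝒪} (hc : c ≠ 0) : ∃ (n : ℕ) (u : 𝒪ˣ), c = u * (p : 𝒪) ^ n :=
  IsDiscreteValuationRing.eq_unit_mul_pow_irreducible hc hϖ.out

end Coeff

/-- `dim 𝒪⟦T⟧ = 2` (tree: `dim 𝒪⟦X₀,…,X_{n-1}⟧ = n + 1`). -/
theorem ringKrullDim_Lam₁ (𝒪 : Type) [CommRing 𝒪] [IsDomain 𝒪] [IsDiscreteValuationRing 𝒪] :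
    ringKrullDim (Lam₁ 𝒪) = ((2 : ℕ∞) : WithBot ℕ∞) := by
  have h := Literature.NumberTheory.GaloisRepresentations.NearlyOrdinaryPresentationCA.ringKrullDim_mvPowerSeries_dvr
    𝒪 1
  rw [ringKrullDim_eq_of_ringEquiv
    (MvPowerSeries.renameEquiv 𝒪 (Equiv.ofUnique (Fin 1) Unit)).toRingEquiv] at h
  refine h.trans ?_
  norm_cast


/-! ## 2. Fibres of the inner (anticyclotomic) variable over a coefficient ring `O` -/

section Fibres

variable (O : Type*) [CommRing O]

/-- The vertical prime of `O⟦T₂⟧⟦T₁⟧` through the point `u` of the inner disc: `T₂ - u`, via the constants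
embedding `C : O⟦T₂⟧ → O⟦T₂⟧⟦T₁⟧`. (`u = 0`: the KATO LINE.) -/
noncomputable def verticalPrimeO (u : O) : PowerSeries (PowerSeries O) :=
  PowerSeries.C (R := PowerSeries O) (PowerSeries.X - PowerSeries.C (R := O) u)

/-- The SECTION `O⟦T⟧ → O⟦T₂⟧⟦T₁⟧`, `T ↦ T₁` (outer variable), constants to constants. Composed with the
quotient by `(T₂ - u)` it is the isomorphism `O⟦T₂⟧⟦T₁⟧/(T₂ - u) ≅ O⟦T₁⟧`; it is the `Λ_cyc`-structure of a
qtame fibre. (NOT the constants map `PowerSeries.C`, which is the `Λ_ac`-structure used on the anticyclotomic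
line by the tree's Herbrand lemmas — SMUL-TRAP of `IwasawaAlgebraSpecialization`.) -/
noncomputable def fibreSection : PowerSeries O →+* PowerSeries (PowerSeries O) :=
  PowerSeries.map (PowerSeries.C (R := O))

/-- **Fibre bound at `u` with slack `p^t`**: `p^t · G(T₁,u) ∈ ch_{O⟦T₁⟧}(Y/(T₂-u)Y)`, written inside
`O⟦T₂⟧⟦T₁⟧` without an evaluation map: `p^t G ∈ ch(fibre)·(section) + (T₂ - u)`. This is what ONE rational
Euler-system argument over `ℚ_∞` for the fibre representation `V_f ⊗ Ind ψ_u⁻¹` plus EXACT fibre control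
delivers. v2: the engine is the `Λ_cyc`-adic form of Rubin's FUNCTIONAL-AT-`p` theorem (Euler Systems,
Thm 2.2.10; printed Greenberg-condition variant at finite level = LLZ14, arXiv:1311.0175, App. Thm 9.2.3);
Rubin's standard-structure Thm 2.3.3 is VACUOUS here because `d⁻(T_u) = 2 = rank_Λ H¹_Iw(ℚ, T_u)`. -/
def FibreBoundAt (p : ℕ) (Y : Type*) [AddCommGroup Y] [Module (PowerSeries (PowerSeries O)) Y]
    (G : PowerSeries (PowerSeries O)) (u : O) (t : ℕ) : Prop :=
  letI : Module (PowerSeries O) (QuotSMulTop (verticalPrimeO O u) Y) :=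
    Module.compHom _ (fibreSection O)
  (p : PowerSeries (PowerSeries O)) ^ t * G ∈
    (Literature.NumberTheory.EllipticCurves.Module.charIdeal (PowerSeries O)
        (QuotSMulTop (verticalPrimeO O u) Y)).map (fibreSection O) ⊔
      Ideal.span {verticalPrimeO O u}

end Fibres

/-- **Final patching (pure algebra over the UFD `Λ₂`, P4-fixed)**: if every height-one `𝔓 ∌ p` carries
exponent in `ch(X)` at most its exponent in `G`, then `(p^a · G) ⊆ ch(X)` for some `a` (`= μ(X)`).
(`ch(X) = ∏ 𝔓^{lengthAt}`.) PROVED below (v4.2, `patchingTarget_holds`) from the tree's `Module.charIdeal`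
and the tree's PROVED factoriality of `Λ₂` (Auslander–Buchsbaum). -/
def PatchingTarget (𝒪 : Type) [CommRing 𝒪] [IsDomain 𝒪] [IsDiscreteValuationRing 𝒪] [IsAdicComplete (IsLocalRing.maximalIdeal 𝒪) 𝒪] [CharZero 𝒪]
    (p : ℕ) [Fact p.Prime] [Fact (Irreducible (p : 𝒪))] (X : Type*) [AddCommGroup X]
    [Module (Lam₂ 𝒪) X] [Module.Finite (Lam₂ 𝒪) X] (G : Lam₂ 𝒪) : Prop :=
  Module.IsTorsion (Lam₂ 𝒪) X →
  (∀ 𝔓 : PrimeSpectrum (Lam₂ 𝒪), 𝔓.asIdeal.height = 1 →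
      (p : Lam₂ 𝒪) ∉ 𝔓.asIdeal →
      𝔓.asIdeal ^ (Literature.NumberTheory.EllipticCurves.Module.lengthAt
        (Lam₂ 𝒪) X 𝔓).toNat ∣ Ideal.span {G}) →
    ∃ a : ℕ, Ideal.span {(p : Lam₂ 𝒪) ^ a * G} ≤
      Literature.NumberTheory.EllipticCurves.Module.charIdeal (Lam₂ 𝒪) X

/-! ## 5. NEW: vertical primes by p-adic approximation from neighbouring fibres (model case `u ∈ ℤ_p`) -/

/-! ### E0.1 Good primes of `Λ₁` (sketch §9.1) and the Props (FT), (LB) (sketch §9.3) -/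

section GoodPrimes

variable {𝒪 : Type} [CommRing 𝒪] [IsDomain 𝒪] [IsDiscreteValuationRing 𝒪] [IsAdicComplete (IsLocalRing.maximalIdeal 𝒪) 𝒪] [CharZero 𝒪]
  {p : ℕ} [Fact p.Prime] [Fact (Irreducible (p : 𝒪))]

theorem C_dvd_of_forall_dvd_coeff {R : Type*} [CommRing R] {a : R} {w : PowerSeries R}
    (h : ∀ n, a ∣ PowerSeries.coeff n w) : PowerSeries.C a ∣ w := by
  choose q hq using h
  refine ⟨PowerSeries.mk q, PowerSeries.ext fun n => ?_⟩
  rw [PowerSeries.coeff_C_mul, PowerSeries.coeff_mk, hq n]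

/-- `C a ∣ w` in `R⟦X⟧` forces `a ∣ coeff n w` for every `n`. -/
theorem dvd_coeff_of_C_dvd {R : Type*} [CommRing R] {a : R} {w : PowerSeries R}
    (h : PowerSeries.C a ∣ w) (n : ℕ) : a ∣ PowerSeries.coeff n w := by
  obtain ⟨q, rfl⟩ := h
  exact ⟨PowerSeries.coeff n q, by rw [PowerSeries.coeff_C_mul]⟩

/-! ### 9.1 Points: prime elements `P ∤ p` of `Λ₁ = ℤ_p⟦T₂⟧` and the finite `ℤ_p`-orders `O_P = Λ₁/(P)` -/

/-- A **good prime** of `Λ₁ = ℤ_p⟦T₂⟧`: a prime element not dividing `p` (equivalently: associated to a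
distinguished irreducible polynomial). Its residue ring `O_P = Λ₁/(P)` is a finite `ℤ_p`-order and a domain of
characteristic zero, and `u_P := T₂ mod P` is a non-unit of `O_P`: these are the algebraic points fed to
`PatchingBeta`. -/
structure GoodPrime (𝒪 : Type) [CommRing 𝒪] (p : ℕ) where
  /-- the prime element -/
  P : Lam₁ 𝒪
  prime : Prime P
  not_dvd : ¬ P ∣ (p : Lam₁ 𝒪)

namespace GoodPrime

variable (P : GoodPrime 𝒪 p)

/-- `O_P = Λ₁/(P)`. -/
abbrev O : Type := Lam₁ 𝒪 ⧸ Ideal.span {P.P}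

theorem span_isPrime : (Ideal.span {P.P}).IsPrime :=
  (Ideal.span_singleton_prime P.prime.ne_zero).mpr P.prime

instance : (Ideal.span {P.P}).IsPrime := P.span_isPrime

instance : IsDomain P.O := Ideal.Quotient.isDomain _

theorem not_isUnit : ¬ IsUnit P.P := P.prime.not_unit

/-- `P` divides no non-zero constant. -/
theorem not_dvd_C {c : 𝒪} (hc : c ≠ 0) : ¬ P.P ∣ PowerSeries.C c := by
  intro h
  obtain ⟨n, w, hc'⟩ := eq_unit_mul_pow_p𝒪 (𝒪 := 𝒪) (p := p) hc
  rw [hc', map_mul, map_pow, map_natCast] at h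
  have h1 : P.P ∣ (p : Lam₁ 𝒪) ^ n :=
    ((P.prime.dvd_or_dvd h).resolve_left fun h' => P.not_isUnit
      (isUnit_of_dvd_unit h' (w.isUnit.map _)))
  exact P.not_dvd (P.prime.dvd_of_dvd_pow h1)

theorem algebraMap_injective : Function.Injective (algebraMap 𝒪 P.O) := by
  rw [injective_iff_map_eq_zero]
  intro c hc
  by_contra h0
  rw [← Ideal.Quotient.mk_algebraMap, Ideal.Quotient.eq_zero_iff_mem, Ideal.mem_span_singleton,
    ← PowerSeries.C_eq_algebraMap] at hc
  exact P.not_dvd_C h0 hc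

instance : CharZero P.O := charZero_of_injective_algebraMap P.algebraMap_injective

theorem not_isUnit_p : ¬ IsUnit (p : Lam₁ 𝒪) := by
  rw [show (p : Lam₁ 𝒪) = PowerSeries.C (p : 𝒪) by rw [map_natCast],
    PowerSeries.isUnit_iff_constantCoeff, PowerSeries.constantCoeff_C]
  exact (not_isUnit_p𝒪 (𝒪 := 𝒪) (p := p))

/-- `P mod p ≠ 0` (as `P ∤ p` and `P` is prime). -/
theorem map_residue_ne_zero : (P.P).map (IsLocalRing.residue 𝒪) ≠ 0 := by
  intro h
  have hcoeff : ∀ n, (p : 𝒪) ∣ PowerSeries.coeff n P.P := by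
    intro n
    have := congrArg (PowerSeries.coeff n) h
    rw [PowerSeries.coeff_map, map_zero, IsLocalRing.residue_eq_zero_iff,
      (maximalIdeal_eq_span_p𝒪 (𝒪 := 𝒪) (p := p)), Ideal.mem_span_singleton] at this
    exact this
  have hdvd : (p : Lam₁ 𝒪) ∣ P.P := by
    have := C_dvd_of_forall_dvd_coeff hcoeff
    rwa [map_natCast] at this
  obtain ⟨Q, hQ⟩ := hdvd
  rcases P.prime.dvd_or_dvd (dvd_of_eq hQ) with h1 | h1
  · exact P.not_dvd h1
  · obtain ⟨R, hR⟩ := h1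
    apply not_isUnit_p (𝒪 := 𝒪) (p := p)
    have h2 : P.P * 1 = P.P * ((p : Lam₁ 𝒪) * R) := by
      rw [mul_one, mul_left_comm, ← hR]; exact hQ
    exact IsUnit.of_mul_eq_one R (mul_left_cancel₀ P.prime.ne_zero h2).symm

/-- The Weierstrass factorisation `P = f · h` over `ℤ_p` (`f` distinguished, `h` a unit). -/
theorem isWeierstrassFactorization :
    (P.P).IsWeierstrassFactorization ((P.P).weierstrassDistinguished P.map_residue_ne_zero)
      ((P.P).weierstrassUnit P.map_residue_ne_zero) :=
  PowerSeries.isWeierstrassFactorization_weierstrassDistinguished_weierstrassUnit P.map_residue_ne_zero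

/-- `O_P` is a finite `ℤ_p`-module (Weierstrass preparation: `Λ₁/(P) ≅ ℤ_p[X]/(f)`, `f` distinguished). -/
instance moduleFinite : Module.Finite 𝒪 P.O := by
  have H := P.isWeierstrassFactorization
  have hf : ((P.P).weierstrassDistinguished P.map_residue_ne_zero).Monic := H.isDistinguishedAt.monic
  haveI : Module.Finite 𝒪
      (Polynomial 𝒪 ⧸ Ideal.span {(P.P).weierstrassDistinguished P.map_residue_ne_zero}) :=
    Module.Finite.of_basis (AdjoinRoot.powerBasis' hf).basis
  exact Module.Finite.equiv H.algEquivQuotient.toLinearEquiv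

/-- The point `u_P = T₂ mod P ∈ O_P`. -/
noncomputable def u : P.O := Ideal.Quotient.mk _ PowerSeries.X

end GoodPrime

variable (𝒪 p) in
/-- Reduction of coefficients `Λ₁⟦T⟧ → O_P⟦T⟧`. -/
noncomputable def redP (P : GoodPrime 𝒪 p) : PowerSeries (Lam₁ 𝒪) →+* PowerSeries P.O :=
  PowerSeries.map (Ideal.Quotient.mk (Ideal.span {P.P}))

theorem redP_apply (P : GoodPrime 𝒪 p) (F : PowerSeries (Lam₁ 𝒪)) :
    redP 𝒪 p P F = PowerSeries.map (Ideal.Quotient.mk (Ideal.span {P.P})) F := rfl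

theorem C_dvd_of_redP_eq_zero (P : GoodPrime 𝒪 p) {F : PowerSeries (Lam₁ 𝒪)} (hF : redP 𝒪 p P F = 0) :
    PowerSeries.C P.P ∣ F := by
  apply C_dvd_of_forall_dvd_coeff
  intro n
  have := congrArg (PowerSeries.coeff n) hF
  rwa [redP_apply, PowerSeries.coeff_map, map_zero, Ideal.Quotient.eq_zero_iff_mem,
    Ideal.mem_span_singleton] at this

/-- `ker (Λ₂ → O_P⟦T⟧) = P·Λ₂`. -/
theorem ker_redP (P : GoodPrime 𝒪 p) :
    RingHom.ker (redP 𝒪 p P) = Ideal.span {(PowerSeries.C P.P : Lam₂ 𝒪)} := by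
  refine le_antisymm (fun F hF => Ideal.mem_span_singleton.mpr (C_dvd_of_redP_eq_zero P hF)) ?_
  rw [Ideal.span_le, Set.singleton_subset_iff, SetLike.mem_coe, RingHom.mem_ker, redP_apply,
    PowerSeries.map_C, Ideal.Quotient.eq_zero_iff_mem.mpr (Ideal.mem_span_singleton_self _), map_zero]

theorem GoodPrime.C_ne_zero (P : GoodPrime 𝒪 p) : (PowerSeries.C P.P : Lam₂ 𝒪) ≠ 0 := by
  intro h
  have := congrArg (PowerSeries.constantCoeff (R := Lam₁ 𝒪)) h
  rw [PowerSeries.constantCoeff_C, map_zero] at this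
  exact P.prime.ne_zero this

/-- `P` stays prime in `Λ₂ = Λ₁⟦T₁⟧`: `Λ₂/PΛ₂ ≅ O_P⟦T₁⟧` is a domain. -/
theorem GoodPrime.prime_C (P : GoodPrime 𝒪 p) : Prime (PowerSeries.C P.P : Lam₂ 𝒪) := by
  rw [← Ideal.span_singleton_prime P.C_ne_zero, ← ker_redP]
  exact RingHom.ker_isPrime _

theorem natCast_p_eq_C : (p : Lam₂ 𝒪) = PowerSeries.C (p : Lam₁ 𝒪) :=
  (map_natCast (PowerSeries.C (R := Lam₁ 𝒪)) p).symm

variable (𝒪 p)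

/-- The fibre bound of `PatchingBeta`'s hypothesis over a coefficient ring `O`, for `Λ_{2,O} ⊗_{Λ₂} X` and
the image of `G` (the `letI`-algebra structure and tensor product exactly as in `PatchingBeta`). -/
def FibreBoundOver (O : Type) [CommRing O] [Algebra 𝒪 O] (X : Type) [AddCommGroup X]
    [Module (Lam₂ 𝒪) X] (G : Lam₂ 𝒪) (u : O) (t : ℕ) : Prop :=
  letI : Algebra (Lam₂ 𝒪) (PowerSeries (PowerSeries O)) :=
    (PowerSeries.map (PowerSeries.map (algebraMap 𝒪 O))).toAlgebra
  FibreBoundAt O p ((PowerSeries (PowerSeries O)) ⊗[Lam₂ 𝒪] X)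
    (PowerSeries.map (PowerSeries.map (algebraMap 𝒪 O)) G) u t

variable {p}

end GoodPrimes

/-! ## E1. The quantitative local endgame (PROVED)  … (full section note: `QtameDoor5.lean` v1.1) -/

section Endgame

open Summit.BirchSwinnertonDyer.BirchSwinnertonDyer.Theorems.SignedBaseChangeAcDivSpecialization

variable {A : Type*} [CommRing A] [IsNoetherianRing A] [IsDomain A]

/-- `n ≤ ℓ_𝔮(A/𝔮^n)` for a non-zero prime `𝔮` of a Noetherian domain (verbatim from the sketch §9.5). -/
theorem natCast_le_lengthAt_quotient_pow (𝔮 : PrimeSpectrum A) (h𝔮 : 𝔮.asIdeal ≠ ⊥) (n : ℕ) :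
    (n : ℕ∞) ≤ Module.lengthAt A (A ⧸ 𝔮.asIdeal ^ n) 𝔮 := by
  classical
  induction n with
  | zero => simp
  | succ n ih =>
    have hST : 𝔮.asIdeal ^ (n + 1) ≤ 𝔮.asIdeal ^ n := Ideal.pow_le_pow_right (Nat.le_succ n)
    -- the layer `K = 𝔮^n/𝔮^(n+1) ⊆ A/𝔮^(n+1)`
    let K : Submodule A (A ⧸ 𝔮.asIdeal ^ (n + 1)) :=
      Submodule.map (𝔮.asIdeal ^ (n + 1)).mkQ (𝔮.asIdeal ^ n)
    have hsplit := Module.lengthAt_eq_add_quotient (R := A) (M := A ⧸ 𝔮.asIdeal ^ (n + 1)) K 𝔮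
    have hquot : Module.lengthAt A ((A ⧸ 𝔮.asIdeal ^ (n + 1)) ⧸ K) 𝔮 =
        Module.lengthAt A (A ⧸ 𝔮.asIdeal ^ n) 𝔮 :=
      Module.lengthAt_eq_of_linearEquiv
        (Submodule.quotientQuotientEquivQuotient (𝔮.asIdeal ^ (n + 1)) (𝔮.asIdeal ^ n) hST) 𝔮
    -- the layer is non-zero at `𝔮`
    have hK : Module.lengthAt A K 𝔮 ≠ 0 := by
      intro h0
      obtain ⟨u, hu, huK⟩ := LocalLength.exists_notMem_forall_smul_eq_zero_of_lengthAt_eq_zero h0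
      -- `u • 𝔮^n ⊆ 𝔮^(n+1)`
      have hincl : ∀ x ∈ 𝔮.asIdeal ^ n, u * x ∈ 𝔮.asIdeal ^ (n + 1) := by
        intro x hx
        have h := congrArg Subtype.val
          (huK ⟨(𝔮.asIdeal ^ (n + 1)).mkQ x, Submodule.mem_map_of_mem (f := (𝔮.asIdeal ^ (n + 1)).mkQ) hx⟩)
        simp only [Submodule.coe_smul, ZeroMemClass.coe_zero, Submodule.mkQ_apply] at h
        rw [← Submodule.Quotient.mk_smul, Submodule.Quotient.mk_eq_zero, smul_eq_mul] at h
        exact h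
      -- so `𝔮^n` (a finitely generated torsion-free module) is zero at `𝔮`: absurd
      have hT0 : Module.lengthAt A ↥(𝔮.asIdeal ^ n) 𝔮 = 0 := by
        refine LocalLength.lengthAt_eq_zero_of_forall_exists_notMem 𝔮 fun m => ⟨u, hu, ?_⟩
        rw [Submodule.mem_smul_top_iff, Submodule.coe_smul, Ideal.smul_eq_mul, ← pow_succ']
        exact hincl m m.2
      obtain ⟨w, hw, hwT⟩ := LocalLength.exists_notMem_forall_smul_eq_zero_of_lengthAt_eq_zero hT0
      obtain ⟨a, ha, ha0⟩ := Submodule.exists_mem_ne_zero_of_ne_bot h𝔮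
      have h2 := congrArg Subtype.val (hwT ⟨a ^ n, Ideal.pow_mem_pow ha n⟩)
      simp only [Submodule.coe_smul, ZeroMemClass.coe_zero, smul_eq_mul] at h2
      rcases mul_eq_zero.mp h2 with h3 | h3
      · exact hw (h3 ▸ 𝔮.asIdeal.zero_mem)
      · exact pow_ne_zero n ha0 h3
    calc ((n + 1 : ℕ) : ℕ∞) = (n : ℕ∞) + 1 := by push_cast; rfl
      _ ≤ Module.lengthAt A (A ⧸ 𝔮.asIdeal ^ n) 𝔮 + Module.lengthAt A K 𝔮 :=
          add_le_add ih (Order.one_le_iff_ne_zero.mpr hK)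
      _ = Module.lengthAt A (A ⧸ 𝔮.asIdeal ^ (n + 1)) 𝔮 := by rw [hsplit, hquot, add_comm]

end Endgame

/-! ## E3. The prime `𝔔̄_Q = (p, T₂)/(Q)` of `Λ₂/(Q)` (PROVED)  … (full section note: `QtameDoor5.lean` v1.1) -/

section KerResidue

open Literature.NumberTheory.IwasawaTheory

variable {𝒪 p}

/-- In a Noetherian ring: a prime strictly above a principal prime `(π)`, `π` a non-zero-divisor, has
height `≥ 2` (sketch §9.7). -/
theorem two_le_height_of_span_lt {R : Type*} [CommRing R] [IsNoetherianRing R] {π : R}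
    (hπ : π ∈ nonZeroDivisors R) [(Ideal.span {π}).IsPrime] {𝔔 : Ideal R} [𝔔.IsPrime]
    (hlt : Ideal.span {π} < 𝔔) : (2 : ℕ∞) ≤ 𝔔.height := by
  have h1 := Ideal.one_le_height_span_singleton_of_mem_nonZeroDivisors hπ
  have h2 := Ideal.height_strict_mono_of_isPrime hlt
  calc (2 : ℕ∞) = 1 + 1 := one_add_one_eq_two.symm
    _ ≤ (Ideal.span {π}).height + 1 := add_le_add h1 le_rfl
    _ ≤ 𝔔.height := Order.add_one_le_of_lt h2

end KerResidue

/-! ## E6. Classification of the height-one primes `𝔓 ∌ p` and the END-TO-END engine (PROVED)  … (full section note: `QtameDoor5.lean` v1.1) -/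

section Engine

variable {𝒪 : Type} [CommRing 𝒪] [IsDomain 𝒪] [IsDiscreteValuationRing 𝒪] [IsAdicComplete (IsLocalRing.maximalIdeal 𝒪) 𝒪] [CharZero 𝒪]
  {p : ℕ} [Fact p.Prime] [Fact (Irreducible (p : 𝒪))]

variable (𝒪 p) in
/-- **(FT_P) Fibre torsion at the good prime `P`**: the fibre `X/(C P)X` is killed by some `s ∉ (C P)` — the
First lemma's hypothesis (at `P = T₂` this is the torsion of `X(K_Δ)`, supplied by Kato, sketch §G′/§H.2). -/
def FibreTorsionAt (P : GoodPrime 𝒪 p) (X : Type) [AddCommGroup X] [Module (Lam₂ 𝒪) X] : Prop :=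
  ∃ s : Lam₂ 𝒪, s ∉ Ideal.span {(PowerSeries.C P.P : Lam₂ 𝒪)} ∧
    ∀ x : X, s • x ∈ (PowerSeries.C P.P : Lam₂ 𝒪) • (⊤ : Submodule (Lam₂ 𝒪) X)

end Engine

/-! ## E8 (v1.2, g16). THE DEPTH CURRENCY — CGLS20 §3.4 one dimension up  … (full section note: `QtameDoor5.lean` v1.1) -/

section DepthCurrency

variable {𝒪 : Type} [CommRing 𝒪] [IsDomain 𝒪] [IsDiscreteValuationRing 𝒪] [IsAdicComplete (IsLocalRing.maximalIdeal 𝒪) 𝒪] [CharZero 𝒪]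
  {p : ℕ} [Fact p.Prime] [Fact (Irreducible (p : 𝒪))]

/-- **(XS)** A finitely generated `Λ₂`-module one of whose fibres `X/(C P)X` is killed by some `s ∉ (C P)` is
`Λ₂`-torsion: Cayley–Hamilton for the endomorphism `s•` (range in `(C P)·X`) gives a monic relation
`d := q(s) = s^n + ((C P)-multiples)` with `d ∉ (C P)` (prime) and `d·X = 0`. -/
theorem isTorsion_of_fibreTorsionAt' (P : GoodPrime 𝒪 p) (X : Type) [AddCommGroup X]
    [Module (Lam₂ 𝒪) X] [Module.Finite (Lam₂ 𝒪) X] (h : FibreTorsionAt 𝒪 p P X) :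
    Module.IsTorsion (Lam₂ 𝒪) X := by
  classical
  obtain ⟨s, hs, hsX⟩ := h
  set π : Lam₂ 𝒪 := PowerSeries.C P.P with hπ
  set I : Ideal (Lam₂ 𝒪) := Ideal.span {π} with hI
  haveI hIp : I.IsPrime := (Ideal.span_singleton_prime P.prime_C.ne_zero).mpr P.prime_C
  let f : Module.End (Lam₂ 𝒪) X := algebraMap (Lam₂ 𝒪) (Module.End (Lam₂ 𝒪) X) s
  have hf : LinearMap.range f ≤ I • ⊤ := by
    rintro _ ⟨x, rfl⟩
    rw [Module.algebraMap_end_apply, hI, Submodule.ideal_span_singleton_smul]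
    exact hsX x
  obtain ⟨q, hmonic, -, hcoeff, hq⟩ :=
    LinearMap.exists_monic_and_natDegree_eq_and_coeff_mem_pow_and_aeval_eq_zero (Lam₂ 𝒪) f I hf
  set d : Lam₂ 𝒪 := q.eval s with hd
  have hdX : ∀ x : X, d • x = 0 := by
    intro x
    have h1 : Polynomial.aeval f q = algebraMap (Lam₂ 𝒪) (Module.End (Lam₂ 𝒪) X) d :=
      Polynomial.aeval_algebraMap_apply_eq_algebraMap_eval s q
    have h2 := congrArg (fun g : Module.End (Lam₂ 𝒪) X => g x) hq
    simpa only [h1, Module.algebraMap_end_apply, LinearMap.zero_apply] using h2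
  -- `d - s^n ∈ I`
  have hdiff : d - s ^ q.natDegree ∈ I := by
    rw [hd, Polynomial.eval_eq_sum_range, Finset.sum_range_succ, hmonic.coeff_natDegree, one_mul,
      add_sub_cancel_right]
    refine I.sum_mem fun k hk => ?_
    have hk' : k < q.natDegree := Finset.mem_range.mp hk
    exact I.mul_mem_right _ (Ideal.pow_le_self (by omega) (hcoeff k))
  have hd0 : d ∉ I := by
    intro hdI
    have hsn : s ^ q.natDegree ∈ I := by
      have := I.sub_mem hdI hdiff
      rwa [sub_sub_cancel] at this
    exact hs (hIp.mem_of_pow_mem _ hsn)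
  have hdne : d ≠ 0 := by
    rintro h0
    exact hd0 (h0 ▸ I.zero_mem)
  intro x
  exact ⟨⟨d, mem_nonZeroDivisors_of_ne_zero hdne⟩, hdX x⟩

end DepthCurrency

/-! ## E9 (v1.3, g17). THE S-DOOR: the vertical input over COMPLETE DVR coefficient rings (PROVED)  … (full section note: `QtameDoor5.lean` v1.1) -/

set_option linter.unusedSectionVars false

/-! ### E9.1 (LB) over any Noetherian domain — the sketch's §9.6, verbatim (namespace `LB`) -/

section LowerBoundGeneric

namespace LB

section LowerBoundProof

open Summit.BirchSwinnertonDyer.BirchSwinnertonDyer.Theorems.SignedBaseChangeAcDivSpecialization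

variable {R : Type*} [CommRing R]

/-- `R → R̄ → N/sN`: scalar tower for the `R̄`-module structure of `N/sN`. -/
theorem isScalarTower_quotSMulTop (a : R) (N : Type*) [AddCommGroup N] [Module R N] :
    IsScalarTower R (R ⧸ Ideal.span {a}) (QuotSMulTop a N) :=
  ⟨fun r b m => by
    obtain ⟨b, rfl⟩ := Ideal.Quotient.mk_surjective b
    obtain ⟨x, rfl⟩ := Submodule.mkQ_surjective _ m
    show (r * b) • (Submodule.Quotient.mk x : QuotSMulTop a N) =
      r • b • (Submodule.Quotient.mk x : QuotSMulTop a N)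
    rw [mul_smul]⟩

/-- `R → R̄ → N[s]`: scalar tower for the `R̄`-module structure of the `s`-torsion. -/
theorem isScalarTower_torsionBy (a : R) (N : Type*) [AddCommGroup N] [Module R N] :
    IsScalarTower R (R ⧸ Ideal.span {a}) (Submodule.torsionBy R N a) :=
  ⟨fun r b m => by
    obtain ⟨b, rfl⟩ := Ideal.Quotient.mk_surjective b
    show (r * b) • m = r • b • m
    rw [mul_smul]⟩

/-- The snake for multiplication by `a` read over `R̄ = R/(a)` (six-term length identity at a prime of `R̄`;
port of the tree's `LocalLength.lengthAt_smul_snake`). -/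
theorem lengthAt_quot_snake (a : R) {N₁ N₂ N₃ : Type*} [AddCommGroup N₁] [Module R N₁]
    [AddCommGroup N₂] [Module R N₂] [AddCommGroup N₃] [Module R N₃]
    (f : N₁ →ₗ[R] N₂) (g : N₂ →ₗ[R] N₃) (hf : Function.Injective f) (hg : Function.Surjective g)
    (hfg : Function.Exact f g) (𝔔 : PrimeSpectrum (R ⧸ Ideal.span {a})) :
    Module.lengthAt (R ⧸ Ideal.span {a}) (Submodule.torsionBy R N₂ a) 𝔔 +
        Module.lengthAt (R ⧸ Ideal.span {a}) (QuotSMulTop a N₁) 𝔔 +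
        Module.lengthAt (R ⧸ Ideal.span {a}) (QuotSMulTop a N₃) 𝔔 =
      Module.lengthAt (R ⧸ Ideal.span {a}) (Submodule.torsionBy R N₁ a) 𝔔 +
        Module.lengthAt (R ⧸ Ideal.span {a}) (Submodule.torsionBy R N₃ a) 𝔔 +
        Module.lengthAt (R ⧸ Ideal.span {a}) (QuotSMulTop a N₂) 𝔔 := by
  haveI := isScalarTower_torsionBy a N₁
  haveI := isScalarTower_torsionBy a N₂
  haveI := isScalarTower_torsionBy a N₃
  haveI := isScalarTower_quotSMulTop a N₁
  haveI := isScalarTower_quotSMulTop a N₂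
  haveI := isScalarTower_quotSMulTop a N₃
  have hsurj : Function.Surjective (algebraMap R (R ⧸ Ideal.span {a})) := Ideal.Quotient.mk_surjective
  have hsq₁ : f.comp (DistribSMul.toLinearMap R N₁ a) = (DistribSMul.toLinearMap R N₂ a).comp f := by
    ext; simp
  have hsq₂ : g.comp (DistribSMul.toLinearMap R N₂ a) = (DistribSMul.toLinearMap R N₃ a).comp g := by
    ext; simp
  let δ := SnakeLemma.δ' (DistribSMul.toLinearMap R N₁ a) (DistribSMul.toLinearMap R N₂ a)
    (DistribSMul.toLinearMap R N₃ a) f g hfg f g hfg hsq₁ hsq₂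
    (Submodule.torsionBy R N₃ a).subtype (Literature.RingTheory.Length.exact_subtype_smulMap a N₃)
    (Submodule.mkQ (a • ⊤)) (Literature.RingTheory.Length.exact_smulMap_mkQ a N₁) hg hf
  have e₁ : Function.Injective (f.restrict (Literature.RingTheory.Length.mapsTo_torsionBy a f)) :=
    Literature.RingTheory.Length.restrict_torsionBy_injective a f hf
  have e₂ := Literature.RingTheory.Length.exact_restrict_torsionBy a f g hf hfg
  have e₃ : Function.Exact (g.restrict (Literature.RingTheory.Length.mapsTo_torsionBy a g)) δ :=
    SnakeLemma.exact_δ'_right (DistribSMul.toLinearMap R N₁ a) (DistribSMul.toLinearMap R N₂ a)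
      (DistribSMul.toLinearMap R N₃ a) f g hfg f g hfg hsq₁ hsq₂
      (Submodule.torsionBy R N₂ a).subtype (Literature.RingTheory.Length.exact_subtype_smulMap a N₂)
      (Submodule.torsionBy R N₃ a).subtype (Literature.RingTheory.Length.exact_subtype_smulMap a N₃)
      (Submodule.mkQ (a • ⊤)) (Literature.RingTheory.Length.exact_smulMap_mkQ a N₁) hg hf
      (g.restrict (Literature.RingTheory.Length.mapsTo_torsionBy a g)) rfl
      (Submodule.injective_subtype _)
  have e₄ : Function.Exact δ (QuotSMulTop.map a f) :=
    SnakeLemma.exact_δ'_left (DistribSMul.toLinearMap R N₁ a) (DistribSMul.toLinearMap R N₂ a)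
      (DistribSMul.toLinearMap R N₃ a) f g hfg f g hfg hsq₁ hsq₂
      (Submodule.torsionBy R N₃ a).subtype (Literature.RingTheory.Length.exact_subtype_smulMap a N₃)
      (Submodule.mkQ (a • ⊤)) (Literature.RingTheory.Length.exact_smulMap_mkQ a N₁)
      (Submodule.mkQ (a • ⊤)) (Literature.RingTheory.Length.exact_smulMap_mkQ a N₂) hg hf
      (QuotSMulTop.map a f) (QuotSMulTop.map_comp_mkQ a f) (Submodule.mkQ_surjective _)
  have e₅ := QuotSMulTop.map_exact a hfg hg
  have e₆ := QuotSMulTop.map_surjective a hg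
  exact LocalLength.lengthAt_six_term
    ((f.restrict (Literature.RingTheory.Length.mapsTo_torsionBy a f)).extendScalarsOfSurjective hsurj)
    ((g.restrict (Literature.RingTheory.Length.mapsTo_torsionBy a g)).extendScalarsOfSurjective hsurj)
    (δ.extendScalarsOfSurjective hsurj) ((QuotSMulTop.map a f).extendScalarsOfSurjective hsurj)
    ((QuotSMulTop.map a g).extendScalarsOfSurjective hsurj) e₁ e₂ e₃ e₄ e₅ e₆ 𝔔

/-- On a module `N ≃ R/𝔮`, every `q ∈ 𝔮` acts as `0`. -/
theorem smul_eq_zero_of_equiv_quotient {N : Type*} [AddCommGroup N] [Module R N] {𝔮 : Ideal R}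
    (e : N ≃ₗ[R] R ⧸ 𝔮) {q : R} (hq : q ∈ 𝔮) (x : N) : q • x = 0 := by
  apply e.injective
  rw [map_smul, map_zero, ← IsScalarTower.algebraMap_smul (R ⧸ 𝔮) q (e x), smul_eq_mul,
    Ideal.Quotient.algebraMap_eq, Ideal.Quotient.eq_zero_iff_mem.mpr hq, zero_mul]

/-- On a module `N ≃ R/𝔮`, an element acting as `0` lies in `𝔮`. -/
theorem mem_of_equiv_quotient {N : Type*} [AddCommGroup N] [Module R N] {𝔮 : Ideal R}
    (e : N ≃ₗ[R] R ⧸ 𝔮) {q : R} (hq : ∀ x : N, q • x = 0) : q ∈ 𝔮 := by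
  have h := congrArg e (hq (e.symm (Ideal.Quotient.mk 𝔮 1)))
  rw [map_smul, LinearEquiv.apply_symm_apply, map_zero,
    ← IsScalarTower.algebraMap_smul (R ⧸ 𝔮) q, smul_eq_mul, Ideal.Quotient.algebraMap_eq, ← map_mul,
    mul_one, Ideal.Quotient.eq_zero_iff_mem] at h
  exact h

/-- `R/𝔮` for `t ∉ 𝔮` (prime) has no `t`-torsion. -/
theorem subsingleton_torsionBy_of_equiv_quotient {t : R} {N : Type*} [AddCommGroup N] [Module R N]
    {𝔮 : Ideal R} (h𝔮 : 𝔮.IsPrime) (e : N ≃ₗ[R] R ⧸ 𝔮) (htq : t ∉ 𝔮) :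
    Subsingleton (Submodule.torsionBy R N t) := by
  have hz : ∀ z : Submodule.torsionBy R N t, z = 0 := by
    intro ⟨z, hz⟩
    rw [Submodule.mem_torsionBy_iff] at hz
    obtain ⟨r, hr⟩ := Ideal.Quotient.mk_surjective (e z)
    have h0 : t • e z = 0 := by rw [← map_smul, hz, map_zero]
    rw [← hr, ← IsScalarTower.algebraMap_smul (R ⧸ 𝔮) t, smul_eq_mul, Ideal.Quotient.algebraMap_eq,
      ← map_mul, Ideal.Quotient.eq_zero_iff_mem] at h0
    have hr𝔮 : r ∈ 𝔮 := (h𝔮.mem_or_mem h0).resolve_left htq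
    have hez : e z = 0 := by rw [← hr, Ideal.Quotient.eq_zero_iff_mem.mpr hr𝔮]
    exact Subtype.ext ((map_eq_zero_iff e e.injective).mp hez)
  exact ⟨fun x y => by rw [hz x, hz y]⟩

/-- `ℓ_𝔔(N[s]) < ∞` over `R̄ = R/(s)` for `N` finitely generated and killed by `c`, `s ∤ c`, `ht 𝔔 = 1`:
`N[s]` is a finitely generated `R̄`-module killed by `c̄ ≠ 0`. -/
theorem lengthAt_torsionBy_ne_top [IsNoetherianRing R] {s c : R} (hs : Prime s) (hsc : ¬ s ∣ c)
    (𝔔 : PrimeSpectrum (R ⧸ Ideal.span {s})) (hht : 𝔔.asIdeal.height = 1)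
    (N : Type*) [AddCommGroup N] [Module R N] [Module.Finite R N] (hcN : ∀ x : N, c • x = 0) :
    Module.lengthAt (R ⧸ Ideal.span {s}) (Submodule.torsionBy R N s) 𝔔 ≠ ⊤ := by
  haveI : (Ideal.span {s}).IsPrime := (Ideal.span_singleton_prime hs.ne_zero).mpr hs
  haveI := isScalarTower_torsionBy s N
  haveI : Module.Finite (R ⧸ Ideal.span {s}) (Submodule.torsionBy R N s) :=
    Module.Finite.of_restrictScalars_finite R _ _
  have hcbar : Ideal.Quotient.mk (Ideal.span {s}) c ≠ 0 := by
    rw [Ne, Ideal.Quotient.eq_zero_iff_mem, Ideal.mem_span_singleton]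
    exact hsc
  refine Module.lengthAt_ne_top_of_isTorsionBy hcbar (fun x => ?_) 𝔔 hht.le
  show c • x = 0
  exact Subtype.ext (by rw [Submodule.coe_smul, ZeroMemClass.coe_zero]; exact hcN x)

variable [IsNoetherianRing R] [IsDomain R]

/-- Bookkeeping in `ℕ∞` for the exact case of the dévissage. -/
theorem enat_devissage_step {E₁ E₃ m B₁ B₂ B₃ A₁ A₂ A₃ : ℕ∞} (I₁ : E₁ * m + B₁ ≤ A₁)
    (I₃ : E₃ * m + B₃ ≤ A₃) (six : B₂ + A₁ + A₃ = B₁ + B₃ + A₂) (h₁ : B₁ ≠ ⊤) (h₃ : B₃ ≠ ⊤) :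
    (E₁ + E₃) * m + B₂ ≤ A₂ := by
  have hB : B₁ + B₃ ≠ ⊤ := WithTop.add_ne_top.mpr ⟨h₁, h₃⟩
  rw [← ENat.add_le_add_iff_right hB]
  calc (E₁ + E₃) * m + B₂ + (B₁ + B₃) = (E₁ * m + B₁) + (E₃ * m + B₃) + B₂ := by ring
    _ ≤ A₁ + A₃ + B₂ := add_le_add (add_le_add I₁ I₃) le_rfl
    _ = B₂ + A₁ + A₃ := by ring
    _ = B₁ + B₃ + A₂ := six
    _ = A₂ + (B₁ + B₃) := by ring

end LowerBoundProof

end LB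

end LowerBoundGeneric

/-! ### E9.2 Evaluation at a point of `𝔪_S` of a complete local ring `S` (Weierstrass division by `T - u`) -/

section EvalS

variable {S : Type} [CommRing S] [IsLocalRing S] [IsAdicComplete (IsLocalRing.maximalIdeal S) S]

/-- `T - u` is distinguished for `u ∈ 𝔪_S`. -/
theorem isDistinguishedAt_X_sub_C {u : S} (hu : u ∈ IsLocalRing.maximalIdeal S) :
    (Polynomial.X - Polynomial.C u).IsDistinguishedAt (IsLocalRing.maximalIdeal S) := by
  refine ⟨⟨fun {n} hn => ?_⟩, Polynomial.monic_X_sub_C _⟩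
  rw [Polynomial.natDegree_X_sub_C, Nat.lt_one_iff] at hn
  subst hn
  rwa [Polynomial.coeff_sub, Polynomial.coeff_X_zero, Polynomial.coeff_C_zero, zero_sub, neg_mem_iff]

theorem coe_X_sub_C (u : S) :
    ((Polynomial.X - Polynomial.C u : Polynomial S) : PowerSeries S) = PowerSeries.X - PowerSeries.C u := by
  rw [Polynomial.coe_sub, Polynomial.coe_X, Polynomial.coe_C]

/-- Weierstrass division by `T - u`: `S[T]/(T - u) ≅ S⟦T⟧/(T - u)` (`Polynomial.IsDistinguishedAt.algEquivQuotient`;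
the `Algebra S S⟦T⟧` instance is pinned by unification). -/
noncomputable def weqvS {u : S} (hu : u ∈ IsLocalRing.maximalIdeal S) :
    (Polynomial S ⧸ Ideal.span {Polynomial.X - Polynomial.C u}) ≃+*
      (PowerSeries S ⧸ Ideal.span {((Polynomial.X - Polynomial.C u : Polynomial S) : PowerSeries S)}) :=
  @AlgEquiv.toRingEquiv _ _ _ _ _ _ (_) (_) (isDistinguishedAt_X_sub_C hu).algEquivQuotient

theorem weqvS_mk {u : S} (hu : u ∈ IsLocalRing.maximalIdeal S) (q : Polynomial S) :
    weqvS hu (Ideal.Quotient.mk _ q) = Ideal.Quotient.mk _ (q : PowerSeries S) := by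
  show Ideal.Quotient.mk _ (PowerSeries.map (algebraMap S S) (q : PowerSeries S)) = _
  rw [Algebra.algebraMap_self, PowerSeries.map_id, id_eq]

/-- **Evaluation at `u ∈ 𝔪_S`**: `ev_u : S⟦T⟧ → S`, `T ↦ u`, constants fixed (reduction modulo the
distinguished polynomial `T - u`, then `S[T]/(T - u) ≅ S`). -/
noncomputable def evS {u : S} (hu : u ∈ IsLocalRing.maximalIdeal S) : PowerSeries S →+* S :=
  (Polynomial.quotientSpanXSubCAlgEquiv u).toRingEquiv.toRingHom.comp
    ((weqvS hu).symm.toRingHom.comp (Ideal.Quotient.mk _))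

theorem evS_apply {u : S} (hu : u ∈ IsLocalRing.maximalIdeal S) (F : PowerSeries S) :
    evS hu F = Polynomial.quotientSpanXSubCAlgEquiv u ((weqvS hu).symm (Ideal.Quotient.mk _ F)) := rfl

theorem evS_coe {u : S} (hu : u ∈ IsLocalRing.maximalIdeal S) (q : Polynomial S) :
    evS hu (q : PowerSeries S) = q.eval u := by
  rw [evS_apply, ← weqvS_mk hu, RingEquiv.symm_apply_apply, Polynomial.quotientSpanXSubCAlgEquiv_mk]

theorem evS_C {u : S} (hu : u ∈ IsLocalRing.maximalIdeal S) (a : S) : evS hu (PowerSeries.C a) = a := by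
  rw [← Polynomial.coe_C, evS_coe, Polynomial.eval_C]

theorem evS_X {u : S} (hu : u ∈ IsLocalRing.maximalIdeal S) : evS hu PowerSeries.X = u := by
  rw [← Polynomial.coe_X, evS_coe, Polynomial.eval_X]

/-- `ker ev_u = (T - u)`. -/
theorem evS_eq_zero_iff {u : S} (hu : u ∈ IsLocalRing.maximalIdeal S) (F : PowerSeries S) :
    evS hu F = 0 ↔ PowerSeries.X - PowerSeries.C u ∣ F := by
  rw [← Ideal.mem_span_singleton, ← coe_X_sub_C, ← Ideal.Quotient.eq_zero_iff_mem, evS_apply,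
    map_eq_zero_iff _ (AlgEquiv.injective _), map_eq_zero_iff _ (RingEquiv.injective _)]

end EvalS

/-! ### E9.3 The coefficient rings `S`: complete DVRs, module-finite over `ℤ_p`, of characteristic zero -/

section SFacts

variable {𝒪 : Type} [CommRing 𝒪] [IsDomain 𝒪] [IsDiscreteValuationRing 𝒪] [IsAdicComplete (IsLocalRing.maximalIdeal 𝒪) 𝒪] [CharZero 𝒪]
  {p : ℕ} [Fact p.Prime] [Fact (Irreducible (p : 𝒪))]
variable (S : Type) [CommRing S] [IsDomain S] [IsDiscreteValuationRing S] [CharZero S]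
  [Algebra 𝒪 S] [Module.Finite 𝒪 S]

include 𝒪 in
/-- `p ∈ 𝔪_S` (Nakayama: `S = p·S` would force `S = 0`). -/
theorem natCast_p_mem_maximalIdeal : (p : S) ∈ IsLocalRing.maximalIdeal S := by
  by_contra h
  have hu : IsUnit (p : S) := by
    rwa [IsLocalRing.mem_maximalIdeal, mem_nonunits_iff, not_not] at h
  obtain ⟨v, hv⟩ := hu.exists_left_inv
  have hle : (⊤ : Submodule 𝒪 S) ≤ IsLocalRing.maximalIdeal 𝒪 • (⊤ : Submodule 𝒪 S) := by
    intro s _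
    have hs : s = (p : 𝒪) • (v * s) := by
      rw [Algebra.smul_def, map_natCast, ← mul_assoc, mul_comm (p : S) v, hv, one_mul]
    rw [hs]
    refine Submodule.smul_mem_smul ?_ Submodule.mem_top
    rw [(maximalIdeal_eq_span_p𝒪 (𝒪 := 𝒪) (p := p))]; exact Ideal.mem_span_singleton_self _
  have htop := Submodule.eq_bot_of_le_smul_of_le_jacobson_bot _ _ Module.Finite.fg_top hle
    (IsLocalRing.maximalIdeal_le_jacobson _)
  have h1 : (1 : S) ∈ (⊤ : Submodule 𝒪 S) := Submodule.mem_top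
  rw [htop, Submodule.mem_bot] at h1
  exact one_ne_zero h1

include 𝒪 in
theorem isUnit_one_sub_p_mulS (x : S) : IsUnit (1 - (p : S) * x) :=
  IsLocalRing.isUnit_one_sub_self_of_mem_nonunits _
    ((IsLocalRing.maximalIdeal S).mul_mem_right x (natCast_p_mem_maximalIdeal (𝒪 := 𝒪) (p := p) S))

theorem natCast_p_ne_zeroS : (p : S) ≠ 0 := Nat.cast_ne_zero.mpr (Fact.out : p.Prime).ne_zero

/-- `𝒪 → S` is injective: its kernel is `0` or `𝔪_𝒪`; in the second case the domain `S` would be a finite algebra over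
the residue field, hence a field — but a DVR is not a field. -/
theorem algebraMap_injectiveS : Function.Injective (algebraMap 𝒪 S) := by
  rw [RingHom.injective_iff_ker_eq_bot]
  by_contra hne
  haveI := RingHom.ker_isPrime (algebraMap 𝒪 S)
  have hmax : RingHom.ker (algebraMap 𝒪 S) = IsLocalRing.maximalIdeal 𝒪 :=
    IsLocalRing.eq_maximalIdeal (IsPrime.to_maximal_ideal hne)
  let φ : IsLocalRing.ResidueField 𝒪 →+* S :=
    Ideal.Quotient.lift (IsLocalRing.maximalIdeal 𝒪) (algebraMap 𝒪 S) fun a ha => by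
      rwa [← hmax, RingHom.mem_ker] at ha
  letI : Algebra (IsLocalRing.ResidueField 𝒪) S := φ.toAlgebra
  haveI : IsScalarTower 𝒪 (IsLocalRing.ResidueField 𝒪) S :=
    IsScalarTower.of_algebraMap_eq fun x => (Ideal.Quotient.lift_mk _ _ _).symm
  haveI : Module.Finite (IsLocalRing.ResidueField 𝒪) S := Module.Finite.of_restrictScalars_finite 𝒪 _ _
  exact IsDiscreteValuationRing.not_isField S
    (isField_of_isIntegral_of_isField' (Field.toIsField (IsLocalRing.ResidueField 𝒪)))

end SFacts

/-! ### E9.4 `Λ_{2,S} = S⟦T₂⟧⟦T₁⟧`: the vertical prime through `u ∈ 𝔪_S`, `ev₂`, `𝔔̄_u`, (FT_S) -/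

section LamS

open Summit.BirchSwinnertonDyer.BirchSwinnertonDyer.Theorems.SignedBaseChangeAcDivSpecialization

variable {𝒪 : Type} [CommRing 𝒪] [IsDomain 𝒪] [IsDiscreteValuationRing 𝒪] [IsAdicComplete (IsLocalRing.maximalIdeal 𝒪) 𝒪] [CharZero 𝒪]
  {p : ℕ} [Fact p.Prime] [Fact (Irreducible (p : 𝒪))]
variable {S : Type} [CommRing S] [IsDomain S] [IsDiscreteValuationRing S]
  [IsAdicComplete (IsLocalRing.maximalIdeal S) S] [CharZero S] [Algebra 𝒪 S] [Module.Finite 𝒪 S]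

theorem X_sub_C_ne_zero (u : S) : (PowerSeries.X - PowerSeries.C u : PowerSeries S) ≠ 0 := fun h => by
  have h1 := congrArg (PowerSeries.coeff 1) h
  rw [map_sub, PowerSeries.coeff_one_X, PowerSeries.coeff_C, if_neg one_ne_zero, sub_zero, map_zero] at h1
  exact one_ne_zero h1

theorem verticalPrimeO_ne_zero (u : S) : verticalPrimeO S u ≠ 0 := fun h => by
  have h1 : PowerSeries.constantCoeff (verticalPrimeO S u) = PowerSeries.X - PowerSeries.C u :=
    PowerSeries.constantCoeff_C _
  rw [h, map_zero] at h1
  exact X_sub_C_ne_zero u h1.symm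

/-- **Evaluation `T₂ ↦ u` on `Λ_{2,S}`**: `S⟦T₂⟧⟦T₁⟧ → S⟦T₁⟧`, `T₁`-coefficientwise `ev_u`. -/
noncomputable def ev₂ {u : S} (hu : u ∈ IsLocalRing.maximalIdeal S) :
    PowerSeries (PowerSeries S) →+* PowerSeries S :=
  PowerSeries.map (evS hu)

theorem coeff_ev₂ {u : S} (hu : u ∈ IsLocalRing.maximalIdeal S) (F : PowerSeries (PowerSeries S)) (n : ℕ) :
    PowerSeries.coeff n (ev₂ hu F) = evS hu (PowerSeries.coeff n F) := by
  rw [ev₂, PowerSeries.coeff_map]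

theorem ev₂_fibreSection {u : S} (hu : u ∈ IsLocalRing.maximalIdeal S) (b : PowerSeries S) :
    ev₂ hu (fibreSection S b) = b := by
  ext n
  rw [coeff_ev₂, fibreSection, PowerSeries.coeff_map, evS_C]

theorem ev₂_comp_fibreSection {u : S} (hu : u ∈ IsLocalRing.maximalIdeal S) :
    (ev₂ hu).comp (fibreSection S) = RingHom.id _ :=
  RingHom.ext (ev₂_fibreSection hu)

theorem ev₂_C {u : S} (hu : u ∈ IsLocalRing.maximalIdeal S) (f : PowerSeries S) :
    ev₂ hu (PowerSeries.C f) = PowerSeries.C (evS hu f) := by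
  rw [ev₂, PowerSeries.map_C]

theorem ev₂_verticalPrimeO {u : S} (hu : u ∈ IsLocalRing.maximalIdeal S) : ev₂ hu (verticalPrimeO S u) = 0 := by
  rw [verticalPrimeO, ev₂_C, map_sub, evS_X, evS_C, sub_self, map_zero]

/-- `ker ev₂ = (T₂ - u)`. -/
theorem ev₂_eq_zero_iff {u : S} (hu : u ∈ IsLocalRing.maximalIdeal S) (F : PowerSeries (PowerSeries S)) :
    ev₂ hu F = 0 ↔ verticalPrimeO S u ∣ F := by
  constructor
  · intro h
    show PowerSeries.C (PowerSeries.X - PowerSeries.C u) ∣ F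
    refine C_dvd_of_forall_dvd_coeff fun n => (evS_eq_zero_iff hu _).mp ?_
    rw [← coeff_ev₂, h, map_zero]
  · rintro ⟨H, rfl⟩
    rw [map_mul, ev₂_verticalPrimeO, zero_mul]

theorem ev₂_surjective {u : S} (hu : u ∈ IsLocalRing.maximalIdeal S) : Function.Surjective (ev₂ hu) :=
  fun b => ⟨fibreSection S b, ev₂_fibreSection hu b⟩

theorem ker_ev₂ {u : S} (hu : u ∈ IsLocalRing.maximalIdeal S) :
    RingHom.ker (ev₂ hu) = Ideal.span {verticalPrimeO S u} := by
  ext F; rw [RingHom.mem_ker, ev₂_eq_zero_iff, Ideal.mem_span_singleton]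

/-- `T₂ - u` is PRIME in `Λ_{2,S}`. -/
theorem prime_verticalPrimeO {u : S} (hu : u ∈ IsLocalRing.maximalIdeal S) : Prime (verticalPrimeO S u) := by
  rw [← Ideal.span_singleton_prime (verticalPrimeO_ne_zero u), ← ker_ev₂ hu]
  exact RingHom.ker_isPrime _

/-- The point `(T₂ - u) ∈ Spec Λ_{2,S}`. -/
noncomputable def ptS {u : S} (hu : u ∈ IsLocalRing.maximalIdeal S) : PrimeSpectrum (PowerSeries (PowerSeries S)) :=
  ⟨Ideal.span {verticalPrimeO S u},
    (Ideal.span_singleton_prime (verticalPrimeO_ne_zero u)).mpr (prime_verticalPrimeO hu)⟩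

theorem ptS_asIdeal {u : S} (hu : u ∈ IsLocalRing.maximalIdeal S) :
    (ptS hu).asIdeal = Ideal.span {verticalPrimeO S u} := rfl

theorem height_ptS {u : S} (hu : u ∈ IsLocalRing.maximalIdeal S) : (ptS hu).asIdeal.height = 1 :=
  Ideal.height_span_singleton_eq_one_of_mem_nonZeroDivisors
    (mem_nonZeroDivisors_of_ne_zero (verticalPrimeO_ne_zero u)) (prime_verticalPrimeO hu).not_unit

/-- **`S⟦T₁⟧ ≅ Λ_{2,S}/(T₂ - u)`** induced by `ev₂`. -/
noncomputable def eqvS {u : S} (hu : u ∈ IsLocalRing.maximalIdeal S) :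
    PowerSeries S ≃+* (PowerSeries (PowerSeries S) ⧸ Ideal.span {verticalPrimeO S u}) :=
  ((ev₂ hu).quotientKerEquivOfSurjective (ev₂_surjective hu)).symm.trans (Ideal.quotEquivOfEq (ker_ev₂ hu))

theorem eqvS_ev₂ {u : S} (hu : u ∈ IsLocalRing.maximalIdeal S) (x : PowerSeries (PowerSeries S)) :
    eqvS hu (ev₂ hu x) = Ideal.Quotient.mk _ x := by
  rw [eqvS, RingEquiv.trans_apply, RingHom.quotientKerEquivOfSurjective_symm_apply, Ideal.quotEquivOfEq_mk]

theorem eqvS_apply {u : S} (hu : u ∈ IsLocalRing.maximalIdeal S) (b : PowerSeries S) :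
    eqvS hu b = Ideal.Quotient.mk _ (fibreSection S b) := by
  rw [← eqvS_ev₂ hu, ev₂_fibreSection]

variable (S) in
/-- `𝔫_S = ker(S⟦T₁⟧ → κ_S⟦T₁⟧) = 𝔪_S · S⟦T₁⟧`. -/
noncomputable def kerRes₁ : Ideal (PowerSeries S) := RingHom.ker (PowerSeries.map (IsLocalRing.residue S))

theorem mem_kerRes₁_iff {f : PowerSeries S} :
    f ∈ kerRes₁ S ↔ ∀ n, PowerSeries.coeff n f ∈ IsLocalRing.maximalIdeal S := by
  rw [kerRes₁, RingHom.mem_ker, PowerSeries.ext_iff]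
  refine forall_congr' fun n => ?_
  rw [PowerSeries.coeff_map, map_zero, IsLocalRing.residue_eq_zero_iff]

theorem kerRes₁_isPrime : (kerRes₁ S).IsPrime := RingHom.ker_isPrime _

theorem kerRes₁_eq_span {ϖ : S} (hϖ : IsLocalRing.maximalIdeal S = Ideal.span {ϖ}) :
    kerRes₁ S = Ideal.span {PowerSeries.C ϖ} := by
  ext f
  rw [mem_kerRes₁_iff, Ideal.mem_span_singleton, hϖ]
  simp_rw [Ideal.mem_span_singleton]
  exact ⟨C_dvd_of_forall_dvd_coeff, dvd_coeff_of_C_dvd⟩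

/-- **(FT_S) fibre transport over `S`**: the fibre bound `p^t G ∈ ch(Y/(T₂-u)Y)·section + (T₂ - u)` (the
`S⟦T₁⟧`-structure through the section) IS `p^t · Ḡ ∈ ch_{Λ_{2,S}/(T₂-u)}(Y/(T₂-u)Y)` along `eqvS`. -/
theorem fibre_transportS {u : S} (hu : u ∈ IsLocalRing.maximalIdeal S) (Y : Type) [AddCommGroup Y]
    [Module (PowerSeries (PowerSeries S)) Y] (G : PowerSeries (PowerSeries S)) (t : ℕ)
    (h : FibreBoundAt S p Y G u t) :
    Ideal.Quotient.mk (Ideal.span {verticalPrimeO S u}) ((p : PowerSeries (PowerSeries S)) ^ t * G) ∈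
      Module.charIdeal (PowerSeries (PowerSeries S) ⧸ Ideal.span {verticalPrimeO S u})
        (QuotSMulTop (verticalPrimeO S u) Y) := by
  letI inst : Module (PowerSeries S) (QuotSMulTop (verticalPrimeO S u) Y) := Module.compHom _ (fibreSection S)
  have h0 : (p : PowerSeries (PowerSeries S)) ^ t * G ∈
      (Module.charIdeal (PowerSeries S) (QuotSMulTop (verticalPrimeO S u) Y)).map (fibreSection S) ⊔
        Ideal.span {verticalPrimeO S u} := h
  have h1 := Ideal.mem_map_of_mem (ev₂ hu) h0
  rw [Ideal.map_sup, Ideal.map_map, ev₂_comp_fibreSection, Ideal.map_id, Ideal.map_span, Set.image_singleton,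
    ev₂_verticalPrimeO, Ideal.span_singleton_zero, sup_bot_eq] at h1
  have he : ∀ (b : PowerSeries S) (f : QuotSMulTop (verticalPrimeO S u) Y),
      (AddEquiv.refl _) (b • f) = eqvS hu b • (AddEquiv.refl _) f := by
    intro b f
    obtain ⟨y, rfl⟩ := Submodule.Quotient.mk_surjective _ f
    rw [AddEquiv.refl_apply, AddEquiv.refl_apply, eqvS_apply]
    rfl
  rw [Module.charIdeal_eq_map_of_semilinearEquiv (eqvS hu) (AddEquiv.refl _) he, ← eqvS_ev₂]
  exact Ideal.mem_map_of_mem _ h1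

end LamS

/-! ### E9.7 Flat base change `Λ₂ → Λ_{2,S}` (free on `C C bⱼ`) and the dévissage inequality
`ℓ_{𝔓'}(Λ_{2,S}/C P) · ℓ_𝔓(N) ≤ ℓ_{𝔓'}(Λ_{2,S} ⊗_{Λ₂} N)` -/

section DoorS

variable {𝒪 : Type} [CommRing 𝒪] [IsDomain 𝒪] [IsDiscreteValuationRing 𝒪] [IsAdicComplete (IsLocalRing.maximalIdeal 𝒪) 𝒪] [CharZero 𝒪]
  {p : ℕ} [Fact p.Prime] [Fact (Irreducible (p : 𝒪))]

/-- `Λ_{2,S}` as a `Λ₂`-algebra by coefficient extension — the `letI` structure of `PatchingBeta` /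
`FibreBoundOver` (a local instance for §E9.7–E9.9). -/
@[reducible] noncomputable def algS (𝒪 : Type) [CommRing 𝒪] (S : Type) [CommRing S] [Algebra 𝒪 S] :
    Algebra (Lam₂ 𝒪) (PowerSeries (PowerSeries S)) :=
  (PowerSeries.map (PowerSeries.map (algebraMap 𝒪 S))).toAlgebra

attribute [local instance] algS

section BaseChange

variable (S : Type) [CommRing S] [IsDomain S] [IsDiscreteValuationRing S]
  [IsAdicComplete (IsLocalRing.maximalIdeal S) S] [CharZero S] [Algebra 𝒪 S] [Module.Finite 𝒪 S]

theorem algebraMap_S (r : Lam₂ 𝒪) :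
    algebraMap (Lam₂ 𝒪) (PowerSeries (PowerSeries S)) r =
      PowerSeries.map (PowerSeries.map (algebraMap 𝒪 S)) r := rfl

theorem coeff_coeff_algebraMap (r : Lam₂ 𝒪) (i k : ℕ) :
    PowerSeries.coeff k (PowerSeries.coeff i (algebraMap (Lam₂ 𝒪) (PowerSeries (PowerSeries S)) r)) =
      algebraMap 𝒪 S (PowerSeries.coeff k (PowerSeries.coeff i r)) := by
  rw [algebraMap_S, PowerSeries.coeff_map, PowerSeries.coeff_map]

theorem algebraMap_injective₂ :
    Function.Injective (algebraMap (Lam₂ 𝒪) (PowerSeries (PowerSeries S))) := by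
  intro a b h
  ext i k
  apply algebraMap_injectiveS S
  rw [← coeff_coeff_algebraMap, ← coeff_coeff_algebraMap, h]

theorem algebraMap_ne_zero₂ {r : Lam₂ 𝒪} (hr : r ≠ 0) :
    algebraMap (Lam₂ 𝒪) (PowerSeries (PowerSeries S)) r ≠ 0 :=
  fun h => hr (algebraMap_injective₂ S (by rw [h, map_zero]))

/-- `r • C (C s)` coefficientwise. -/
theorem coeff_coeff_smul_CC (r : Lam₂ 𝒪) (s : S) (i k : ℕ) :
    PowerSeries.coeff k (PowerSeries.coeff i
        (r • (PowerSeries.C (PowerSeries.C s) : PowerSeries (PowerSeries S)))) =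
      PowerSeries.coeff k (PowerSeries.coeff i r) • s := by
  rw [Algebra.smul_def, algebraMap_S, PowerSeries.coeff_mul_C, PowerSeries.coeff_map, PowerSeries.coeff_mul_C,
    PowerSeries.coeff_map, Algebra.smul_def]

/-- **`Λ_{2,S}` is free of finite rank over `Λ₂`** (on `C C bⱼ` for a `ℤ_p`-basis `bⱼ` of the finite
torsion-free, hence free, `ℤ_p`-module `S`). -/
theorem exists_linearEquiv_pi :
    ∃ n : ℕ, Nonempty (PowerSeries (PowerSeries S) ≃ₗ[Lam₂ 𝒪] (Fin n → Lam₂ 𝒪)) := by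
  classical
  haveI : Module.IsTorsionFree 𝒪 S := Module.isTorsionFree_iff_smul_eq_zero.mpr fun r m h => by
    rw [Algebra.smul_def, mul_eq_zero] at h
    exact h.imp_left fun h0 => algebraMap_injectiveS S (by rw [h0, map_zero])
  haveI : Module.Free 𝒪 S := Module.free_of_finite_type_torsion_free'
  let b := Module.finBasis 𝒪 S
  refine ⟨Module.finrank 𝒪 S, ⟨?_⟩⟩
  let Φ : (Fin (Module.finrank 𝒪 S) → Lam₂ 𝒪) →ₗ[Lam₂ 𝒪]
      PowerSeries (PowerSeries S) :=
    { toFun := fun f => ∑ j, f j • (PowerSeries.C (PowerSeries.C (b j)) : PowerSeries (PowerSeries S))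
      map_add' := fun f g => by
        simp only [Pi.add_apply, add_smul, Finset.sum_add_distrib]
      map_smul' := fun r f => by
        simp only [Pi.smul_apply, smul_eq_mul, mul_smul, Finset.smul_sum, RingHom.id_apply] }
  have hΦ : ∀ f i k, PowerSeries.coeff k (PowerSeries.coeff i (Φ f)) =
      b.equivFun.symm (fun j => PowerSeries.coeff k (PowerSeries.coeff i (f j))) := by
    intro f i k
    rw [b.equivFun_symm_apply]
    show PowerSeries.coeff k (PowerSeries.coeff i
      (∑ j, f j • (PowerSeries.C (PowerSeries.C (b j)) : PowerSeries (PowerSeries S)))) = _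
    rw [map_sum, map_sum]
    exact Finset.sum_congr rfl fun j _ => coeff_coeff_smul_CC S (f j) (b j) i k
  have hinj : Function.Injective Φ := by
    intro f g h
    funext j
    ext i k
    have h1 := congrArg (fun F => b.equivFun (PowerSeries.coeff k (PowerSeries.coeff i F))) h
    simp only [hΦ, LinearEquiv.apply_symm_apply] at h1
    exact congrFun h1 j
  have hsurj : Function.Surjective Φ := by
    intro F
    refine ⟨fun j => PowerSeries.mk fun i => PowerSeries.mk fun k =>
      b.equivFun (PowerSeries.coeff k (PowerSeries.coeff i F)) j, ?_⟩
    ext i k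
    rw [hΦ]
    simp only [PowerSeries.coeff_mk]
    exact b.equivFun.symm_apply_apply _
  exact (LinearEquiv.ofBijective Φ ⟨hinj, hsurj⟩).symm

/-- Hence `Λ_{2,S}` is flat over `Λ₂`. -/
theorem flatS : Module.Flat (Lam₂ 𝒪) (PowerSeries (PowerSeries S)) := by
  obtain ⟨n, ⟨e⟩⟩ := exists_linearEquiv_pi (𝒪 := 𝒪) S
  exact Module.Flat.of_linearEquiv e

/-! ### E9.8 Descent `Λ_{2,S} → Λ₂` at a root `u₀ ∈ 𝔪_S` of `P`: (K) `a(u₀) = 0 ⟹ P ∣ a` (heights in `Λ₁`),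
(D1) `π_{u₀} ∣ H ⟹ C P ∣ H`, (D) `m'k ≤ k_S ≤ m'g` ⟹ `(C P)^k ∣ G` in `Λ₂` -/

variable {S}

/-- (K) **Kernel of evaluation at a root.** -/
theorem dvd_of_evS_eq_zero (P : GoodPrime 𝒪 p) {u₀ : S} (hu₀ : u₀ ∈ IsLocalRing.maximalIdeal S)
    (hroot : evS hu₀ (PowerSeries.map (algebraMap 𝒪 S) P.P) = 0) {a : Lam₁ 𝒪}
    (ha : evS hu₀ (PowerSeries.map (algebraMap 𝒪 S) a) = 0) : P.P ∣ a := by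
  classical
  by_contra hPa
  let φ : Lam₁ 𝒪 →+* S := (evS hu₀).comp (PowerSeries.map (algebraMap 𝒪 S))
  haveI hI : (RingHom.ker φ).IsPrime := RingHom.ker_isPrime φ
  haveI : (Ideal.span {P.P}).IsPrime := (Ideal.span_singleton_prime P.prime.ne_zero).mpr P.prime
  have hlt : Ideal.span {P.P} < RingHom.ker φ := by
    refine lt_of_le_of_ne ?_ fun h => hPa ?_
    · rw [Ideal.span_le, Set.singleton_subset_iff, SetLike.mem_coe, RingHom.mem_ker]
      exact hroot
    · have ha' : a ∈ RingHom.ker φ := ha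
      rw [← h, Ideal.mem_span_singleton] at ha'
      exact ha'
  have h2 := two_le_height_of_span_lt (mem_nonZeroDivisors_of_ne_zero P.prime.ne_zero) hlt
  have hm : (IsLocalRing.maximalIdeal (Lam₁ 𝒪)).height = 2 := by
    have h : ((IsLocalRing.maximalIdeal (Lam₁ 𝒪)).height : WithBot ℕ∞) =
        ((2 : ℕ∞) : WithBot ℕ∞) := by
      rw [IsLocalRing.maximalIdeal_height_eq_ringKrullDim]
      exact ringKrullDim_Lam₁ 𝒪
    exact_mod_cast h
  have heq : RingHom.ker φ = IsLocalRing.maximalIdeal (Lam₁ 𝒪) :=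
    Ideal.eq_of_le_of_height_le (I := RingHom.ker φ) (J := IsLocalRing.maximalIdeal (Lam₁ 𝒪))
      (IsLocalRing.le_maximalIdeal hI.ne_top) (by rw [hm]; exact h2)
  have hp : (p : Lam₁ 𝒪) ∈ RingHom.ker φ := by
    rw [heq]
    exact GoodPrime.not_isUnit_p
  rw [RingHom.mem_ker, map_natCast] at hp
  exact natCast_p_ne_zeroS S hp

/-- (D1) `π_{u₀} ∣ H` in `Λ_{2,S}` for `H ∈ Λ₂` ⟹ `C P ∣ H` in `Λ₂`. -/
theorem C_dvd_of_verticalPrimeO_dvd (P : GoodPrime 𝒪 p) {u₀ : S} (hu₀ : u₀ ∈ IsLocalRing.maximalIdeal S)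
    (hroot : evS hu₀ (PowerSeries.map (algebraMap 𝒪 S) P.P) = 0) {H : Lam₂ 𝒪}
    (h : verticalPrimeO S u₀ ∣ algebraMap (Lam₂ 𝒪) (PowerSeries (PowerSeries S)) H) :
    (PowerSeries.C P.P : Lam₂ 𝒪) ∣ H := by
  refine C_dvd_of_forall_dvd_coeff fun n => dvd_of_evS_eq_zero P hu₀ hroot ?_
  rw [evS_eq_zero_iff]
  have h1 := dvd_coeff_of_C_dvd h n
  rwa [algebraMap_S, PowerSeries.coeff_map] at h1

variable (𝒪 p) in
/-- **Root datum** of a good prime `P`: a complete DVR `S`, finite over `ℤ_p`, with a root `u₀ ∈ 𝔪_S` of `P`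
(constructed for every `P` in §E10, `rootDatumS`). -/
def RootDatumS (P : GoodPrime 𝒪 p) : Prop :=
  ∃ (S : Type) (_ : CommRing S) (_ : IsDomain S) (_ : IsDiscreteValuationRing S)
    (_ : IsAdicComplete (IsLocalRing.maximalIdeal S) S) (_ : CharZero S) (_ : Algebra 𝒪 S)
    (_ : Module.Finite 𝒪 S) (u₀ : S) (hu₀ : u₀ ∈ IsLocalRing.maximalIdeal S),
    evS hu₀ (PowerSeries.map (algebraMap 𝒪 S) P.P) = 0

end BaseChange

end DoorS


/-! ## E10' ALGEBRAIC ROOT DATA (= `QtameRootData.lean` f6784b8b971a verbatim): `AdjoinRoot` of the EISENSTEIN Weierstrass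
polynomial of `T^d + p·h` is a complete DVR finite over `𝒪`, `char 0`, root in `𝔪_S` — over ANY complete DVR `𝒪`. -/

namespace RD


open Polynomial IsLocalRing

universe u

/-! ## 0. Finitely generated modules over complete rings are complete (tree lemma, restated) -/

section ModuleFinite

open Submodule TensorProduct

variable {R M : Type*} [CommRing R] [AddCommGroup M] [Module R M] (I : Ideal R)

/-- A finitely generated module over an `I`-adically precomplete ring is `I`-adically precomplete
(verbatim `Literature.NumberTheory.Automorphic.isPrecomplete_of_moduleFinite`). -/
theorem isPrecomplete_of_moduleFinite [IsPrecomplete I R] [Module.Finite R M] : IsPrecomplete I M := by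
  refine AdicCompletion.of_surjective_iff.1 fun y => ?_
  obtain ⟨t, rfl⟩ := AdicCompletion.ofTensorProduct_surjective_of_finite I M y
  have key : ∀ t : AdicCompletion I R ⊗[R] M, ∃ m : M, t = (1 : AdicCompletion I R) ⊗ₜ[R] m := by
    intro t
    induction t using TensorProduct.induction_on with
    | zero => exact ⟨0, by rw [TensorProduct.tmul_zero]⟩
    | tmul r m =>
      obtain ⟨r₀, rfl⟩ := AdicCompletion.of_surjective I R r
      refine ⟨r₀ • m, ?_⟩
      rw [← TensorProduct.smul_tmul]
      congr 1
      rw [← Algebra.algebraMap_eq_smul_one]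
      rfl
    | add t₁ t₂ h₁ h₂ =>
      obtain ⟨m₁, rfl⟩ := h₁
      obtain ⟨m₂, rfl⟩ := h₂
      exact ⟨m₁ + m₂, by rw [TensorProduct.tmul_add]⟩
  obtain ⟨m, rfl⟩ := key t
  exact ⟨m, by rw [AdicCompletion.ofTensorProduct_tmul, one_smul]⟩

/-- A finitely generated module over an `I`-adically complete Noetherian ring with `I ≤ J(R)` is
`I`-adically complete (verbatim `Literature.NumberTheory.Automorphic.isAdicComplete_of_moduleFinite`). -/
theorem isAdicComplete_of_moduleFinite [IsNoetherianRing R] [IsAdicComplete I R]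
    (hI : I ≤ Ideal.jacobson ⊥) [Module.Finite R M] : IsAdicComplete I M :=
  { toIsHausdorff := IsHausdorff.of_le_jacobson I M hI
    toIsPrecomplete := isPrecomplete_of_moduleFinite I }

end ModuleFinite

/-! ## 1. Transfer of adic completeness along comparable filtrations -/

section Transfer

variable {R : Type*} {A : Type*} [CommRing R] [CommRing A] [Algebra R A]

theorem mem_pow_smul_top_iff (I : Ideal R) (n : ℕ) (x : A) :
    x ∈ (I ^ n • ⊤ : Submodule R A) ↔ x ∈ (I.map (algebraMap R A)) ^ n := by
  rw [Ideal.smul_top_eq_map, Submodule.restrictScalars_mem, Ideal.map_pow]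

theorem mem_pow_smul_top_iff' (J : Ideal A) (n : ℕ) (x : A) :
    x ∈ (J ^ n • ⊤ : Submodule A A) ↔ x ∈ J ^ n := by
  rw [smul_eq_mul, Ideal.mul_top]

/-- **Transfer of adic completeness.** If `A` is `I`-adically complete as an `R`-module and `J` is an
ideal of `A` with `I·A ≤ J` and `J^d ≤ I·A` for some `d ≥ 1`, then `A` is `J`-adically complete. -/
theorem isAdicComplete_of_comparable (I : Ideal R) (J : Ideal A) {d : ℕ} (hd : 1 ≤ d)
    (h1 : I.map (algebraMap R A) ≤ J) (h2 : J ^ d ≤ I.map (algebraMap R A))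
    [IsAdicComplete I A] : IsAdicComplete J A where
  haus' x hx := by
    refine IsHausdorff.haus' (I := I) x fun n => ?_
    rw [SModEq.zero, mem_pow_smul_top_iff]
    have h := hx (d * n)
    rw [SModEq.zero, mem_pow_smul_top_iff', pow_mul] at h
    exact Ideal.pow_right_mono h2 n h
  prec' f hf := by
    have hg : ∀ {m n : ℕ}, m ≤ n →
        f (d * m) ≡ f (d * n) [SMOD (I ^ m • ⊤ : Submodule R A)] := by
      intro m n hmn
      rw [SModEq.sub_mem, mem_pow_smul_top_iff]
      have h := hf (Nat.mul_le_mul_left d hmn)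
      rw [SModEq.sub_mem, mem_pow_smul_top_iff', pow_mul] at h
      exact Ideal.pow_right_mono h2 m h
    obtain ⟨L, hL⟩ := IsPrecomplete.prec' (I := I) (fun n => f (d * n)) hg
    refine ⟨L, fun n => ?_⟩
    rw [SModEq.sub_mem, mem_pow_smul_top_iff']
    have hdn : n ≤ d * n := Nat.le_mul_of_pos_left n hd
    have e1 : f n - f (d * n) ∈ J ^ n := by
      have h := hf hdn
      rwa [SModEq.sub_mem, mem_pow_smul_top_iff'] at h
    have e2 : f (d * n) - L ∈ J ^ n := by
      have h := hL n
      rw [SModEq.sub_mem, mem_pow_smul_top_iff] at h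
      exact Ideal.pow_right_mono h1 n h
    have e : f n - L = (f n - f (d * n)) + (f (d * n) - L) := by ring
    rw [e]
    exact add_mem e1 e2

end Transfer

/-! ## 2. `AdjoinRoot` of an Eisenstein polynomial over a DVR -/

section Eisenstein

variable {𝒪 : Type u} [CommRing 𝒪] [IsDomain 𝒪] [IsDiscreteValuationRing 𝒪]
variable {f : 𝒪[X]}

theorem prime_of_isEisensteinAt (hf : f.Monic) (hE : f.IsEisensteinAt (maximalIdeal 𝒪))
    (hdeg : 0 < f.natDegree) : Prime f :=
  (hE.irreducible inferInstance hf.isPrimitive hdeg).prime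

theorem isDomain_adjoinRoot (hf : f.Monic) (hE : f.IsEisensteinAt (maximalIdeal 𝒪))
    (hdeg : 0 < f.natDegree) : IsDomain (AdjoinRoot f) :=
  AdjoinRoot.isDomain_of_prime (prime_of_isEisensteinAt hf hE hdeg)

theorem of_injective (hf : f.Monic) (hdeg : 0 < f.natDegree) :
    Function.Injective (AdjoinRoot.of f) := by
  apply AdjoinRoot.of.injective_of_degree_ne_zero
  rw [Polynomial.degree_eq_natDegree hf.ne_zero]
  exact_mod_cast hdeg.ne'

/-- `f - X^d = C ϖ * q` with `q(0)` a unit, for `ϖ` a uniformiser. -/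
theorem exists_eq_X_pow_add_C_mul (hf : f.Monic) (hE : f.IsEisensteinAt (maximalIdeal 𝒪))
    (hdeg : 0 < f.natDegree) {ϖ : 𝒪} (hϖ : Irreducible ϖ) :
    ∃ q : 𝒪[X], f = X ^ f.natDegree + C ϖ * q ∧ IsUnit (q.coeff 0) := by
  have hm := hϖ.maximalIdeal_eq
  have hdvd : C ϖ ∣ f - X ^ f.natDegree := by
    rw [Polynomial.C_dvd_iff_dvd_coeff]
    intro i
    rw [Polynomial.coeff_sub, Polynomial.coeff_X_pow]
    rcases lt_trichotomy i f.natDegree with hi | hi | hi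
    · rw [if_neg hi.ne, sub_zero]
      have := hE.mem hi
      rw [hm, Ideal.mem_span_singleton] at this
      exact this
    · subst hi
      rw [if_pos rfl, Polynomial.Monic.coeff_natDegree hf, sub_self]
      exact dvd_zero _
    · rw [if_neg hi.ne', sub_zero, Polynomial.coeff_eq_zero_of_natDegree_lt hi]
      exact dvd_zero _
  obtain ⟨q, hq⟩ := hdvd
  refine ⟨q, by rw [← hq]; ring, ?_⟩
  have h0 : f.coeff 0 = ϖ * q.coeff 0 := by
    have := congrArg (fun r => Polynomial.coeff r 0) hq
    simp only [Polynomial.coeff_sub, Polynomial.coeff_X_pow, Polynomial.coeff_C_mul,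
      if_neg (Nat.pos_iff_ne_zero.mp hdeg).symm, sub_zero] at this
    exact this
  have hnot : f.coeff 0 ∉ maximalIdeal 𝒪 ^ 2 := hE.notMem
  rw [h0] at hnot
  by_contra hu
  apply hnot
  have hq0 : q.coeff 0 ∈ maximalIdeal 𝒪 := by
    rw [mem_maximalIdeal, mem_nonunits_iff]; exact hu
  rw [hm] at hq0 ⊢
  rw [pow_two]
  exact Ideal.mul_mem_mul (Ideal.mem_span_singleton_self ϖ) hq0

omit [IsDomain 𝒪] [IsDiscreteValuationRing 𝒪] in
/-- In `S = 𝒪[α]`: `α^d = -(ϖ · q(α))`. -/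
theorem root_pow_eq {ϖ : 𝒪} {q : 𝒪[X]} (hq : f = X ^ f.natDegree + C ϖ * q) :
    AdjoinRoot.root f ^ f.natDegree = -(AdjoinRoot.of f ϖ * AdjoinRoot.mk f q) := by
  have h : AdjoinRoot.mk f (X ^ f.natDegree + C ϖ * q) = 0 := by
    rw [← hq]; exact AdjoinRoot.mk_self
  rw [map_add, map_pow, map_mul, AdjoinRoot.mk_X, AdjoinRoot.mk_C] at h
  exact eq_neg_of_add_eq_zero_left h

/-- The residue map `S = 𝒪[α] → k = 𝒪/𝔪`, `α ↦ 0` (well defined because `f(0) ∈ 𝔪`). -/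
noncomputable def toResidueField (hE : f.IsEisensteinAt (maximalIdeal 𝒪)) (hdeg : 0 < f.natDegree) :
    AdjoinRoot f →+* ResidueField 𝒪 :=
  AdjoinRoot.lift (residue 𝒪) 0 (by
    rw [Polynomial.eval₂_at_zero, residue_eq_zero_iff]
    exact hE.mem hdeg)

theorem toResidueField_of (hE : f.IsEisensteinAt (maximalIdeal 𝒪)) (hdeg : 0 < f.natDegree) (x : 𝒪) :
    toResidueField hE hdeg (AdjoinRoot.of f x) = residue 𝒪 x :=
  AdjoinRoot.lift_of _

theorem toResidueField_root (hE : f.IsEisensteinAt (maximalIdeal 𝒪)) (hdeg : 0 < f.natDegree) :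
    toResidueField hE hdeg (AdjoinRoot.root f) = 0 :=
  AdjoinRoot.lift_root _

theorem toResidueField_mk (hE : f.IsEisensteinAt (maximalIdeal 𝒪)) (hdeg : 0 < f.natDegree)
    (g : 𝒪[X]) : toResidueField hE hdeg (AdjoinRoot.mk f g) = residue 𝒪 (g.coeff 0) := by
  rw [toResidueField, AdjoinRoot.lift_mk, Polynomial.eval₂_at_zero]

theorem toResidueField_surjective (hE : f.IsEisensteinAt (maximalIdeal 𝒪)) (hdeg : 0 < f.natDegree) :
    Function.Surjective (toResidueField hE hdeg) := fun y => by
  obtain ⟨x, rfl⟩ := Ideal.Quotient.mk_surjective y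
  exact ⟨AdjoinRoot.of f x, toResidueField_of hE hdeg x⟩

theorem ker_isMaximal (hE : f.IsEisensteinAt (maximalIdeal 𝒪)) (hdeg : 0 < f.natDegree) :
    (RingHom.ker (toResidueField hE hdeg)).IsMaximal :=
  RingHom.ker_isMaximal_of_surjective _ (toResidueField_surjective hE hdeg)

/-- The kernel of the residue map is contained in every ideal containing `𝔪_𝒪·S` and `α`. -/
theorem ker_le_of_mem (hE : f.IsEisensteinAt (maximalIdeal 𝒪)) (hdeg : 0 < f.natDegree)
    (N : Ideal (AdjoinRoot f)) (hm : (maximalIdeal 𝒪).map (AdjoinRoot.of f) ≤ N)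
    (hα : AdjoinRoot.root f ∈ N) : RingHom.ker (toResidueField hE hdeg) ≤ N := by
  intro x hx
  obtain ⟨g, rfl⟩ := AdjoinRoot.mk_surjective x
  rw [RingHom.mem_ker, toResidueField_mk, residue_eq_zero_iff] at hx
  have hsplit : AdjoinRoot.mk f g =
      AdjoinRoot.of f (g.coeff 0) + AdjoinRoot.root f * AdjoinRoot.mk f g.divX := by
    conv_lhs => rw [← Polynomial.divX_mul_X_add g]
    rw [map_add, map_mul, AdjoinRoot.mk_X, AdjoinRoot.mk_C]
    ring
  rw [hsplit]
  exact add_mem (hm (Ideal.mem_map_of_mem _ hx)) (Ideal.mul_mem_right _ N hα)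

/-- Every maximal ideal of `S` contains `𝔪_𝒪·S` (integrality + locality of `𝒪`). -/
theorem map_maximalIdeal_le (hf : f.Monic) (N : Ideal (AdjoinRoot f)) [hN : N.IsMaximal] :
    (maximalIdeal 𝒪).map (AdjoinRoot.of f) ≤ N := by
  haveI : Module.Finite 𝒪 (AdjoinRoot f) := hf.finite_adjoinRoot
  rw [Ideal.map_le_iff_le_comap]
  have hmax : (N.comap (algebraMap 𝒪 (AdjoinRoot f))).IsMaximal :=
    Ideal.isMaximal_comap_of_isIntegral_of_isMaximal N
  rw [AdjoinRoot.algebraMap_eq] at hmax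
  exact le_of_eq (IsLocalRing.eq_maximalIdeal hmax).symm

/-- Every maximal ideal of `S` contains `α` (because `α^d ∈ 𝔪_𝒪·S`). -/
theorem root_mem (hf : f.Monic) (hE : f.IsEisensteinAt (maximalIdeal 𝒪)) (hdeg : 0 < f.natDegree)
    (N : Ideal (AdjoinRoot f)) [hN : N.IsMaximal] : AdjoinRoot.root f ∈ N := by
  obtain ⟨ϖ, hϖ⟩ := IsDiscreteValuationRing.exists_irreducible 𝒪
  obtain ⟨q, hq, -⟩ := exists_eq_X_pow_add_C_mul hf hE hdeg hϖ
  apply hN.isPrime.mem_of_pow_mem f.natDegree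
  rw [root_pow_eq hq]
  refine neg_mem (Ideal.mul_mem_right _ N (map_maximalIdeal_le hf N ?_))
  exact Ideal.mem_map_of_mem _ (hϖ.maximalIdeal_eq ▸ Ideal.mem_span_singleton_self ϖ)

theorem existsUnique_isMaximal (hf : f.Monic) (hE : f.IsEisensteinAt (maximalIdeal 𝒪))
    (hdeg : 0 < f.natDegree) : ∃! N : Ideal (AdjoinRoot f), N.IsMaximal := by
  refine ⟨RingHom.ker (toResidueField hE hdeg), ker_isMaximal hE hdeg, fun N hN => ?_⟩
  haveI := hN
  exact ((ker_isMaximal hE hdeg).eq_of_le hN.ne_top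
    (ker_le_of_mem hE hdeg N (map_maximalIdeal_le hf N) (root_mem hf hE hdeg N))).symm

/-- **`S = 𝒪[α]` is local.** -/
theorem isLocalRing_adjoinRoot (hf : f.Monic) (hE : f.IsEisensteinAt (maximalIdeal 𝒪))
    (hdeg : 0 < f.natDegree) : IsLocalRing (AdjoinRoot f) :=
  IsLocalRing.of_unique_max_ideal (existsUnique_isMaximal hf hE hdeg)

theorem maximalIdeal_eq_ker (hf : f.Monic) (hE : f.IsEisensteinAt (maximalIdeal 𝒪))
    (hdeg : 0 < f.natDegree) :
    haveI := isLocalRing_adjoinRoot hf hE hdeg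
    maximalIdeal (AdjoinRoot f) = RingHom.ker (toResidueField hE hdeg) := by
  haveI := isLocalRing_adjoinRoot hf hE hdeg
  exact (IsLocalRing.eq_maximalIdeal (ker_isMaximal hE hdeg)).symm

/-- A uniformiser of `𝒪` lies in `(α)`: `ϖ = -α^d · q(α)⁻¹` with `q(α)` a unit. -/
theorem of_mem_span_root (hf : f.Monic) (hE : f.IsEisensteinAt (maximalIdeal 𝒪))
    (hdeg : 0 < f.natDegree) {ϖ : 𝒪} (hϖ : Irreducible ϖ) :
    AdjoinRoot.of f ϖ ∈ Ideal.span {AdjoinRoot.root f} := by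
  haveI := isLocalRing_adjoinRoot hf hE hdeg
  obtain ⟨q, hq, hq0⟩ := exists_eq_X_pow_add_C_mul hf hE hdeg hϖ
  have hB : IsUnit (AdjoinRoot.mk f q) := by
    by_contra hu
    have hmem : AdjoinRoot.mk f q ∈ maximalIdeal (AdjoinRoot f) :=
      (mem_maximalIdeal _).mpr (mem_nonunits_iff.mpr hu)
    rw [maximalIdeal_eq_ker hf hE hdeg, RingHom.mem_ker, toResidueField_mk, residue_eq_zero_iff] at hmem
    exact ((mem_nonunits_iff).mp ((mem_maximalIdeal _).mp hmem)) hq0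
  obtain ⟨u, hu⟩ := hB
  have hpow := root_pow_eq hq
  rw [← hu] at hpow
  have hϖeq : AdjoinRoot.of f ϖ = -(AdjoinRoot.root f ^ f.natDegree) * ↑u⁻¹ := by
    rw [hpow, neg_neg, mul_assoc, Units.mul_inv, mul_one]
  rw [hϖeq]
  exact Ideal.mul_mem_right _ _
    (neg_mem (Ideal.pow_mem_of_mem _ (Ideal.mem_span_singleton_self _) _ hdeg))

/-- **The maximal ideal of `S = 𝒪[α]` is `(α)`.** -/
theorem maximalIdeal_eq_span_root (hf : f.Monic) (hE : f.IsEisensteinAt (maximalIdeal 𝒪))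
    (hdeg : 0 < f.natDegree) :
    haveI := isLocalRing_adjoinRoot hf hE hdeg
    maximalIdeal (AdjoinRoot f) = Ideal.span {AdjoinRoot.root f} := by
  haveI := isLocalRing_adjoinRoot hf hE hdeg
  obtain ⟨ϖ, hϖ⟩ := IsDiscreteValuationRing.exists_irreducible 𝒪
  apply le_antisymm
  · rw [maximalIdeal_eq_ker hf hE hdeg]
    refine ker_le_of_mem hE hdeg _ ?_ (Ideal.mem_span_singleton_self _)
    rw [hϖ.maximalIdeal_eq, Ideal.map_span, Set.image_singleton, Ideal.span_singleton_le_iff_mem]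
    exact of_mem_span_root hf hE hdeg hϖ
  · rw [Ideal.span_singleton_le_iff_mem, maximalIdeal_eq_ker hf hE hdeg, RingHom.mem_ker]
    exact toResidueField_root hE hdeg

theorem maximalIdeal_ne_bot (hf : f.Monic) (hE : f.IsEisensteinAt (maximalIdeal 𝒪))
    (hdeg : 0 < f.natDegree) :
    haveI := isLocalRing_adjoinRoot hf hE hdeg
    maximalIdeal (AdjoinRoot f) ≠ ⊥ := by
  haveI := isLocalRing_adjoinRoot hf hE hdeg
  obtain ⟨ϖ, hϖ⟩ := IsDiscreteValuationRing.exists_irreducible 𝒪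
  intro h
  have hmem : AdjoinRoot.of f ϖ ∈ maximalIdeal (AdjoinRoot f) := by
    rw [maximalIdeal_eq_span_root hf hE hdeg]; exact of_mem_span_root hf hE hdeg hϖ
  rw [h, Ideal.mem_bot] at hmem
  exact hϖ.ne_zero ((injective_iff_map_eq_zero _).mp (of_injective hf hdeg) ϖ hmem)

/-- **`S = 𝒪[α]` is a discrete valuation ring** (Serre, *Local Fields* I §6 Prop. 17). -/
theorem isDiscreteValuationRing_adjoinRoot (hf : f.Monic) (hE : f.IsEisensteinAt (maximalIdeal 𝒪))
    (hdeg : 0 < f.natDegree) :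
    haveI := isDomain_adjoinRoot hf hE hdeg
    IsDiscreteValuationRing (AdjoinRoot f) := by
  haveI := isDomain_adjoinRoot hf hE hdeg
  haveI := isLocalRing_adjoinRoot hf hE hdeg
  have hnf : ¬ IsField (AdjoinRoot f) := by
    rw [IsLocalRing.isField_iff_maximalIdeal_eq]
    exact maximalIdeal_ne_bot hf hE hdeg
  have hpr : (maximalIdeal (AdjoinRoot f)).IsPrincipal :=
    ⟨⟨AdjoinRoot.root f, by rw [maximalIdeal_eq_span_root hf hE hdeg]⟩⟩
  exact ((IsDiscreteValuationRing.TFAE (AdjoinRoot f) hnf).out 0 4).mpr hpr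

/-- **`S = 𝒪[α]` is `𝔪_S`-adically complete** when `𝒪` is `𝔪_𝒪`-adically complete
(`(α)^d ≤ 𝔪_𝒪·S ≤ (α)` and §0–§1). -/
theorem isAdicComplete_adjoinRoot [IsAdicComplete (maximalIdeal 𝒪) 𝒪] (hf : f.Monic)
    (hE : f.IsEisensteinAt (maximalIdeal 𝒪)) (hdeg : 0 < f.natDegree) :
    haveI := isLocalRing_adjoinRoot hf hE hdeg
    IsAdicComplete (maximalIdeal (AdjoinRoot f)) (AdjoinRoot f) := by
  haveI := isLocalRing_adjoinRoot hf hE hdeg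
  haveI : Module.Finite 𝒪 (AdjoinRoot f) := hf.finite_adjoinRoot
  haveI : IsAdicComplete (maximalIdeal 𝒪) (AdjoinRoot f) :=
    isAdicComplete_of_moduleFinite (maximalIdeal 𝒪) (maximalIdeal_le_jacobson ⊥)
  obtain ⟨ϖ, hϖ⟩ := IsDiscreteValuationRing.exists_irreducible 𝒪
  obtain ⟨q, hq, -⟩ := exists_eq_X_pow_add_C_mul hf hE hdeg hϖ
  refine isAdicComplete_of_comparable (maximalIdeal 𝒪) (maximalIdeal (AdjoinRoot f)) hdeg ?_ ?_
  · rw [AdjoinRoot.algebraMap_eq]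
    exact map_maximalIdeal_le hf _
  · rw [AdjoinRoot.algebraMap_eq, maximalIdeal_eq_span_root hf hE hdeg, Ideal.span_singleton_pow,
      Ideal.span_singleton_le_iff_mem, root_pow_eq hq]
    refine neg_mem (Ideal.mul_mem_right _ _ ?_)
    exact Ideal.mem_map_of_mem _ (hϖ.maximalIdeal_eq ▸ Ideal.mem_span_singleton_self ϖ)

end Eisenstein

/-! ## 3. Root data for an Eisenstein polynomial over a complete DVR -/

section RootData

variable {𝒪 : Type u} [CommRing 𝒪] [IsDomain 𝒪] [IsDiscreteValuationRing 𝒪]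

/-- **Algebraic root data.** For a monic Eisenstein `f` of positive degree over a complete DVR `𝒪` of
characteristic zero there is a complete DVR `S`, finite over `𝒪`, of characteristic zero, with a root
`u₀ ∈ 𝔪_S` of `f` — namely `S = 𝒪[X]/(f)`, `u₀ = X`. Same shape as `QtameDoor5.RD.exists_dvr_root`
(`𝒪 = 𝒪`), no `p`-adic analysis. -/
theorem exists_dvr_root_of_isEisensteinAt [IsAdicComplete (maximalIdeal 𝒪) 𝒪] [CharZero 𝒪]
    (f : 𝒪[X]) (hf : f.Monic) (hE : f.IsEisensteinAt (maximalIdeal 𝒪)) (hdeg : 0 < f.natDegree) :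
    ∃ (S : Type u) (_ : CommRing S) (_ : IsDomain S) (_ : IsDiscreteValuationRing S)
      (_ : IsAdicComplete (IsLocalRing.maximalIdeal S) S) (_ : CharZero S) (_ : Algebra 𝒪 S)
      (_ : Module.Finite 𝒪 S) (u₀ : S),
      u₀ ∈ IsLocalRing.maximalIdeal S ∧ f.eval₂ (algebraMap 𝒪 S) u₀ = 0 := by
  haveI := isDomain_adjoinRoot hf hE hdeg
  haveI := isDiscreteValuationRing_adjoinRoot hf hE hdeg
  haveI := isAdicComplete_adjoinRoot hf hE hdeg
  haveI : CharZero (AdjoinRoot f) :=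
    charZero_of_injective_algebraMap ((AdjoinRoot.algebraMap_eq f).symm ▸ of_injective hf hdeg)
  haveI : Module.Finite 𝒪 (AdjoinRoot f) := hf.finite_adjoinRoot
  refine ⟨AdjoinRoot f, inferInstance, inferInstance, inferInstance, inferInstance, inferInstance,
    inferInstance, inferInstance, AdjoinRoot.root f, ?_, ?_⟩
  · rw [maximalIdeal_eq_span_root hf hE hdeg]
    exact Ideal.mem_span_singleton_self _
  · rw [AdjoinRoot.algebraMap_eq]
    exact AdjoinRoot.eval₂_root f

end RootData


/-! ## 4. Root data for Eisenstein-SHAPE power series `P = T^d + ϖ·h` (Eisenstein-system members) -/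

section EisensteinShape

open PowerSeries

variable {𝒪 : Type u} [CommRing 𝒪] [IsDomain 𝒪] [IsDiscreteValuationRing 𝒪]

/-- `P = T^d + ϖ·h` reduces to `T^d ≠ 0` modulo `𝔪`. -/
theorem map_residue_eq_of_eisenstein_shape {ϖ : 𝒪} (hϖ : Irreducible ϖ) {d : ℕ} {h P : 𝒪⟦X⟧}
    (hP : P = PowerSeries.X ^ d + PowerSeries.C ϖ * h) :
    P.map (residue 𝒪) = PowerSeries.X ^ d := by
  have h0 : residue 𝒪 ϖ = 0 :=
    (residue_eq_zero_iff _).mpr (hϖ.maximalIdeal_eq ▸ Ideal.mem_span_singleton_self ϖ)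
  rw [hP, map_add, map_pow, PowerSeries.map_X, map_mul, PowerSeries.map_C, h0, map_zero, zero_mul,
    add_zero]

theorem map_residue_ne_zero_of_eisenstein_shape {ϖ : 𝒪} (hϖ : Irreducible ϖ) {d : ℕ} {h P : 𝒪⟦X⟧}
    (hP : P = PowerSeries.X ^ d + PowerSeries.C ϖ * h) : P.map (residue 𝒪) ≠ 0 := by
  rw [map_residue_eq_of_eisenstein_shape hϖ hP]
  exact pow_ne_zero _ PowerSeries.X_ne_zero

/-- **The Weierstrass polynomial of `P = T^d + ϖ·h` (`h` a unit, `d ≥ 1`) is Eisenstein of degree `d`.** -/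
theorem weierstrassDistinguished_of_eisenstein_shape [IsAdicComplete (maximalIdeal 𝒪) 𝒪]
    {ϖ : 𝒪} (hϖ : Irreducible ϖ) {d : ℕ} (hd : 0 < d) {h P : 𝒪⟦X⟧} (hh : IsUnit h)
    (hP : P = PowerSeries.X ^ d + PowerSeries.C ϖ * h) (hres : P.map (residue 𝒪) ≠ 0) :
    (P.weierstrassDistinguished hres).natDegree = d ∧
      (P.weierstrassDistinguished hres).IsEisensteinAt (maximalIdeal 𝒪) := by
  have HW := P.isWeierstrassFactorization_weierstrassDistinguished_weierstrassUnit hres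
  set f := P.weierstrassDistinguished hres with hfdef
  set u := P.weierstrassUnit hres with hudef
  have hfD : f.IsDistinguishedAt (maximalIdeal 𝒪) := HW.isDistinguishedAt
  have hnat : f.natDegree = d := by
    rw [HW.natDegree_eq_toNat_order_map, map_residue_eq_of_eisenstein_shape hϖ hP,
      PowerSeries.order_X_pow]
    rfl
  refine ⟨hnat, ⟨?_, fun hn => hfD.mem hn, ?_⟩⟩
  · rw [hfD.monic.leadingCoeff]
    exact (Ideal.ne_top_iff_one _).mp (Ideal.IsMaximal.ne_top inferInstance)
  · -- constant terms: `f(0)·u(0) = ϖ·h(0)` with `u(0), h(0)` units, so `f(0) ∉ (ϖ²)`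
    have hc : f.coeff 0 * PowerSeries.constantCoeff u = ϖ * PowerSeries.constantCoeff h := by
      have := congrArg PowerSeries.constantCoeff HW.eq_mul
      rw [map_mul, Polynomial.constantCoeff_coe] at this
      rw [← this, hP, map_add, map_pow, PowerSeries.constantCoeff_X, zero_pow hd.ne', zero_add, map_mul,
        PowerSeries.constantCoeff_C]
    have hu0 : IsUnit (PowerSeries.constantCoeff u) := PowerSeries.isUnit_iff_constantCoeff.mp HW.isUnit
    have hh0 : IsUnit (PowerSeries.constantCoeff h) := PowerSeries.isUnit_iff_constantCoeff.mp hh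
    intro hmem
    rw [hϖ.maximalIdeal_eq, Ideal.span_singleton_pow, Ideal.mem_span_singleton] at hmem
    obtain ⟨t, ht⟩ := hmem
    obtain ⟨v, hv⟩ := hu0
    have hh0mem : PowerSeries.constantCoeff h ∈ maximalIdeal 𝒪 := by
      rw [hϖ.maximalIdeal_eq, Ideal.mem_span_singleton]
      refine ⟨t * ↑v, mul_left_cancel₀ hϖ.ne_zero ?_⟩
      rw [← hc, ht, ← hv]; ring
    exact (mem_nonunits_iff.mp ((mem_maximalIdeal _).mp hh0mem)) hh0

/-- **Algebraic root data for Eisenstein-system members.** Over a complete DVR `𝒪` of characteristic zero,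
for `P = T^d + ϖ·h` (`ϖ` a uniformiser, `h` a unit, `d ≥ 1`) the Weierstrass polynomial `f` of `P` has degree
`d` and there is a complete DVR `S`, finite over `𝒪`, of characteristic zero, with `u₀ ∈ 𝔪_S`, `f(u₀) = 0` —
exactly what a coefficient-generic `rootDatumS (𝓟.P n)` consumes (`P = f·(unit)` then gives `P(u₀) = 0`). -/
theorem exists_dvr_root_of_eisenstein_shape [IsAdicComplete (maximalIdeal 𝒪) 𝒪] [CharZero 𝒪]
    {ϖ : 𝒪} (hϖ : Irreducible ϖ) {d : ℕ} (hd : 0 < d) {h P : 𝒪⟦X⟧} (hh : IsUnit h)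
    (hP : P = PowerSeries.X ^ d + PowerSeries.C ϖ * h) (hres : P.map (residue 𝒪) ≠ 0) :
    (P.weierstrassDistinguished hres).natDegree = d ∧
    ∃ (S : Type u) (_ : CommRing S) (_ : IsDomain S) (_ : IsDiscreteValuationRing S)
      (_ : IsAdicComplete (IsLocalRing.maximalIdeal S) S) (_ : CharZero S) (_ : Algebra 𝒪 S)
      (_ : Module.Finite 𝒪 S) (u₀ : S),
      u₀ ∈ IsLocalRing.maximalIdeal S ∧
        (P.weierstrassDistinguished hres).eval₂ (algebraMap 𝒪 S) u₀ = 0 := by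
  obtain ⟨hnat, hE⟩ := weierstrassDistinguished_of_eisenstein_shape hϖ hd hh hP hres
  exact ⟨hnat, exists_dvr_root_of_isEisensteinAt _
    (P.isDistinguishedAt_weierstrassDistinguished hres).monic hE (hnat ▸ hd)⟩

end EisensteinShape


end RD

section RootDatum

variable {𝒪 : Type} [CommRing 𝒪] [IsDomain 𝒪] [IsDiscreteValuationRing 𝒪]
  [IsAdicComplete (IsLocalRing.maximalIdeal 𝒪) 𝒪] [CharZero 𝒪] {p : ℕ} [Fact p.Prime] [Fact (Irreducible (p : 𝒪))]

attribute [local instance] algS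

/-- **Root data exist** for every good prime of Eisenstein shape `T^d + p·h` (`h` unit, `d ≥ 1`): `S = 𝒪[X]/(f)`, §E10'. -/
theorem rootDatumS (P : GoodPrime 𝒪 p) {d : ℕ} (hd : 0 < d) {h : Lam₁ 𝒪} (hh : IsUnit h)
    (hP : P.P = PowerSeries.X ^ d + (p : Lam₁ 𝒪) * h) : RootDatumS 𝒪 p P := by
  have hres := P.map_residue_ne_zero
  have HW := P.isWeierstrassFactorization
  have hP' : P.P = PowerSeries.X ^ d + PowerSeries.C (p : 𝒪) * h := by rw [hP, map_natCast]
  obtain ⟨-, S, _, _, _, _, _, _, _, u₀, hu₀, hroot⟩ :=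
    RD.exists_dvr_root_of_eisenstein_shape (Fact.out : Irreducible (p : 𝒪)) hd hh hP' hres
  refine ⟨S, inferInstance, inferInstance, inferInstance, inferInstance, inferInstance, inferInstance,
    inferInstance, u₀, hu₀, ?_⟩
  rw [HW.eq_mul, map_mul, map_mul, ← Polynomial.polynomial_map_coe, evS_coe, Polynomial.eval_map, hroot,
    zero_mul]

end RootDatum

/-! ## E11 (g17″). DOOR 3: the non-vertical primes from the DVR-class fibre bounds (no `PatchingBeta`, no `hnv`)  … (full section note: `QtameDoor5.lean` v1.1) -/

section LowerBoundFinset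

namespace LB

open Summit.BirchSwinnertonDyer.BirchSwinnertonDyer.Theorems.SignedBaseChangeAcDivSpecialization

variable {R : Type*} [CommRing R] [IsNoetherianRing R] [IsDomain R]

/-- Bookkeeping in `ℕ∞` for the exact case (sum version). -/
theorem enat_devissage_step' {E₁ E₃ B₁ B₂ B₃ A₁ A₂ A₃ : ℕ∞} (I₁ : E₁ + B₁ ≤ A₁)
    (I₃ : E₃ + B₃ ≤ A₃) (six : B₂ + A₁ + A₃ = B₁ + B₃ + A₂) (h₁ : B₁ ≠ ⊤) (h₃ : B₃ ≠ ⊤) :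
    (E₁ + E₃) + B₂ ≤ A₂ := by
  have h := enat_devissage_step (m := 1) (by rwa [mul_one]) (by rwa [mul_one]) six h₁ h₃
  rwa [mul_one] at h

/-- **§E11.1 The dévissage inequality for a finite set `J` of height-one primes not containing `s`:**
`Σ_{𝔭 ∈ J} ℓ_𝔭(N) · ℓ_𝔔(R̄/𝔭̄) + ℓ_𝔔(N[s]) ≤ ℓ_𝔔(N/sN)` (`R̄ = R/(s)`, `𝔭̄ = 𝔭R̄`, `ht 𝔔 = 1`, `N` killed by
`c` with `s ∤ c`). Same prime-filtration induction as `lowerBound_devissage`. -/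
theorem lowerBound_devissage_finset {s c : R} (hs : Prime s) (hsc : ¬ s ∣ c)
    (J : Finset (PrimeSpectrum R)) (hJ1 : ∀ 𝔭 ∈ J, 𝔭.asIdeal.height = 1)
    (hJs : ∀ 𝔭 ∈ J, s ∉ 𝔭.asIdeal)
    (𝔔 : PrimeSpectrum (R ⧸ Ideal.span {s})) (hht : 𝔔.asIdeal.height = 1)
    (N : Type*) [AddCommGroup N] [Module R N] [hN : Module.Finite R N] (hcN : ∀ x : N, c • x = 0) :
    (∑ 𝔭 ∈ J, Module.lengthAt R N 𝔭 *
          Module.lengthAt (R ⧸ Ideal.span {s})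
            ((R ⧸ Ideal.span {s}) ⧸ 𝔭.asIdeal.map (Ideal.Quotient.mk (Ideal.span {s}))) 𝔔) +
        Module.lengthAt (R ⧸ Ideal.span {s}) (Submodule.torsionBy R N s) 𝔔 ≤
      Module.lengthAt (R ⧸ Ideal.span {s}) (QuotSMulTop s N) 𝔔 := by
  classical
  haveI hsP : (Ideal.span {s}).IsPrime := (Ideal.span_singleton_prime hs.ne_zero).mpr hs
  have hsurj : Function.Surjective (algebraMap R (R ⧸ Ideal.span {s})) :=
    Ideal.Quotient.mk_surjective
  have hc0 : c ≠ 0 := fun h => hsc (h ▸ dvd_zero s)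
  revert hcN
  induction hN using IsNoetherianRing.induction_on_isQuotientEquivQuotientPrime R with
  | subsingleton N =>
    intro hcN
    rw [Finset.sum_eq_zero (fun 𝔭 _ => by
        rw [Module.lengthAt_eq_zero_of_subsingleton (R := R) (M := N), zero_mul]),
      Module.lengthAt_eq_zero_of_subsingleton (R := R ⧸ Ideal.span {s})
        (M := Submodule.torsionBy R N s), zero_add]
    exact bot_le
  | quotient N q e =>
    intro hcN
    haveI := isScalarTower_quotSMulTop s N
    haveI := isScalarTower_torsionBy s N
    have hcq : c ∈ q.asIdeal := mem_of_equiv_quotient e hcN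
    have hq0 : q.asIdeal ≠ ⊥ := by
      intro h
      rw [h, Ideal.mem_bot] at hcq
      exact hc0 hcq
    -- `ℓ_𝔭(R/𝔮) = 0` for `𝔭 ∈ J`, `𝔭 ≠ 𝔮`
    have hzero : ∀ 𝔭 ∈ J, 𝔭 ≠ q → Module.lengthAt R N 𝔭 = 0 := by
      intro 𝔭 h𝔭 hne
      have hnle : ¬ q.asIdeal ≤ 𝔭.asIdeal := by
        intro hle
        have h1 : 𝔭.asIdeal.height ≤ q.asIdeal.height := by
          rw [hJ1 𝔭 h𝔭, Order.one_le_iff_ne_zero, Ne, Ideal.height_eq_zero_iff_eq_bot]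
          exact hq0
        exact hne (PrimeSpectrum.ext (Ideal.eq_of_le_of_height_le (I := q.asIdeal) (J := 𝔭.asIdeal) hle h1)).symm
      rw [Module.lengthAt_eq_of_linearEquiv e, Module.lengthAt_quotient_eq_zero_of_not_le hnle]
    by_cases hqJ : q ∈ J
    · -- `𝔮 ∈ J`: the sum is `ℓ_𝔔(R̄/𝔮̄)`, `b = 0`
      have hsq : s ∉ q.asIdeal := hJs q hqJ
      haveI := subsingleton_torsionBy_of_equiv_quotient q.isPrime e hsq
      rw [← Finset.add_sum_erase J _ hqJ, Finset.sum_eq_zero (fun 𝔭 h𝔭 => by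
          rw [hzero 𝔭 (Finset.mem_of_mem_erase h𝔭) (Finset.ne_of_mem_erase h𝔭), zero_mul]), add_zero,
        Module.lengthAt_eq_of_linearEquiv e, Module.lengthAt_quotient_self, one_mul,
        Module.lengthAt_eq_zero_of_subsingleton (R := R ⧸ Ideal.span {s})
          (M := Submodule.torsionBy R N s), add_zero]
      -- the surjection `N/sN ↠ R̄/𝔮̄`
      have hker : (q.asIdeal : Submodule R R) ≤ LinearMap.ker (Algebra.linearMap R
          ((R ⧸ Ideal.span {s}) ⧸ q.asIdeal.map (Ideal.Quotient.mk (Ideal.span {s})))) := by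
        intro x hx
        rw [LinearMap.mem_ker, Algebra.linearMap_apply, ← Ideal.Quotient.mk_algebraMap,
          Ideal.Quotient.algebraMap_eq, Ideal.Quotient.eq_zero_iff_mem]
        exact Ideal.mem_map_of_mem _ hx
      let ψ : N →ₗ[R] ((R ⧸ Ideal.span {s}) ⧸ q.asIdeal.map (Ideal.Quotient.mk (Ideal.span {s}))) :=
        (Submodule.liftQ q.asIdeal (Algebra.linearMap R _) hker) ∘ₗ e.toLinearMap
      have hkerψ : (s • ⊤ : Submodule R N) ≤ LinearMap.ker ψ := by
        intro z hz
        obtain ⟨y, -, rfl⟩ := (Submodule.mem_smul_pointwise_iff_exists _ _ _).mp hz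
        rw [LinearMap.mem_ker, map_smul,
          ← IsScalarTower.algebraMap_smul (R ⧸ Ideal.span {s}) s (ψ y), Ideal.Quotient.algebraMap_eq,
          Ideal.Quotient.eq_zero_iff_mem.mpr (Ideal.mem_span_singleton_self s), zero_smul]
      let ψq := ((s • ⊤ : Submodule R N).liftQ ψ hkerψ).extendScalarsOfSurjective hsurj
      refine Module.lengthAt_le_of_surjective ψq (fun y => ?_) 𝔔
      obtain ⟨z, rfl⟩ := Ideal.Quotient.mk_surjective y
      obtain ⟨r, rfl⟩ := Ideal.Quotient.mk_surjective z
      refine ⟨Submodule.Quotient.mk (e.symm (Submodule.Quotient.mk r)), ?_⟩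
      rw [LinearMap.extendScalarsOfSurjective_apply, Submodule.liftQ_apply, LinearMap.comp_apply,
        LinearEquiv.coe_coe, LinearEquiv.apply_symm_apply, Submodule.liftQ_apply, Algebra.linearMap_apply]
      rfl
    · -- `𝔮 ∉ J`: every `e`-term vanishes
      rw [Finset.sum_eq_zero (fun 𝔭 h𝔭 => by
          rw [hzero 𝔭 h𝔭 (fun h => hqJ (h ▸ h𝔭)), zero_mul]), zero_add]
      by_cases hsq : s ∈ q.asIdeal
      · -- `s ∈ 𝔮`: `sN = 0`, so `N[s] ↪ N/sN`
        have hkill : ∀ x : N, s • x = 0 := smul_eq_zero_of_equiv_quotient e hsq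
        have hbot : (s • ⊤ : Submodule R N) = ⊥ := by
          rw [eq_bot_iff]
          intro x hx
          obtain ⟨y, -, rfl⟩ := (Submodule.mem_smul_pointwise_iff_exists _ _ _).mp hx
          exact (Submodule.mem_bot R).mpr (hkill y)
        let φ := ((s • ⊤ : Submodule R N).mkQ ∘ₗ (Submodule.torsionBy R N s).subtype)
          |>.extendScalarsOfSurjective hsurj
        refine Module.lengthAt_le_of_injective φ (fun x y hxy => ?_) 𝔔
        have : ((x : N) - y) ∈ (s • ⊤ : Submodule R N) := by
          rw [← Submodule.Quotient.eq]; exact hxy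
        rw [hbot, Submodule.mem_bot, sub_eq_zero] at this
        exact Subtype.ext this
      · haveI := subsingleton_torsionBy_of_equiv_quotient q.isPrime e hsq
        rw [Module.lengthAt_eq_zero_of_subsingleton (R := R ⧸ Ideal.span {s})
          (M := Submodule.torsionBy R N s)]
        exact bot_le
  | exact N₁ N₂ N₃ f g hf hg hfg ih₁ ih₃ =>
    intro hc₂
    have hc₁ : ∀ x : N₁, c • x = 0 := fun x => hf (by rw [map_smul, hc₂, map_zero])
    have hc₃ : ∀ x : N₃, c • x = 0 := fun x => by
      obtain ⟨y, rfl⟩ := hg x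
      rw [← map_smul, hc₂, map_zero]
    have hsplit : (∑ 𝔭 ∈ J, Module.lengthAt R N₂ 𝔭 *
          Module.lengthAt (R ⧸ Ideal.span {s})
            ((R ⧸ Ideal.span {s}) ⧸ 𝔭.asIdeal.map (Ideal.Quotient.mk (Ideal.span {s}))) 𝔔) =
        (∑ 𝔭 ∈ J, Module.lengthAt R N₁ 𝔭 *
          Module.lengthAt (R ⧸ Ideal.span {s})
            ((R ⧸ Ideal.span {s}) ⧸ 𝔭.asIdeal.map (Ideal.Quotient.mk (Ideal.span {s}))) 𝔔) +
        ∑ 𝔭 ∈ J, Module.lengthAt R N₃ 𝔭 *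
          Module.lengthAt (R ⧸ Ideal.span {s})
            ((R ⧸ Ideal.span {s}) ⧸ 𝔭.asIdeal.map (Ideal.Quotient.mk (Ideal.span {s}))) 𝔔 := by
      rw [← Finset.sum_add_distrib]
      refine Finset.sum_congr rfl fun 𝔭 _ => ?_
      rw [Module.lengthAt_eq_add_of_exact f g hf hg hfg 𝔭, add_mul]
    rw [hsplit]
    exact enat_devissage_step' (ih₁ hc₁) (ih₃ hc₃) (lengthAt_quot_snake s f g hf hg hfg 𝔔)
      (lengthAt_torsionBy_ne_top hs hsc 𝔔 hht N₁ hc₁) (lengthAt_torsionBy_ne_top hs hsc 𝔔 hht N₃ hc₃)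

/-- **§E11.2 The cyclic upper bound.** In a Noetherian UFD `R` with `s` prime, `𝔔` a prime of `R̄ = R/(s)`,
`x ≠ 0` with `s ∤ x`, and `J` a finite set of height-one primes containing every height-one prime through `x`:
`ℓ_𝔔(R̄/(x̄)) ≤ Σ_{𝔭 ∈ J} ℓ_𝔭(R/(x)) · ℓ_𝔔(R̄/𝔭̄)` (induction on the prime factorisation of `x`; additivity of
`ℓ_𝔔(R̄/(·))` in the domain `R̄`). -/
theorem lengthAt_quot_le_sum [UniqueFactorizationMonoid R] {s : R} (hs : Prime s)
    (𝔔 : PrimeSpectrum (R ⧸ Ideal.span {s})) (J : Finset (PrimeSpectrum R))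
    {x : R} (hx : x ≠ 0) (hsx : ¬ s ∣ x)
    (hJ : ∀ 𝔭 : PrimeSpectrum R, 𝔭.asIdeal.height = 1 → x ∈ 𝔭.asIdeal → 𝔭 ∈ J) :
    Module.lengthAt (R ⧸ Ideal.span {s})
        ((R ⧸ Ideal.span {s}) ⧸ Ideal.span {Ideal.Quotient.mk (Ideal.span {s}) x}) 𝔔 ≤
      ∑ 𝔭 ∈ J, Module.lengthAt R (R ⧸ Ideal.span {x}) 𝔭 *
          Module.lengthAt (R ⧸ Ideal.span {s})
            ((R ⧸ Ideal.span {s}) ⧸ 𝔭.asIdeal.map (Ideal.Quotient.mk (Ideal.span {s}))) 𝔔 := by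
  classical
  haveI hsP : (Ideal.span {s}).IsPrime := (Ideal.span_singleton_prime hs.ne_zero).mpr hs
  haveI : IsDomain (R ⧸ Ideal.span {s}) := Ideal.Quotient.isDomain _
  revert hx hsx hJ
  refine UniqueFactorizationMonoid.induction_on_prime x ?_ ?_ ?_
  · intro h; exact absurd rfl h
  · -- units
    intro u hu _ _ _
    have h0 : Module.lengthAt (R ⧸ Ideal.span {s})
        ((R ⧸ Ideal.span {s}) ⧸ Ideal.span {Ideal.Quotient.mk (Ideal.span {s}) u}) 𝔔 = 0 := by
      haveI : Subsingleton ((R ⧸ Ideal.span {s}) ⧸ Ideal.span {Ideal.Quotient.mk (Ideal.span {s}) u}) := by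
        rw [Ideal.span_singleton_eq_top.mpr (hu.map _)]
        exact Ideal.Quotient.subsingleton_iff.mpr rfl
      exact Module.lengthAt_eq_zero_of_subsingleton (R := R ⧸ Ideal.span {s})
        (M := (R ⧸ Ideal.span {s}) ⧸ Ideal.span {Ideal.Quotient.mk (Ideal.span {s}) u}) 𝔔
    rw [h0]
    exact bot_le
  · -- `x = q * a`, `q` prime
    intro a q ha hq ih _ hsqa hJ
    have hsa : ¬ s ∣ a := fun h => hsqa (h.mul_left q)
    have hsq : ¬ s ∣ q := fun h => hsqa (h.mul_right a)
    have hJa : ∀ 𝔭 : PrimeSpectrum R, 𝔭.asIdeal.height = 1 → a ∈ 𝔭.asIdeal → 𝔭 ∈ J :=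
      fun 𝔭 h1 hm => hJ 𝔭 h1 (Ideal.mul_mem_left _ q hm)
    -- the point `(q)` of `J`
    let 𝔮 : PrimeSpectrum R := ⟨Ideal.span {q}, (Ideal.span_singleton_prime hq.ne_zero).mpr hq⟩
    have h𝔮1 : 𝔮.asIdeal.height = 1 :=
      Ideal.height_span_singleton_eq_one_of_mem_nonZeroDivisors (mem_nonZeroDivisors_of_ne_zero hq.ne_zero)
        hq.not_unit
    have h𝔮J : 𝔮 ∈ J := hJ 𝔮 h𝔮1 (Ideal.mem_span_singleton.mpr (dvd_mul_right q a))
    have hqbar : Ideal.Quotient.mk (Ideal.span {s}) q ≠ 0 := by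
      rw [Ne, Ideal.Quotient.eq_zero_iff_mem, Ideal.mem_span_singleton]; exact hsq
    -- additivity on both sides
    rw [map_mul, Module.lengthAt_quotient_span_singleton_mul _ hqbar 𝔔]
    have hsplit : ∑ 𝔭 ∈ J, Module.lengthAt R (R ⧸ Ideal.span {q * a}) 𝔭 *
          Module.lengthAt (R ⧸ Ideal.span {s})
            ((R ⧸ Ideal.span {s}) ⧸ 𝔭.asIdeal.map (Ideal.Quotient.mk (Ideal.span {s}))) 𝔔 =
        (∑ 𝔭 ∈ J, Module.lengthAt R (R ⧸ Ideal.span {q}) 𝔭 *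
          Module.lengthAt (R ⧸ Ideal.span {s})
            ((R ⧸ Ideal.span {s}) ⧸ 𝔭.asIdeal.map (Ideal.Quotient.mk (Ideal.span {s}))) 𝔔) +
        ∑ 𝔭 ∈ J, Module.lengthAt R (R ⧸ Ideal.span {a}) 𝔭 *
          Module.lengthAt (R ⧸ Ideal.span {s})
            ((R ⧸ Ideal.span {s}) ⧸ 𝔭.asIdeal.map (Ideal.Quotient.mk (Ideal.span {s}))) 𝔔 := by
      rw [← Finset.sum_add_distrib]
      refine Finset.sum_congr rfl fun 𝔭 _ => ?_
      rw [Module.lengthAt_quotient_span_singleton_mul a hq.ne_zero 𝔭, add_mul]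
    rw [hsplit]
    refine add_le_add ?_ (ih ha hsa hJa)
    -- `ℓ_𝔔(R̄/(q̄)) = 1 · ℓ_𝔔(R̄/𝔮̄) ≤` the `𝔮`-term of the first sum
    have hterm : Module.lengthAt (R ⧸ Ideal.span {s})
        ((R ⧸ Ideal.span {s}) ⧸ Ideal.span {Ideal.Quotient.mk (Ideal.span {s}) q}) 𝔔 =
        Module.lengthAt R (R ⧸ Ideal.span {q}) 𝔮 *
          Module.lengthAt (R ⧸ Ideal.span {s})
            ((R ⧸ Ideal.span {s}) ⧸ 𝔮.asIdeal.map (Ideal.Quotient.mk (Ideal.span {s}))) 𝔔 := by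
      rw [show Module.lengthAt R (R ⧸ Ideal.span {q}) 𝔮 = 1 from Module.lengthAt_quotient_self 𝔮, one_mul,
        show 𝔮.asIdeal = Ideal.span {q} from rfl, Ideal.map_span, Set.image_singleton]
    rw [hterm]
    exact Finset.single_le_sum (f := fun 𝔭 => Module.lengthAt R (R ⧸ Ideal.span {q}) 𝔭 *
          Module.lengthAt (R ⧸ Ideal.span {s})
            ((R ⧸ Ideal.span {s}) ⧸ 𝔭.asIdeal.map (Ideal.Quotient.mk (Ideal.span {s}))) 𝔔)
      (fun _ _ => zero_le) h𝔮J

end LB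

end LowerBoundFinset

section Door3

variable {𝒪 : Type} [CommRing 𝒪] [IsDomain 𝒪] [IsDiscreteValuationRing 𝒪] [IsAdicComplete (IsLocalRing.maximalIdeal 𝒪) 𝒪] [CharZero 𝒪]
  {p : ℕ} [Fact p.Prime] [Fact (Irreducible (p : 𝒪))]

attribute [local instance] algS

section BaseChangeS

variable (S : Type) [CommRing S] [IsDomain S] [IsDiscreteValuationRing S]
  [IsAdicComplete (IsLocalRing.maximalIdeal S) S] [CharZero S] [Algebra 𝒪 S] [Module.Finite 𝒪 S]

/-! ### E11.4 Flat base change at a general height-one prime of `Λ₂` -/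

/-- `ℓ_{𝔓'}(Λ_{2,S}/𝔓Λ_{2,S}) · ℓ_𝔓(N) ≤ ℓ_{𝔓'}(Λ_{2,S} ⊗_{Λ₂} N)` for `𝔓` of height one, `𝔓'` any prime of
`Λ_{2,S}`, `N` finitely generated killed by `c ≠ 0` (the proof of `lengthAt_baseChange_ge`, verbatim). -/
theorem lengthAt_baseChange_ge' (𝔓 : PrimeSpectrum (Lam₂ 𝒪)) (h𝔓 : 𝔓.asIdeal.height = 1)
    (𝔓' : PrimeSpectrum (PowerSeries (PowerSeries S)))
    (N : Type) [AddCommGroup N] [Module (Lam₂ 𝒪) N] [hN : Module.Finite (Lam₂ 𝒪) N]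
    {c : Lam₂ 𝒪} (hc : c ≠ 0) (hcN : ∀ x : N, c • x = 0) :
    Module.lengthAt (PowerSeries (PowerSeries S))
        (PowerSeries (PowerSeries S) ⧸
          𝔓.asIdeal.map (algebraMap (Lam₂ 𝒪) (PowerSeries (PowerSeries S)))) 𝔓' *
      Module.lengthAt (Lam₂ 𝒪) N 𝔓 ≤
    Module.lengthAt (PowerSeries (PowerSeries S)) ((PowerSeries (PowerSeries S)) ⊗[Lam₂ 𝒪] N) 𝔓' := by
  classical
  haveI := flatS (𝒪 := 𝒪) S
  revert hcN
  induction hN using IsNoetherianRing.induction_on_isQuotientEquivQuotientPrime (Lam₂ 𝒪) with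
  | subsingleton N =>
    intro _
    rw [Module.lengthAt_eq_zero_of_subsingleton (R := Lam₂ 𝒪) (M := N), mul_zero]
    exact bot_le
  | quotient N 𝔮 e =>
    intro hcN
    have hc𝔮 : c ∈ 𝔮.asIdeal := LB.mem_of_equiv_quotient e hcN
    by_cases h𝔮 : 𝔮 = 𝔓
    · subst h𝔮
      rw [Module.lengthAt_eq_of_linearEquiv e, Module.lengthAt_quotient_self, mul_one]
      have e' := (Algebra.TensorProduct.quotIdealMapEquivTensorQuot (PowerSeries (PowerSeries S))
          𝔮.asIdeal).toLinearEquiv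
      exact (Module.lengthAt_eq_of_linearEquiv
        (e'.trans (LinearEquiv.baseChange (Lam₂ 𝒪) (PowerSeries (PowerSeries S)) _ _ e).symm) 𝔓').le
    · have hne : ¬ 𝔮.asIdeal ≤ 𝔓.asIdeal := by
        intro hle
        have h0 : 𝔮.asIdeal ≠ ⊥ := by
          intro h
          rw [h, Ideal.mem_bot] at hc𝔮
          exact hc hc𝔮
        have h1 : 𝔓.asIdeal.height ≤ 𝔮.asIdeal.height := by
          rw [h𝔓, Order.one_le_iff_ne_zero, Ne, Ideal.height_eq_zero_iff_eq_bot]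
          exact h0
        exact h𝔮 (PrimeSpectrum.ext (Ideal.eq_of_le_of_height_le (I := 𝔮.asIdeal) (J := 𝔓.asIdeal) hle h1))
      rw [Module.lengthAt_eq_of_linearEquiv e, Module.lengthAt_quotient_eq_zero_of_not_le hne, mul_zero]
      exact bot_le
  | exact N₁ N₂ N₃ f g hf hg hfg ih₁ ih₃ =>
    intro hcN₂
    have hcN₁ : ∀ x : N₁, c • x = 0 := fun x => hf (by rw [map_smul, hcN₂, map_zero])
    have hcN₃ : ∀ x : N₃, c • x = 0 := fun x => by
      obtain ⟨y, rfl⟩ := hg x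
      rw [← map_smul, hcN₂, map_zero]
    have hf' : Function.Injective (f.baseChange (PowerSeries (PowerSeries S))) := by
      rw [LinearMap.baseChange_eq_ltensor]
      exact Module.Flat.lTensor_preserves_injective_linearMap f hf
    have hg' : Function.Surjective (g.baseChange (PowerSeries (PowerSeries S))) := by
      rw [LinearMap.baseChange_eq_ltensor]
      exact LinearMap.lTensor_surjective _ hg
    have hfg' : Function.Exact (f.baseChange (PowerSeries (PowerSeries S)))
        (g.baseChange (PowerSeries (PowerSeries S))) := by
      rw [LinearMap.baseChange_eq_ltensor, LinearMap.baseChange_eq_ltensor]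
      exact lTensor_exact _ hfg hg
    rw [Module.lengthAt_eq_add_of_exact f g hf hg hfg 𝔓,
      Module.lengthAt_eq_add_of_exact _ _ hf' hg' hfg' 𝔓', mul_add]
    exact add_le_add (ih₁ hcN₁) (ih₃ hcN₃)

/-! ### E11.5 The fibre ring `Λ_{2,S}/(T₂ - u) ≅ S⟦T₁⟧`: dimension `2`; a non-zero prime avoiding `p̄` has height `1` -/

/-- `dim S⟦T⟧ = 2` (tree: `dim 𝒪⟦X₀,…,X_{n-1}⟧ = n + 1`). -/
theorem ringKrullDim_powerSeriesS : ringKrullDim (PowerSeries S) = ((2 : ℕ∞) : WithBot ℕ∞) := by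
  have h := Literature.NumberTheory.GaloisRepresentations.NearlyOrdinaryPresentationCA.ringKrullDim_mvPowerSeries_dvr
    S 1
  rw [ringKrullDim_eq_of_ringEquiv
    (MvPowerSeries.renameEquiv S (Equiv.ofUnique (Fin 1) Unit)).toRingEquiv] at h
  refine h.trans ?_
  norm_cast

include 𝒪 in
/-- A prime `𝔮 ≠ 0` of `Λ_{2,S}/(T₂ - u)` not containing `p̄` has height `1`. -/
theorem height_eq_one_quotS {u : S} (hu : u ∈ IsLocalRing.maximalIdeal S)
    (𝔮 : Ideal (PowerSeries (PowerSeries S) ⧸ Ideal.span {verticalPrimeO S u})) [𝔮.IsPrime]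
    (h0 : 𝔮 ≠ ⊥)
    (hp : Ideal.Quotient.mk (Ideal.span {verticalPrimeO S u}) (p : PowerSeries (PowerSeries S)) ∉ 𝔮) :
    𝔮.height = 1 := by
  set e := eqvS hu with he
  rw [← RingEquiv.height_comap e 𝔮]
  have hne : 𝔮.comap e ≠ ⊥ := by
    intro h
    apply h0
    rw [eq_bot_iff]
    intro x hx
    have hx' : e.symm x ∈ 𝔮.comap e := by
      rw [Ideal.mem_comap]
      show e (e.symm x) ∈ 𝔮
      rwa [RingEquiv.apply_symm_apply]
    rw [h, Ideal.mem_bot, map_eq_zero_iff _ e.symm.injective] at hx'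
    exact (Ideal.mem_bot).mpr hx'
  have h1 : 1 ≤ (𝔮.comap e).height := by
    rw [Order.one_le_iff_ne_zero, Ne, Ideal.height_eq_zero_iff_eq_bot]
    exact hne
  have hpm : (p : PowerSeries S) ∈ IsLocalRing.maximalIdeal (PowerSeries S) := by
    rw [IsLocalRing.mem_maximalIdeal, mem_nonunits_iff, PowerSeries.isUnit_iff_constantCoeff, map_natCast]
    exact (IsLocalRing.mem_maximalIdeal _).mp (natCast_p_mem_maximalIdeal (𝒪 := 𝒪) (p := p) S)
  have hlt : 𝔮.comap e < IsLocalRing.maximalIdeal (PowerSeries S) := by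
    refine lt_of_le_of_ne (IsLocalRing.le_maximalIdeal (Ideal.IsPrime.ne_top inferInstance)) fun h => hp ?_
    rw [← h, Ideal.mem_comap, map_natCast] at hpm
    rwa [map_natCast]
  have h2 := Ideal.height_add_one_le_of_lt_of_isPrime hlt
  have hm : (IsLocalRing.maximalIdeal (PowerSeries S)).height = 2 := by
    have h := IsLocalRing.maximalIdeal_height_eq_ringKrullDim (R := PowerSeries S)
    rw [ringKrullDim_powerSeriesS S] at h
    exact WithBot.coe_injective h
  rw [hm, show (2 : ℕ∞) = 1 + 1 from rfl, ENat.add_le_add_iff_right ENat.one_ne_top] at h2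
  exact le_antisymm h2 h1

/-! ### E11.6 The good-point inequality `ℓ_{(F)}(X) ≤ g` over `Λ_{2,S}` -/

/-- **The good-point inequality.** `P` a good prime with a root `u₀ ∈ 𝔪_S`; `X` killed by `c ≠ 0`, `C P ∤ c`;
`F` a prime of `Λ₂` with `C P ∤ F`; `𝔔 ∋ C P, F` a prime of `Λ₂` avoiding `p` and `G₁`; the fibre
bound at `u₀` for `G = F^g G₁` with slack `p^t` ⟹ `ℓ_{(F)}(X) ≤ g`. (Lying over `Λ₂ ⊆ Λ_{2,S}`, §E11.1 for
the height-one primes of `Λ_{2,S}` through `F`, §E11.4, fibre transport, §E11.2.) -/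
theorem lengthAt_le_of_goodPointS (P : GoodPrime 𝒪 p) {u₀ : S} (hu₀ : u₀ ∈ IsLocalRing.maximalIdeal S)
    (hr : evS hu₀ (PowerSeries.map (algebraMap 𝒪 S) P.P) = 0)
    (X : Type) [AddCommGroup X] [Module (Lam₂ 𝒪) X] [Module.Finite (Lam₂ 𝒪) X]
    {c : Lam₂ 𝒪} (hc : c ≠ 0) (hcX : ∀ x : X, c • x = 0)
    (hPc : ¬ (PowerSeries.C P.P : Lam₂ 𝒪) ∣ c)
    {F : Lam₂ 𝒪} (hF : Prime F) (hPF : ¬ (PowerSeries.C P.P : Lam₂ 𝒪) ∣ F)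
    {G₁ : Lam₂ 𝒪} (g : ℕ)
    (𝔔 : Ideal (Lam₂ 𝒪)) [𝔔.IsPrime] (hCP𝔔 : (PowerSeries.C P.P : Lam₂ 𝒪) ∈ 𝔔)
    (hF𝔔 : F ∈ 𝔔) (hp𝔔 : (p : Lam₂ 𝒪) ∉ 𝔔) (hG₁𝔔 : G₁ ∉ 𝔔)
    {t : ℕ} (hFB : FibreBoundOver 𝒪 p S X (F ^ g * G₁) u₀ t) :
    Module.lengthAt (Lam₂ 𝒪) X
        ⟨Ideal.span {F}, (Ideal.span_singleton_prime hF.ne_zero).mpr hF⟩ ≤ g := by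
  classical
  -- notation and instances
  set Λ := PowerSeries (PowerSeries S) with hΛ
  set ι := algebraMap (Lam₂ 𝒪) Λ with hι
  set π := verticalPrimeO S u₀ with hπdef
  have hπ : Prime π := prime_verticalPrimeO hu₀
  haveI hπP : (Ideal.span {π}).IsPrime := (Ideal.span_singleton_prime hπ.ne_zero).mpr hπ
  haveI : IsDomain (Λ ⧸ Ideal.span {π}) := Ideal.Quotient.isDomain _
  haveI : UniqueFactorizationMonoid Λ :=
    Literature.NumberTheory.IwasawaTheory.uniqueFactorizationMonoid_powerSeries_powerSeries S
  haveI : Module.Finite (Lam₂ 𝒪) Λ := by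
    obtain ⟨n, ⟨e⟩⟩ := exists_linearEquiv_pi (𝒪 := 𝒪) S
    exact Module.Finite.equiv e.symm
  set 𝔓F : PrimeSpectrum (Lam₂ 𝒪) :=
    ⟨Ideal.span {F}, (Ideal.span_singleton_prime hF.ne_zero).mpr hF⟩ with h𝔓F
  have hF1 : 𝔓F.asIdeal.height = 1 :=
    Ideal.height_span_singleton_eq_one_of_mem_nonZeroDivisors (mem_nonZeroDivisors_of_ne_zero hF.ne_zero)
      hF.not_unit
  set Y := Λ ⊗[Lam₂ 𝒪] X with hY
  set A := Λ ⧸ Ideal.span {π} with hA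
  set mk := Ideal.Quotient.mk (Ideal.span {π}) with hmk
  -- (D1): `π ∤ ι F`, `π ∤ ι c`
  have hπF : ¬ π ∣ ι F := fun h => hPF (C_dvd_of_verticalPrimeO_dvd P hu₀ hr h)
  have hπc : ¬ π ∣ ι c := fun h => hPc (C_dvd_of_verticalPrimeO_dvd P hu₀ hr h)
  have hFS0 : ι F ≠ 0 := algebraMap_ne_zero₂ S hF.ne_zero
  have hFbar : mk (ι F) ≠ 0 := by
    rw [Ne, hmk, Ideal.Quotient.eq_zero_iff_mem, Ideal.mem_span_singleton]; exact hπF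
  have hcbar : mk (ι c) ≠ 0 := by
    rw [Ne, hmk, Ideal.Quotient.eq_zero_iff_mem, Ideal.mem_span_singleton]; exact hπc
  -- `ι c` kills `Y`
  have hcY : ∀ y : Y, ι c • y = 0 := by
    intro y
    induction y using TensorProduct.induction_on with
    | zero => rw [smul_zero]
    | tmul a x =>
      rw [TensorProduct.smul_tmul', smul_eq_mul, ← Algebra.smul_def, TensorProduct.smul_tmul, hcX,
        TensorProduct.tmul_zero]
    | add y z hy hz => rw [smul_add, hy, hz, add_zero]
  -- Step 1: a prime `Q ⊇ (π)` of `Λ_{2,S}` lying over `𝔔`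
  have hIP : (Ideal.span {π}).comap ι ≤ 𝔔 := by
    intro x hx
    rw [Ideal.mem_comap, Ideal.mem_span_singleton] at hx
    exact (Ideal.span_singleton_le_iff_mem _).mpr hCP𝔔
      (Ideal.mem_span_singleton.mpr (C_dvd_of_verticalPrimeO_dvd P hu₀ hr hx))
  obtain ⟨Q, hQπ, hQp, hQc⟩ := Ideal.exists_ideal_over_prime_of_isIntegral 𝔔 (Ideal.span {π}) hIP
  haveI := hQp
  -- Step 2: `𝔮 = Q/(π)`, a prime of `A`; membership of `Λ₂`-elements
  have hker : RingHom.ker mk ≤ Q := by rw [hmk, Ideal.mk_ker]; exact hQπ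
  haveI h𝔮p : (Q.map mk).IsPrime := Ideal.map_isPrime_of_surjective Ideal.Quotient.mk_surjective hker
  have hcm : (Q.map mk).comap mk = Q := by
    rw [Ideal.comap_map_of_surjective _ Ideal.Quotient.mk_surjective, ← RingHom.ker_eq_comap_bot,
      Ideal.mk_ker]
    exact sup_eq_left.mpr hQπ
  have hmemΛ : ∀ x : Λ, mk x ∈ Q.map mk ↔ x ∈ Q := fun x => by
    rw [← Ideal.mem_comap, hcm]
  have hmem₂ : ∀ x : Lam₂ 𝒪, mk (ι x) ∈ Q.map mk ↔ x ∈ 𝔔 := fun x => by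
    rw [hmemΛ, ← Ideal.mem_comap, hι, hQc]
  set 𝔮 : PrimeSpectrum A := ⟨Q.map mk, h𝔮p⟩ with h𝔮def
  have hF𝔮 : mk (ι F) ∈ 𝔮.asIdeal := (hmem₂ F).mpr hF𝔔
  have hp𝔮 : mk (p : Λ) ∉ 𝔮.asIdeal := fun h => hp𝔔 ((hmem₂ _).mp (by rwa [map_natCast]))
  have hG₁𝔮 : mk (ι G₁) ∉ 𝔮.asIdeal := fun h => hG₁𝔔 ((hmem₂ _).mp h)
  have hpbar : mk (p : Λ) ≠ 0 := fun h => hp𝔮 (h ▸ 𝔮.asIdeal.zero_mem)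
  have hG₁bar : mk (ι G₁) ≠ 0 := fun h => hG₁𝔮 (h ▸ 𝔮.asIdeal.zero_mem)
  -- Step 3: `ht 𝔮 = 1`
  have h𝔮0 : 𝔮.asIdeal ≠ ⊥ := fun h => hFbar (by
    have h' := hF𝔮; rw [h, Ideal.mem_bot] at h'; exact h')
  have h𝔮1 : 𝔮.asIdeal.height = 1 := height_eq_one_quotS (𝒪 := 𝒪) (p := p) S hu₀ (Q.map mk) h𝔮0 hp𝔮
  -- Step 4: the height-one primes of `Λ_{2,S}` through `ι F`
  have hfin : {𝔭 : PrimeSpectrum Λ | 𝔭.asIdeal.height = 1 ∧ ι F ∈ 𝔭.asIdeal}.Finite := by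
    have hmin := Ideal.finite_minimalPrimes_of_isNoetherianRing Λ (Ideal.span {ι F})
    have hsub : {𝔭 : PrimeSpectrum Λ | 𝔭.asIdeal.height = 1 ∧ ι F ∈ 𝔭.asIdeal} ⊆
        PrimeSpectrum.asIdeal ⁻¹' (Ideal.span {ι F}).minimalPrimes := by
      rintro 𝔭 ⟨h1, hm⟩
      refine Ideal.mem_minimalPrimes_of_height_eq ((Ideal.span_singleton_le_iff_mem _).mpr hm) ?_
      rw [h1, Order.one_le_iff_ne_zero, Ne, Ideal.height_eq_zero_iff_eq_bot, Ideal.span_singleton_eq_bot]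
      exact hFS0
    exact (hmin.preimage fun _ _ _ _ h => PrimeSpectrum.ext h).subset hsub
  set J := hfin.toFinset with hJ
  have hJmem : ∀ 𝔭 : PrimeSpectrum Λ, 𝔭 ∈ J ↔ 𝔭.asIdeal.height = 1 ∧ ι F ∈ 𝔭.asIdeal := fun 𝔭 => by
    rw [hJ, Set.Finite.mem_toFinset]; rfl
  have hJ1 : ∀ 𝔭 ∈ J, 𝔭.asIdeal.height = 1 := fun 𝔭 h => ((hJmem 𝔭).mp h).1
  have hJs : ∀ 𝔭 ∈ J, π ∉ 𝔭.asIdeal := by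
    intro 𝔭 h𝔭 hπ𝔭
    obtain ⟨h1, hm⟩ := (hJmem 𝔭).mp h𝔭
    have hle : Ideal.span {π} ≤ 𝔭.asIdeal := (Ideal.span_singleton_le_iff_mem _).mpr hπ𝔭
    have hh : 𝔭.asIdeal.height ≤ (Ideal.span {π}).height := by rw [h1, ← ptS_asIdeal hu₀, height_ptS hu₀]
    have heq := Ideal.eq_of_le_of_height_le (I := Ideal.span {π}) (J := 𝔭.asIdeal) hle hh
    rw [← heq, Ideal.mem_span_singleton] at hm
    exact hπF hm
  -- abbreviations for the lengths
  set mbar : PrimeSpectrum Λ → ℕ∞ := fun 𝔭 =>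
    Module.lengthAt A (A ⧸ 𝔭.asIdeal.map mk) 𝔮 with hmbar
  set eF : PrimeSpectrum Λ → ℕ∞ := fun 𝔭 => Module.lengthAt Λ (Λ ⧸ Ideal.span {ι F}) 𝔭 with heF
  set sumE := ∑ 𝔭 ∈ J, eF 𝔭 * mbar 𝔭 with hsumE
  set ℓX := Module.lengthAt (Lam₂ 𝒪) X 𝔓F with hℓX
  haveI := LB.isScalarTower_quotSMulTop π Y
  haveI : Module.Finite A (QuotSMulTop π Y) := Module.Finite.of_restrictScalars_finite Λ _ _
  set ℓq := Module.lengthAt A (QuotSMulTop π Y) 𝔮 with hℓq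
  -- Step 5: (LB) for `J`: `Σ_𝔭 ℓ_𝔭(Y) m̄_𝔭 ≤ ℓ_𝔮(Y/πY)`
  have hLB : ∑ 𝔭 ∈ J, Module.lengthAt Λ Y 𝔭 * mbar 𝔭 ≤ ℓq :=
    le_trans le_self_add (LB.lowerBound_devissage_finset hπ hπc J hJ1 hJs 𝔮 h𝔮1 Y hcY)
  -- Step 6: base change termwise: `ℓX · sumE ≤ Σ_𝔭 ℓ_𝔭(Y) m̄_𝔭`
  have hmapF : 𝔓F.asIdeal.map ι = Ideal.span {ι F} := by
    rw [show 𝔓F.asIdeal = Ideal.span {F} from rfl, Ideal.map_span, Set.image_singleton]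
  have hBC : ∀ 𝔭 : PrimeSpectrum Λ, eF 𝔭 * ℓX ≤ Module.lengthAt Λ Y 𝔭 := by
    intro 𝔭
    have h := lengthAt_baseChange_ge' (𝒪 := 𝒪) S 𝔓F hF1 𝔭 X hc hcX
    rwa [Module.lengthAt_eq_of_linearEquiv (Ideal.quotientEquivAlgOfEq Λ hmapF).toLinearEquiv] at h
  have h6 : ℓX * sumE ≤ ∑ 𝔭 ∈ J, Module.lengthAt Λ Y 𝔭 * mbar 𝔭 := by
    rw [hsumE, Finset.mul_sum]
    refine Finset.sum_le_sum fun 𝔭 _ => ?_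
    rw [← mul_assoc, mul_comm ℓX]
    exact mul_le_mul' (hBC 𝔭) le_rfl
  -- Step 7: the fibre bound read at `𝔮`: `ℓq ≤ g · ℓ_𝔮(A/(F̄))`
  have hmem := fibre_transportS hu₀ Y (ι (F ^ g * G₁)) t hFB
  have hcM : ∀ x : QuotSMulTop π Y, mk (ι c) • x = 0 := by
    intro x
    obtain ⟨x, rfl⟩ := Submodule.mkQ_surjective _ x
    show ι c • (Submodule.Quotient.mk x : QuotSMulTop π Y) = 0
    rw [← Submodule.Quotient.mk_smul, hcY, Submodule.Quotient.mk_zero]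
  have hTq : Module.IsTorsion A (QuotSMulTop π Y) := fun x =>
    ⟨⟨mk (ι c), mem_nonZeroDivisors_of_ne_zero hcbar⟩, hcM x⟩
  have hℓqtop : ℓq ≠ ⊤ := Module.lengthAt_ne_top_of_isTorsionBy hcbar (fun x => hcM x) 𝔮 h𝔮1.le
  have hxmem : mk ((p : Λ) ^ t * ι (F ^ g * G₁)) ∈ 𝔮.asIdeal ^ ℓq.toNat :=
    Summit.BirchSwinnertonDyer.Rank1Residual.X11b.CongruenceLimit.charIdeal_le_pow_lengthAt
      (M := QuotSMulTop π Y) hTq 𝔮 h𝔮1 hmem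
  have h7a : ℓq ≤ Module.lengthAt A (A ⧸ Ideal.span {mk ((p : Λ) ^ t * ι (F ^ g * G₁))}) 𝔮 := by
    have hle : Ideal.span {mk ((p : Λ) ^ t * ι (F ^ g * G₁))} ≤ 𝔮.asIdeal ^ ℓq.toNat :=
      (Ideal.span_singleton_le_iff_mem _).mpr hxmem
    calc ℓq = (ℓq.toNat : ℕ∞) := (ENat.coe_toNat hℓqtop).symm
      _ ≤ Module.lengthAt A (A ⧸ 𝔮.asIdeal ^ ℓq.toNat) 𝔮 := natCast_le_lengthAt_quotient_pow 𝔮 h𝔮0 _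
      _ ≤ _ := Module.lengthAt_le_of_surjective (Submodule.factor hle) (Submodule.factor_surjective hle) 𝔮
  have hzero_p : Module.lengthAt A (A ⧸ Ideal.span {mk (p : Λ) ^ t}) 𝔮 = 0 := by
    rw [Module.lengthAt_quotient_span_singleton_pow hpbar t 𝔮,
      Module.lengthAt_quotient_eq_zero_of_not_le (I := Ideal.span {mk (p : Λ)})
        (fun h => hp𝔮 ((Ideal.span_singleton_le_iff_mem _).mp h)), smul_zero]
  have hzero_G₁ : Module.lengthAt A (A ⧸ Ideal.span {mk (ι G₁)}) 𝔮 = 0 :=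
    Module.lengthAt_quotient_eq_zero_of_not_le (I := Ideal.span {mk (ι G₁)})
      (fun h => hG₁𝔮 ((Ideal.span_singleton_le_iff_mem _).mp h))
  have h7 : ℓq ≤ g • Module.lengthAt A (A ⧸ Ideal.span {mk (ι F)}) 𝔮 := by
    refine h7a.trans (le_of_eq ?_)
    rw [map_mul, map_mul, map_mul, map_pow, map_pow, map_pow,
      Module.lengthAt_quotient_span_singleton_mul _ (pow_ne_zero t hpbar) 𝔮, hzero_p, zero_add,
      Module.lengthAt_quotient_span_singleton_mul _ (pow_ne_zero g hFbar) 𝔮, hzero_G₁, add_zero,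
      Module.lengthAt_quotient_span_singleton_pow hFbar g 𝔮]
  -- Step 8: the cyclic upper bound `ℓ_𝔮(A/(F̄)) ≤ sumE`
  have h8 : Module.lengthAt A (A ⧸ Ideal.span {mk (ι F)}) 𝔮 ≤ sumE :=
    LB.lengthAt_quot_le_sum hπ 𝔮 J hFS0 hπF fun 𝔭 h1 hm => (hJmem 𝔭).mpr ⟨h1, hm⟩
  -- Step 9: `0 < sumE < ⊤` and the cancellation
  have hsumE1 : 1 ≤ sumE := by
    refine le_trans ?_ h8
    have hle : Ideal.span {mk (ι F)} ≤ 𝔮.asIdeal := (Ideal.span_singleton_le_iff_mem _).mpr hF𝔮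
    calc (1 : ℕ∞) = Module.lengthAt A (A ⧸ 𝔮.asIdeal) 𝔮 := (Module.lengthAt_quotient_self 𝔮).symm
      _ ≤ _ := Module.lengthAt_le_of_surjective (Submodule.factor hle) (Submodule.factor_surjective hle) 𝔮
  have hsumEtop : sumE ≠ ⊤ := by
    rw [hsumE]
    refine ENat.sum_ne_top.mpr fun 𝔭 h𝔭 => ?_
    have h1 := hJ1 𝔭 h𝔭
    have hm : ι F ∈ 𝔭.asIdeal := ((hJmem 𝔭).mp h𝔭).2
    have he : eF 𝔭 ≠ ⊤ := by
      refine Module.lengthAt_ne_top_of_isTorsionBy (M := Λ ⧸ Ideal.span {ι F}) hFS0 (fun x => ?_) 𝔭 h1.le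
      obtain ⟨b, rfl⟩ := Ideal.Quotient.mk_surjective x
      change Ideal.Quotient.mk (Ideal.span {ι F}) (ι F • b) = 0
      rw [Ideal.Quotient.eq_zero_iff_mem, smul_eq_mul]
      exact Ideal.mul_mem_right b _ (Ideal.mem_span_singleton_self _)
    have hmb : mbar 𝔭 ≠ ⊤ := by
      refine Module.lengthAt_ne_top_of_isTorsionBy (M := A ⧸ 𝔭.asIdeal.map mk) hFbar (fun x => ?_) 𝔮
        h𝔮1.le
      obtain ⟨b, rfl⟩ := Ideal.Quotient.mk_surjective x
      change Ideal.Quotient.mk (𝔭.asIdeal.map mk) (mk (ι F) • b) = 0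
      rw [Ideal.Quotient.eq_zero_iff_mem, smul_eq_mul]
      exact Ideal.mul_mem_right b _ (Ideal.mem_map_of_mem _ hm)
    rw [← ENat.coe_toNat he, ← ENat.coe_toNat hmb, ← Nat.cast_mul]
    exact ENat.coe_ne_top _
  have hℓXtop : ℓX ≠ ⊤ := Module.lengthAt_ne_top_of_isTorsionBy hc hcX 𝔓F hF1.le
  -- the chain `ℓX · sumE ≤ g · sumE`
  have hchain : ℓX * sumE ≤ (g : ℕ∞) * sumE := by
    refine h6.trans (hLB.trans (h7.trans ?_))
    rw [nsmul_eq_mul]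
    exact mul_le_mul' le_rfl h8
  obtain ⟨n, hn⟩ : ∃ n : ℕ, sumE = n := ⟨sumE.toNat, (ENat.coe_toNat hsumEtop).symm⟩
  obtain ⟨k, hk⟩ : ∃ k : ℕ, ℓX = k := ⟨ℓX.toNat, (ENat.coe_toNat hℓXtop).symm⟩
  have hn0 : 0 < n := by
    have h := hsumE1; rw [hn] at h; exact_mod_cast h
  rw [hn, hk] at hchain
  rw [hk]
  have hkn : k * n ≤ g * n := by exact_mod_cast hchain
  exact_mod_cast Nat.le_of_mul_le_mul_right hkn hn0

end BaseChangeS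

end Door3

/-! ## E14 (g22). DOOR 5 — two-direction CLASSICAL patching  … (full section note: `QtameDoor5.lean` v1.1) -/

section Door5

variable {𝒪 : Type} [CommRing 𝒪] [IsDomain 𝒪] [IsDiscreteValuationRing 𝒪] [IsAdicComplete (IsLocalRing.maximalIdeal 𝒪) 𝒪] [CharZero 𝒪]
  {p : ℕ} [Fact p.Prime] [Fact (Irreducible (p : 𝒪))]

attribute [local instance] algS

/-! ### E14.1 Small algebra: units plus maximal-ideal elements, `p` prime in `Λ₁`, reduction mod `p` -/

theorem isUnit_add_of_mem_maximalIdeal {R : Type*} [CommRing R] [IsLocalRing R] {a b : R} (ha : IsUnit a)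
    (hb : b ∈ IsLocalRing.maximalIdeal R) : IsUnit (a + b) := by
  by_contra h
  have hab : a + b ∈ IsLocalRing.maximalIdeal R := (IsLocalRing.mem_maximalIdeal _).mpr (mem_nonunits_iff.mpr h)
  have ha' : a ∈ IsLocalRing.maximalIdeal R := by
    have := Ideal.sub_mem _ hab hb; rwa [add_sub_cancel_right] at this
  exact (IsLocalRing.mem_maximalIdeal _).mp ha' ha

theorem prime_natCast_p₁ : Prime (p : Lam₁ 𝒪) := by
  rw [← map_natCast (PowerSeries.C (R := 𝒪)) p]
  exact prime_C_of_prime (prime_p𝒪 (𝒪 := 𝒪) (p := p))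

theorem not_isUnit_natCast_p₂ : ¬ IsUnit (p : Lam₂ 𝒪) := by
  rw [PowerSeries.isUnit_iff_constantCoeff, map_natCast, PowerSeries.isUnit_iff_constantCoeff, map_natCast]
  exact (not_isUnit_p𝒪 (𝒪 := 𝒪) (p := p))

/-- `map residue a = 0 ⟹ p ∣ a` in `Λ₁`. -/
theorem natCast_dvd_of_map_residue_eq_zero₁ {a : Lam₁ 𝒪}
    (h : PowerSeries.map (IsLocalRing.residue 𝒪) a = 0) : (p : Lam₁ 𝒪) ∣ a := by
  have hmem : a ∈ kerRes₁ 𝒪 := (RingHom.mem_ker).mpr h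
  rw [kerRes₁_eq_span (maximalIdeal_eq_span_p𝒪 (𝒪 := 𝒪) (p := p)), Ideal.mem_span_singleton, map_natCast] at hmem
  exact hmem

/-- `map (map residue) F = 0 ⟹ p ∣ F` in `Λ₂`. -/
theorem natCast_dvd_of_map_residue_eq_zero₂ {F : Lam₂ 𝒪}
    (h : PowerSeries.map (PowerSeries.map (IsLocalRing.residue 𝒪)) F = 0) : (p : Lam₂ 𝒪) ∣ F := by
  rw [natCast_p_eq_C]
  refine C_dvd_of_forall_dvd_coeff fun i => natCast_dvd_of_map_residue_eq_zero₁ (𝒪 := 𝒪) (p := p) ?_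
  have := congrArg (PowerSeries.coeff i) h
  rwa [PowerSeries.coeff_map, map_zero] at this

/-- `g ≠ 0` in `Λ₁` is `p^μ · g'` with `g' mod p ≠ 0`. -/
theorem exists_eq_pow_mul_map_residue_ne_zero {g : Lam₁ 𝒪} (hg : g ≠ 0) :
    ∃ (μ : ℕ) (g' : Lam₁ 𝒪), g = (p : Lam₁ 𝒪) ^ μ * g' ∧
      PowerSeries.map (IsLocalRing.residue 𝒪) g' ≠ 0 := by
  obtain ⟨μ, g', hnd, rfl⟩ := WfDvdMonoid.max_power_factor hg (prime_natCast_p₁ (𝒪 := 𝒪) (p := p)).irreducible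
  exact ⟨μ, g', rfl, fun h => hnd (natCast_dvd_of_map_residue_eq_zero₁ (𝒪 := 𝒪) (p := p) h)⟩

/-- Lifting the `T`-adic expansion mod `p`: if `T^m ∣ (a mod p)` then `a = T^m·w + p·r` with
`w mod p = (a mod p)/T^m`. -/
theorem exists_eq_X_pow_mul_add₁ (a : Lam₁ 𝒪) (m : ℕ)
    (hm : (m : ℕ∞) ≤ (PowerSeries.map (IsLocalRing.residue 𝒪) a).order) :
    ∃ w r : Lam₁ 𝒪, a = PowerSeries.X ^ m * w + (p : Lam₁ 𝒪) * r ∧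
      PowerSeries.map (IsLocalRing.residue 𝒪) w =
        PowerSeries.mk fun i => PowerSeries.coeff (i + m) (PowerSeries.map (IsLocalRing.residue 𝒪) a) := by
  set abar := PowerSeries.map (IsLocalRing.residue 𝒪) a with habar
  set bbar : PowerSeries (IsLocalRing.ResidueField 𝒪) := PowerSeries.mk fun i => PowerSeries.coeff (i + m) abar
  have hfac : abar = PowerSeries.X ^ m * bbar := by
    ext j
    rw [PowerSeries.coeff_X_pow_mul']
    split_ifs with hj
    · rw [PowerSeries.coeff_mk, Nat.sub_add_cancel hj]
    · exact PowerSeries.coeff_of_lt_order j (lt_of_lt_of_le (by exact_mod_cast not_le.mp hj) hm)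
  obtain ⟨w, hw⟩ := PowerSeries.map_surjective _ IsLocalRing.residue_surjective bbar
  have hker : PowerSeries.map (IsLocalRing.residue 𝒪) (a - PowerSeries.X ^ m * w) = 0 := by
    rw [map_sub, map_mul, map_pow, PowerSeries.map_X, hw, ← habar, hfac, sub_self]
  obtain ⟨r, hr⟩ := natCast_dvd_of_map_residue_eq_zero₁ (𝒪 := 𝒪) (p := p) hker
  exact ⟨w, r, by rw [← hr, add_sub_cancel], hw⟩

/-! ### E14.2 Eisenstein systems of good primes -/

variable (𝒪 p) in
/-- An **Eisenstein system**: good primes `P_n = T₂^{d_n} + p·h_n` of `Λ₁` with `h_n ∈ Λ₁^×` and `d_n` strictly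
increasing (the classical points of one axis direction; model: `P_n = Φ_{p^{n+1}}(1+T₂)`, §E14.9). -/
structure EisensteinSystem where
  /-- the `n`-th prime -/
  P : ℕ → GoodPrime 𝒪 p
  /-- its Weierstrass degree -/
  d : ℕ → ℕ
  /-- the unit cofactor -/
  h : ℕ → Lam₁ 𝒪
  shape : ∀ n, (P n).P = PowerSeries.X ^ d n + (p : Lam₁ 𝒪) * h n
  isUnit_h : ∀ n, IsUnit (h n)
  strictMono_d : StrictMono d

namespace EisensteinSystem

variable (𝓟 : EisensteinSystem 𝒪 p)

theorem le_d (n : ℕ) : n ≤ 𝓟.d n := 𝓟.strictMono_d.le_apply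

theorem d_pos (n : ℕ) : 0 < 𝓟.d n := by
  by_contra h0
  apply (𝓟.P n).prime.not_unit
  rw [𝓟.shape n, show 𝓟.d n = 0 by omega, pow_zero, PowerSeries.isUnit_iff_constantCoeff, map_add, map_one,
    map_mul, map_natCast]
  have h1 := isUnit_one_sub_p_mulS (𝒪 := 𝒪) (p := p) 𝒪 (-PowerSeries.constantCoeff (𝓟.h n))
  rwa [mul_neg, sub_neg_eq_add] at h1

/-- Two distinct members generate `p`: `P_m - T₂^{d_m-d_n}·P_n = p·(unit)`. -/
theorem natCast_mem_span_pair {n m : ℕ} (hnm : n ≠ m) :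
    (p : Lam₁ 𝒪) ∈ Ideal.span {(𝓟.P n).P, (𝓟.P m).P} := by
  wlog hlt : n < m generalizing n m
  · have h := this hnm.symm (lt_of_le_of_ne (not_lt.mp hlt) hnm.symm)
    rwa [Set.pair_comm] at h
  have hd : 𝓟.d n < 𝓟.d m := 𝓟.strictMono_d hlt
  set k := 𝓟.d m - 𝓟.d n with hk
  have hw : IsUnit (𝓟.h m - PowerSeries.X ^ k * 𝓟.h n) := by
    rw [PowerSeries.isUnit_iff_constantCoeff, map_sub, map_mul, map_pow, PowerSeries.constantCoeff_X,
      zero_pow (by omega), zero_mul, sub_zero, ← PowerSeries.isUnit_iff_constantCoeff]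
    exact 𝓟.isUnit_h m
  obtain ⟨w, hw'⟩ := hw
  have hkd : k + 𝓟.d n = 𝓟.d m := by omega
  have hrel : (𝓟.P m).P - PowerSeries.X ^ k * (𝓟.P n).P = (p : Lam₁ 𝒪) * (w : Lam₁ 𝒪) := by
    rw [hw', 𝓟.shape m, 𝓟.shape n, ← hkd, pow_add]; ring
  rw [Ideal.mem_span_pair]
  refine ⟨-(PowerSeries.X ^ k * ((w⁻¹ : (Lam₁ 𝒪)ˣ) : Lam₁ 𝒪)),
    ((w⁻¹ : (Lam₁ 𝒪)ˣ) : Lam₁ 𝒪), ?_⟩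
  have : ((𝓟.P m).P - PowerSeries.X ^ k * (𝓟.P n).P) * ((w⁻¹ : (Lam₁ 𝒪)ˣ) : Lam₁ 𝒪) =
      (p : Lam₁ 𝒪) := by
    rw [hrel, mul_assoc, Units.mul_inv, mul_one]
  rw [← this]; ring

/-! ### E14.3 Classical points are DEEP and FLEE: at a root `u₀` of `P_n`, `u₀^{d_n} ∣ p`, and
`a(u₀) = u₀^{ord_T(a mod p)}·(unit)` once `d_n` exceeds that order -/

section Roots

variable {S : Type} [CommRing S] [IsDomain S] [IsDiscreteValuationRing S]
  [IsAdicComplete (IsLocalRing.maximalIdeal S) S] [CharZero S] [Algebra 𝒪 S] [Module.Finite 𝒪 S]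

theorem root_pow_eq (n : ℕ) {u₀ : S} (hu₀ : u₀ ∈ IsLocalRing.maximalIdeal S)
    (hr : evS hu₀ (PowerSeries.map (algebraMap 𝒪 S) (𝓟.P n).P) = 0) :
    u₀ ^ 𝓟.d n = -((p : S) * evS hu₀ (PowerSeries.map (algebraMap 𝒪 S) (𝓟.h n))) := by
  rw [𝓟.shape n, map_add, map_pow, PowerSeries.map_X, map_mul, map_natCast, map_add, map_pow, evS_X, map_mul,
    map_natCast] at hr
  exact eq_neg_of_add_eq_zero_left hr

theorem isUnit_evS_h (n : ℕ) {u₀ : S} (hu₀ : u₀ ∈ IsLocalRing.maximalIdeal S) :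
    IsUnit (evS hu₀ (PowerSeries.map (algebraMap 𝒪 S) (𝓟.h n))) :=
  ((𝓟.isUnit_h n).map _).map _

/-- DEEP: `u₀^{d_n} ∣ p`. -/
theorem pow_d_dvd_natCast (n : ℕ) {u₀ : S} (hu₀ : u₀ ∈ IsLocalRing.maximalIdeal S)
    (hr : evS hu₀ (PowerSeries.map (algebraMap 𝒪 S) (𝓟.P n).P) = 0) : u₀ ^ 𝓟.d n ∣ (p : S) := by
  obtain ⟨e, he⟩ := 𝓟.isUnit_evS_h n hu₀
  have h := 𝓟.root_pow_eq n hu₀ hr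
  rw [← he] at h
  exact ⟨-(↑e⁻¹ : S), by rw [mul_neg, h, neg_mul, neg_neg, mul_assoc, Units.mul_inv, mul_one]⟩

theorem root_ne_zero (n : ℕ) {u₀ : S} (hu₀ : u₀ ∈ IsLocalRing.maximalIdeal S)
    (hr : evS hu₀ (PowerSeries.map (algebraMap 𝒪 S) (𝓟.P n).P) = 0) : u₀ ≠ 0 := by
  intro h0
  have h := 𝓟.pow_d_dvd_natCast n hu₀ hr
  rw [h0, zero_pow (𝓟.d_pos n).ne', zero_dvd_iff] at h
  exact natCast_p_ne_zeroS S h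

/-- `u₀^m ∣ a(u₀)` whenever `T^m ∣ (a mod p)` and `m ≤ d_n`. -/
theorem pow_dvd_evS (n : ℕ) {u₀ : S} (hu₀ : u₀ ∈ IsLocalRing.maximalIdeal S)
    (hr : evS hu₀ (PowerSeries.map (algebraMap 𝒪 S) (𝓟.P n).P) = 0) (a : Lam₁ 𝒪) (m : ℕ)
    (hm : (m : ℕ∞) ≤ (PowerSeries.map (IsLocalRing.residue 𝒪) a).order) (hmn : m ≤ 𝓟.d n) :
    u₀ ^ m ∣ evS hu₀ (PowerSeries.map (algebraMap 𝒪 S) a) := by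
  obtain ⟨w, r, ha, -⟩ := exists_eq_X_pow_mul_add₁ (𝒪 := 𝒪) (p := p) a m hm
  rw [ha, map_add, map_mul, map_pow, PowerSeries.map_X, map_mul, map_natCast, map_add, map_mul, map_pow, evS_X,
    map_mul, map_natCast]
  exact dvd_add (dvd_mul_right _ _)
    (((pow_dvd_pow u₀ hmn).trans (𝓟.pow_d_dvd_natCast n hu₀ hr)).mul_right _)

/-- FLEE: `a(u₀) = u₀^m·(unit)` when `ord_T(a mod p) = m < d_n`. -/
theorem evS_eq_pow_mul_unit (n : ℕ) {u₀ : S} (hu₀ : u₀ ∈ IsLocalRing.maximalIdeal S)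
    (hr : evS hu₀ (PowerSeries.map (algebraMap 𝒪 S) (𝓟.P n).P) = 0) (a : Lam₁ 𝒪) (m : ℕ)
    (hm : (PowerSeries.map (IsLocalRing.residue 𝒪) a).order = m) (hmn : m < 𝓟.d n) :
    ∃ v : S, IsUnit v ∧ evS hu₀ (PowerSeries.map (algebraMap 𝒪 S) a) = u₀ ^ m * v := by
  obtain ⟨w, r, ha, hw⟩ := exists_eq_X_pow_mul_add₁ (𝒪 := 𝒪) (p := p) a m hm.ge
  -- `w` is a unit: its constant coefficient reduces to `coeff m (a mod p) ≠ 0`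
  have hwU : IsUnit w := by
    rw [PowerSeries.isUnit_iff_constantCoeff, ← IsLocalRing.notMem_maximalIdeal, ← IsLocalRing.residue_eq_zero_iff]
    have h1 : IsLocalRing.residue 𝒪 (PowerSeries.coeff 0 w) =
        PowerSeries.coeff m (PowerSeries.map (IsLocalRing.residue 𝒪) a) := by
      have := congrArg (PowerSeries.coeff 0) hw
      rwa [PowerSeries.coeff_map, PowerSeries.coeff_mk, zero_add] at this
    rw [← PowerSeries.coeff_zero_eq_constantCoeff_apply, h1]
    exact (PowerSeries.order_eq_nat.mp hm).1
  obtain ⟨c, hc⟩ := 𝓟.pow_d_dvd_natCast n hu₀ hr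
  refine ⟨evS hu₀ (PowerSeries.map (algebraMap 𝒪 S) w) +
      u₀ ^ (𝓟.d n - m) * c * evS hu₀ (PowerSeries.map (algebraMap 𝒪 S) r), ?_, ?_⟩
  · refine isUnit_add_of_mem_maximalIdeal ((hwU.map _).map _) (Ideal.mul_mem_right _ _ (Ideal.mul_mem_right _ _ ?_))
    exact Ideal.pow_mem_of_mem _ hu₀ _ (Nat.sub_pos_of_lt hmn)
  · rw [ha, map_add, map_mul, map_pow, PowerSeries.map_X, map_mul, map_natCast, map_add, map_mul, map_pow, evS_X,
      map_mul, map_natCast, hc, mul_add, ← mul_assoc, ← mul_assoc, ← pow_add, Nat.add_sub_cancel' hmn.le]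

/-- A root of `P_n` kills exactly the multiples of `P_n`; so `P_n ∤ a` once `a` flees. -/
theorem not_dvd_of_order_lt (n : ℕ) {u₀ : S} (hu₀ : u₀ ∈ IsLocalRing.maximalIdeal S)
    (hr : evS hu₀ (PowerSeries.map (algebraMap 𝒪 S) (𝓟.P n).P) = 0) {a : Lam₁ 𝒪} (μ m : ℕ)
    (hm : (PowerSeries.map (IsLocalRing.residue 𝒪) a).order = m) (hmn : m < 𝓟.d n) :
    ¬ (𝓟.P n).P ∣ (p : Lam₁ 𝒪) ^ μ * a := by
  rintro hdvd
  have hPa : (𝓟.P n).P ∣ a := by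
    rcases (𝓟.P n).prime.dvd_or_dvd hdvd with h | h
    · exact absurd ((𝓟.P n).prime.dvd_of_dvd_pow h) (𝓟.P n).not_dvd
    · exact h
  obtain ⟨q, hq⟩ := hPa
  obtain ⟨v, hv, hev⟩ := 𝓟.evS_eq_pow_mul_unit n hu₀ hr a m hm hmn
  have h0 : evS hu₀ (PowerSeries.map (algebraMap 𝒪 S) a) = 0 := by rw [hq, map_mul, map_mul, hr, zero_mul]
  rw [hev] at h0
  exact (mul_ne_zero (pow_ne_zero _ (𝓟.root_ne_zero n hu₀ hr)) hv.ne_zero) h0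

end Roots

end EisensteinSystem

/-! ### E14.4 Visibility and the dichotomy -/

variable (𝒪 p) in
/-- `F ∈ Λ₂` is **visible** (in direction 2) if some `T₁`-coefficient of `F mod p ∈ k⟦T₂⟧⟦T₁⟧` has `T₂`-order strictly
below that of the constant `T₁`-coefficient. -/
def Visible (F : Lam₂ 𝒪) : Prop :=
  ∃ i : ℕ, (PowerSeries.coeff i (PowerSeries.map (PowerSeries.map (IsLocalRing.residue 𝒪)) F)).order <
    (PowerSeries.constantCoeff (PowerSeries.map (PowerSeries.map (IsLocalRing.residue 𝒪)) F)).order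

/-- An invisible `F` with `p ∤ F` reduces to `C(T₂^λ)·(unit)`. -/
theorem exists_eq_C_X_pow_mul_unit_of_not_visible {F : Lam₂ 𝒪} (hpF : ¬ (p : Lam₂ 𝒪) ∣ F)
    (hinv : ¬ Visible 𝒪 F) :
    ∃ (n : ℕ) (U : PowerSeries (PowerSeries (IsLocalRing.ResidueField 𝒪))), IsUnit U ∧
      PowerSeries.map (PowerSeries.map (IsLocalRing.residue 𝒪)) F = PowerSeries.C (PowerSeries.X ^ n) * U := by
  set Fb := PowerSeries.map (PowerSeries.map (IsLocalRing.residue 𝒪)) F with hFb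
  have hFb0 : Fb ≠ 0 := fun h => hpF (natCast_dvd_of_map_residue_eq_zero₂ h)
  obtain ⟨i, hi⟩ := PowerSeries.exists_coeff_ne_zero_iff_ne_zero.mpr hFb0
  simp only [Visible, not_exists, not_lt, ← hFb] at hinv
  have htop : (PowerSeries.constantCoeff Fb).order ≠ ⊤ := by
    intro h
    have := hinv i; rw [h, top_le_iff, PowerSeries.order_eq_top] at this
    exact hi this
  set n := (PowerSeries.constantCoeff Fb).order.toNat with hn
  have hord : (PowerSeries.constantCoeff Fb).order = n := (ENat.coe_toNat htop).symm
  have hdvd : ∀ j, PowerSeries.X ^ n ∣ PowerSeries.coeff j Fb := fun j =>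
    PowerSeries.X_pow_dvd_iff.mpr fun m hm =>
      PowerSeries.coeff_of_lt_order m (lt_of_lt_of_le (by rw [hord]; exact_mod_cast hm) (hinv j))
  choose b hb using hdvd
  refine ⟨n, PowerSeries.mk b, ?_, ?_⟩
  · rw [PowerSeries.isUnit_iff_constantCoeff, ← PowerSeries.coeff_zero_eq_constantCoeff_apply, PowerSeries.coeff_mk,
      PowerSeries.isUnit_iff_constantCoeff, isUnit_iff_ne_zero]
    have h1 := (PowerSeries.order_eq_nat.mp hord).1
    rw [← PowerSeries.coeff_zero_eq_constantCoeff_apply, hb 0, PowerSeries.coeff_X_pow_mul', if_pos le_rfl,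
      Nat.sub_self, PowerSeries.coeff_zero_eq_constantCoeff_apply] at h1
    exact h1
  · ext j : 1
    rw [PowerSeries.coeff_C_mul, PowerSeries.coeff_mk, hb j]

theorem constantCoeff_map' {R T : Type*} [Semiring R] [Semiring T] (f : R →+* T) (φ : PowerSeries R) :
    PowerSeries.constantCoeff (PowerSeries.map f φ) = f (PowerSeries.constantCoeff φ) := by
  rw [← PowerSeries.coeff_zero_eq_constantCoeff_apply, PowerSeries.coeff_map, PowerSeries.coeff_zero_eq_constantCoeff_apply]

theorem isUnit_of_isUnit_map_residue₂ {F : Lam₂ 𝒪}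
    (h : IsUnit (PowerSeries.map (PowerSeries.map (IsLocalRing.residue 𝒪)) F)) : IsUnit F := by
  rw [PowerSeries.isUnit_iff_constantCoeff, PowerSeries.isUnit_iff_constantCoeff, ← IsLocalRing.notMem_maximalIdeal,
    ← IsLocalRing.residue_eq_zero_iff]
  have h2 := (h.map PowerSeries.constantCoeff).map PowerSeries.constantCoeff
  rw [constantCoeff_map', constantCoeff_map'] at h2
  exact h2.ne_zero

/-- **Visibility dichotomy.** A non-unit `F` with `p ∤ F` is visible in direction 2 or its transpose is. -/
theorem visible_or_visible_transpose {F : Lam₂ 𝒪} (hFu : ¬ IsUnit F) (hpF : ¬ (p : Lam₂ 𝒪) ∣ F) :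
    Visible 𝒪 F ∨ Visible 𝒪 (IntSeries.transpose F) := by
  by_contra h
  push Not at h
  have hpFt : ¬ (p : Lam₂ 𝒪) ∣ IntSeries.transpose F := by
    rintro ⟨q, hq⟩
    refine hpF ⟨IntSeries.transpose q, ?_⟩
    have := congrArg IntSeries.transpose hq
    rwa [IntSeries.transpose_transpose, ← IntSeries.transposeRingEquiv_apply, map_mul, map_natCast,
      IntSeries.transposeRingEquiv_apply] at this
  obtain ⟨n, U, hU, hFU⟩ := exists_eq_C_X_pow_mul_unit_of_not_visible hpF h.1
  obtain ⟨m, V, hV, hFV⟩ := exists_eq_C_X_pow_mul_unit_of_not_visible hpFt h.2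
  rw [IntSeries.map_map_transpose] at hFV
  -- `F mod p = T₂ ↦`: transpose back: `F̄ = T₁^m · Vᵗ`
  have hFV' : PowerSeries.map (PowerSeries.map (IsLocalRing.residue 𝒪)) F =
      PowerSeries.X ^ m * IntSeries.transpose V := by
    have := congrArg IntSeries.transpose hFV
    rwa [IntSeries.transpose_transpose, ← IntSeries.transposeRingEquiv_apply, map_mul,
      IntSeries.transposeRingEquiv_apply, IntSeries.transposeRingEquiv_apply, IntSeries.transpose_C, map_pow,
      PowerSeries.map_X] at this
  have hVt : IsUnit (IntSeries.transpose V) := by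
    rw [← IntSeries.transposeRingEquiv_apply]; exact hV.map _
  rcases Nat.eq_zero_or_pos m with hm | hm
  · rw [hm, pow_zero, one_mul] at hFV'
    exact hFu (isUnit_of_isUnit_map_residue₂ (hFV' ▸ hVt))
  · have h1 := congrArg PowerSeries.constantCoeff (hFU.symm.trans hFV')
    rw [map_mul, PowerSeries.constantCoeff_C, map_mul, map_pow, PowerSeries.constantCoeff_X, zero_pow hm.ne',
      zero_mul, mul_eq_zero] at h1
    rcases h1 with h1 | h1
    · exact PowerSeries.X_ne_zero (pow_eq_zero_iff (n := n) (by
        rintro rfl; rw [pow_zero] at h1; exact one_ne_zero h1) |>.mp h1)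
    · exact (hU.map PowerSeries.constantCoeff).ne_zero h1

/-! ### E14.5 The bad levels are finite: a prime `𝔔 ∌ p` through `F`, `G₁` (`F ∤ G₁`) and `C P_n` is minimal over
`(F, G₁)` (`dim Λ₂ = 3`), and each such prime hosts at most one level `n` -/

theorem EisensteinSystem.eventually_no_bad_prime (𝓟 : EisensteinSystem 𝒪 p) {F G₁ : Lam₂ 𝒪} (hF : Prime F)
    (hFG₁ : ¬ F ∣ G₁) :
    ∃ N : ℕ, ∀ n, N ≤ n → ∀ 𝔔 : Ideal (Lam₂ 𝒪), 𝔔.IsPrime → F ∈ 𝔔 → G₁ ∈ 𝔔 →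
      (p : Lam₂ 𝒪) ∉ 𝔔 → (PowerSeries.C (𝓟.P n).P : Lam₂ 𝒪) ∈ 𝔔 → False := by
  classical
  set I : Ideal (Lam₂ 𝒪) := Ideal.span {F, G₁} with hI
  have hM : I.minimalPrimes.Finite := Ideal.finite_minimalPrimes_of_isNoetherianRing _ I
  -- each minimal prime avoiding `p` hosts at most one level
  have hsub : ∀ 𝔔 ∈ I.minimalPrimes, ({n : ℕ | (p : Lam₂ 𝒪) ∉ 𝔔 ∧
      (PowerSeries.C (𝓟.P n).P : Lam₂ 𝒪) ∈ 𝔔} : Set ℕ).Subsingleton := by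
    rintro 𝔔 - n ⟨hpn, hn⟩ m ⟨-, hm⟩
    by_contra hnm
    obtain ⟨a, b, hab⟩ := Ideal.mem_span_pair.mp (𝓟.natCast_mem_span_pair hnm)
    apply hpn
    rw [natCast_p_eq_C, ← hab, map_add, map_mul, map_mul]
    exact Ideal.add_mem _ (Ideal.mul_mem_left _ _ hn) (Ideal.mul_mem_left _ _ hm)
  set B : Set ℕ := ⋃ 𝔔 ∈ I.minimalPrimes, {n : ℕ | (p : Lam₂ 𝒪) ∉ 𝔔 ∧
      (PowerSeries.C (𝓟.P n).P : Lam₂ 𝒪) ∈ 𝔔} with hB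
  have hBfin : B.Finite := hM.biUnion fun 𝔔 h𝔔 => (hsub 𝔔 h𝔔).finite
  obtain ⟨N₀, hN₀⟩ := hBfin.bddAbove
  refine ⟨N₀ + 1, fun n hn 𝔔 h𝔔 hF𝔔 hG₁𝔔 hp𝔔 hP𝔔 => ?_⟩
  -- `𝔔` is a minimal prime of `I`: heights `2 ≤ ht 𝔔' ≤ ht 𝔔 ≤ 2`
  have hI𝔔 : I ≤ 𝔔 := by
    rw [hI, Ideal.span_le]; rintro x (rfl | rfl) <;> assumption
  obtain ⟨𝔔', h𝔔'M, hle⟩ := Ideal.exists_minimalPrimes_le hI𝔔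
  haveI h𝔔'p : 𝔔'.IsPrime := h𝔔'M.1.1
  have hI𝔔' : I ≤ 𝔔' := h𝔔'M.1.2
  haveI hFp : (Ideal.span {F}).IsPrime := (Ideal.span_singleton_prime hF.ne_zero).mpr hF
  have hlt1 : (⊥ : Ideal (Lam₂ 𝒪)) < Ideal.span {F} :=
    bot_lt_iff_ne_bot.mpr (mt Ideal.span_singleton_eq_bot.mp hF.ne_zero)
  have hlt2 : Ideal.span {F} < 𝔔' := by
    refine lt_of_le_of_ne ((Ideal.span_singleton_le_iff_mem _).mpr (hI𝔔' (Ideal.subset_span (by simp)))) ?_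
    intro h
    have hG : G₁ ∈ Ideal.span {F} := h ▸ hI𝔔' (Ideal.subset_span (by simp))
    exact hFG₁ (Ideal.mem_span_singleton.mp hG)
  have h2 : (2 : ℕ∞) ≤ 𝔔'.height := by
    have a := Order.add_one_le_of_lt (Ideal.height_strict_mono_of_isPrime_of_isPrime hlt1)
    have b := Order.add_one_le_of_lt (Ideal.height_strict_mono_of_isPrime_of_isPrime hlt2)
    rw [Ideal.height_bot, zero_add] at a
    calc (2 : ℕ∞) = 1 + 1 := by norm_num
      _ ≤ (Ideal.span {F}).height + 1 := add_le_add a le_rfl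
      _ ≤ 𝔔'.height := b
  have hdim : ((IsLocalRing.maximalIdeal (Lam₂ 𝒪)).height : WithBot ℕ∞) = 3 := by
    rw [IsLocalRing.maximalIdeal_height_eq_ringKrullDim]
    exact Literature.NumberTheory.IwasawaTheory.ringKrullDim_powerSeries_powerSeries 𝒪
  have hdim' : (IsLocalRing.maximalIdeal (Lam₂ 𝒪)).height = 3 := by
    have h3 : ((3 : ℕ∞) : WithBot ℕ∞) = 3 := rfl
    rw [← h3, WithBot.coe_eq_coe] at hdim; exact hdim
  have hlt3 : 𝔔 < IsLocalRing.maximalIdeal (Lam₂ 𝒪) := by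
    refine lt_of_le_of_ne (IsLocalRing.le_maximalIdeal h𝔔.ne_top) fun h => hp𝔔 ?_
    rw [h]
    exact (IsLocalRing.mem_maximalIdeal _).mpr (mem_nonunits_iff.mpr not_isUnit_natCast_p₂)
  have h3 : 𝔔.height ≤ 2 := by
    have := Ideal.height_strict_mono_of_isPrime_of_isPrime hlt3
    rw [hdim', show (3 : ℕ∞) = 2 + 1 by norm_num] at this
    exact Order.le_of_lt_add_one this
  have heq : 𝔔' = 𝔔 := by
    by_contra hne
    have := Ideal.height_strict_mono_of_isPrime_of_isPrime (lt_of_le_of_ne hle hne)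
    exact (lt_irrefl (2 : ℕ∞)) (lt_of_le_of_lt h2 (lt_of_lt_of_le this h3))
  subst heq
  have hnB : n ∈ B := by
    rw [hB, Set.mem_iUnion₂]; exact ⟨𝔔', h𝔔'M, hp𝔔, hP𝔔⟩
  have := hN₀ hnB
  omega

/-! ### E14.6 The good prime `𝔔` at a deep classical point through a visible `F` -/

section GoodIdeal

variable (S : Type) [CommRing S] [IsDomain S] [IsDiscreteValuationRing S]
  [IsAdicComplete (IsLocalRing.maximalIdeal S) S] [CharZero S] [Algebra 𝒪 S] [Module.Finite 𝒪 S]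

/-- At a root `u₀` of `P_n` with `d_n > λ := ord_{T₂}(a_i mod p) < ord_{T₂}(a_0 mod p)` (`a_j` = the `T₁^j`-coefficient
of `F`): a prime `𝔔 ∋ C P_n, F` of `Λ₂` with `p ∉ 𝔔`, namely the contraction of a minimal prime of
`F(T₁,u₀)/ϖ^m` in `S⟦T₁⟧`; and `C P_n ∤ F`. -/
theorem EisensteinSystem.exists_goodIdeal (𝓟 : EisensteinSystem 𝒪 p) (n : ℕ) {u₀ : S}
    (hu₀ : u₀ ∈ IsLocalRing.maximalIdeal S) (hr : evS hu₀ (PowerSeries.map (algebraMap 𝒪 S) (𝓟.P n).P) = 0)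
    (F : Lam₂ 𝒪) (i lam : ℕ)
    (hlam : (PowerSeries.map (IsLocalRing.residue 𝒪) (PowerSeries.coeff i F)).order = lam)
    (hvis : (lam : ℕ∞) < (PowerSeries.map (IsLocalRing.residue 𝒪) (PowerSeries.constantCoeff F)).order)
    (hn : lam < 𝓟.d n) :
    ∃ 𝔔 : Ideal (Lam₂ 𝒪), 𝔔.IsPrime ∧ (PowerSeries.C (𝓟.P n).P : Lam₂ 𝒪) ∈ 𝔔 ∧ F ∈ 𝔔 ∧
      (p : Lam₂ 𝒪) ∉ 𝔔 ∧ ¬ (PowerSeries.C (𝓟.P n).P : Lam₂ 𝒪) ∣ F := by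
  classical
  set Λ := PowerSeries (PowerSeries S)
  set θ : Lam₂ 𝒪 →+* PowerSeries S := (ev₂ hu₀).comp (algebraMap (Lam₂ 𝒪) Λ) with hθ
  have hθcoeff : ∀ (j : ℕ) (H : Lam₂ 𝒪), PowerSeries.coeff j (θ H) =
      evS hu₀ (PowerSeries.map (algebraMap 𝒪 S) (PowerSeries.coeff j H)) := fun j H => by
    rw [hθ, RingHom.comp_apply, coeff_ev₂, algebraMap_S, PowerSeries.coeff_map]
  have hθC : ∀ a : Lam₁ 𝒪, θ (PowerSeries.C a) =
      PowerSeries.C (evS hu₀ (PowerSeries.map (algebraMap 𝒪 S) a)) := fun a => by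
    rw [hθ, RingHom.comp_apply, algebraMap_S, PowerSeries.map_C, ev₂_C]
  have hθP : θ (PowerSeries.C (𝓟.P n).P) = 0 := by rw [hθC, hr, map_zero]
  set f := θ F with hf
  -- the two coefficients
  obtain ⟨v, hv, hfi⟩ := 𝓟.evS_eq_pow_mul_unit n hu₀ hr (PowerSeries.coeff i F) lam hlam hn
  have hf0dvd : u₀ ^ (lam + 1) ∣ PowerSeries.constantCoeff f := by
    rw [← PowerSeries.coeff_zero_eq_constantCoeff_apply, hθcoeff, PowerSeries.coeff_zero_eq_constantCoeff_apply]
    exact 𝓟.pow_dvd_evS n hu₀ hr _ (lam + 1) (Order.add_one_le_of_lt hvis) (by omega)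
  have hu0 : u₀ ≠ 0 := 𝓟.root_ne_zero n hu₀ hr
  have hfi' : PowerSeries.coeff i f = u₀ ^ lam * v := by rw [hf, hθcoeff, hfi]
  have hf0 : f ≠ 0 := fun h => by
    have := hfi'; rw [h, map_zero] at this
    exact (mul_ne_zero (pow_ne_zero _ hu0) hv.ne_zero) this.symm
  have hPF : ¬ (PowerSeries.C (𝓟.P n).P : Lam₂ 𝒪) ∣ F := by
    rintro ⟨q, hq⟩; exact hf0 (by rw [hf, hq, map_mul, hθP, zero_mul])
  -- strip the `ϖ`-power: `f = (C ϖ)^m · f₁`, `C ϖ ∤ f₁`, `f₁` not a unit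
  obtain ⟨ϖ, hϖ⟩ := IsDiscreteValuationRing.exists_irreducible S
  have hϖspan : IsLocalRing.maximalIdeal S = Ideal.span {ϖ} :=
    (IsDiscreteValuationRing.irreducible_iff_uniformizer ϖ).mp hϖ
  have hCϖ0 : (PowerSeries.C ϖ : PowerSeries S) ≠ 0 := fun h => hϖ.ne_zero (by
    have := congrArg PowerSeries.constantCoeff h; rwa [PowerSeries.constantCoeff_C, map_zero] at this)
  have hCϖ : Prime (PowerSeries.C ϖ : PowerSeries S) := by
    rw [← Ideal.span_singleton_prime hCϖ0, ← kerRes₁_eq_span hϖspan]; exact kerRes₁_isPrime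
  obtain ⟨m, f₁, hnd, hff₁⟩ := WfDvdMonoid.max_power_factor hf0 hCϖ.irreducible
  have hf₁u : ¬ IsUnit f₁ := by
    intro hu
    have e := PowerSeries.isUnit_iff_constantCoeff.mp hu
    -- `cc f = ϖ^m · cc f₁`, `coeff i f = ϖ^m · coeff i f₁`
    have h0 : PowerSeries.constantCoeff f = ϖ ^ m * PowerSeries.constantCoeff f₁ := by
      rw [hff₁, map_mul, map_pow, PowerSeries.constantCoeff_C]
    have hi' : PowerSeries.coeff i f = ϖ ^ m * PowerSeries.coeff i f₁ := by
      rw [hff₁, ← map_pow, PowerSeries.coeff_C_mul]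
    -- `u₀^{λ+1} ∣ ϖ^m ∣ u₀^λ · v`
    have h1 : u₀ ^ (lam + 1) ∣ ϖ ^ m := by
      obtain ⟨e', he'⟩ := e
      have := hf0dvd; rw [h0, ← he'] at this
      exact (Units.dvd_mul_right).mp this
    have h2 : ϖ ^ m ∣ u₀ ^ lam * v := by rw [← hfi', hi']; exact dvd_mul_right _ _
    have h3 : u₀ ^ lam * u₀ ∣ u₀ ^ lam * 1 := by
      rw [← pow_succ, mul_one]
      obtain ⟨w, hw⟩ := hv
      have := h1.trans h2; rw [← hw] at this
      exact (Units.dvd_mul_right).mp this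
    have h4 : u₀ ∣ 1 := (mul_dvd_mul_iff_left (pow_ne_zero _ hu0)).mp h3
    exact (IsLocalRing.mem_maximalIdeal _).mp hu₀ (isUnit_of_dvd_one h4)
  -- a minimal prime `𝔮` of `(f₁)`: height ≤ 1, contains `f`, avoids `p`
  obtain ⟨⟨𝔮, h𝔮⟩⟩ := Ideal.nonempty_minimalPrimes (mt Ideal.span_singleton_eq_top.mp hf₁u)
  haveI h𝔮p : 𝔮.IsPrime := h𝔮.1.1
  have hf₁𝔮 : f₁ ∈ 𝔮 := h𝔮.1.2 (Ideal.mem_span_singleton_self f₁)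
  have hf𝔮 : f ∈ 𝔮 := by rw [hff₁]; exact Ideal.mul_mem_left _ _ hf₁𝔮
  have hht : 𝔮.height ≤ 1 := Ideal.height_le_one_of_isPrincipal_of_mem_minimalPrimes _ 𝔮 h𝔮
  have hp𝔮 : (p : PowerSeries S) ∉ 𝔮 := by
    intro hp𝔮
    -- `C ϖ ∈ 𝔮`: the contraction of `𝔮` to `S` is a nonzero prime, hence `𝔪_S`
    have hCϖ𝔮 : (PowerSeries.C ϖ : PowerSeries S) ∈ 𝔮 := by
      have hc : (𝔮.comap (PowerSeries.C (R := S))) ≠ ⊥ := fun h => by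
        have : (p : S) ∈ 𝔮.comap (PowerSeries.C (R := S)) := by rw [Ideal.mem_comap, map_natCast]; exact hp𝔮
        rw [h, Ideal.mem_bot] at this; exact natCast_p_ne_zeroS S this
      haveI := IsPrime.to_maximal_ideal (S := 𝔮.comap (PowerSeries.C (R := S))) hc
      have hmax : 𝔮.comap (PowerSeries.C (R := S)) = IsLocalRing.maximalIdeal S := IsLocalRing.eq_maximalIdeal inferInstance
      have : ϖ ∈ 𝔮.comap (PowerSeries.C (R := S)) := by rw [hmax, hϖspan]; exact Ideal.mem_span_singleton_self ϖ
      exact Ideal.mem_comap.mp this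
    haveI hϖP : (Ideal.span {(PowerSeries.C ϖ : PowerSeries S)}).IsPrime := (Ideal.span_singleton_prime hCϖ0).mpr hCϖ
    have hlt : Ideal.span {(PowerSeries.C ϖ : PowerSeries S)} < 𝔮 := by
      refine lt_of_le_of_ne ((Ideal.span_singleton_le_iff_mem _).mpr hCϖ𝔮) fun h => hnd ?_
      exact Ideal.mem_span_singleton.mp (h ▸ hf₁𝔮)
    have hbot : (⊥ : Ideal (PowerSeries S)) < Ideal.span {(PowerSeries.C ϖ : PowerSeries S)} :=
      bot_lt_iff_ne_bot.mpr (mt Ideal.span_singleton_eq_bot.mp hCϖ0)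
    have a := Order.add_one_le_of_lt (Ideal.height_strict_mono_of_isPrime_of_isPrime hbot)
    rw [Ideal.height_bot, zero_add] at a
    have b := Ideal.height_strict_mono_of_isPrime_of_isPrime hlt
    exact (lt_irrefl (1 : ℕ∞)) (lt_of_le_of_lt a (lt_of_lt_of_le b hht))
  -- contract to `Λ₂`
  refine ⟨𝔮.comap θ, Ideal.IsPrime.comap θ, ?_, ?_, ?_, hPF⟩
  · rw [Ideal.mem_comap, hθP]; exact zero_mem _
  · exact Ideal.mem_comap.mpr hf𝔮
  · rw [Ideal.mem_comap, map_natCast]; exact hp𝔮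

end GoodIdeal

/-! ### E14.7 Classical fibre bounds in one direction reach every visible height-one prime -/

variable (𝒪 p) in
/-- **Classical fibre bounds** for `(X, G)` along the Eisenstein system `𝓟`: a UNIFORM slack `p^t` such that for all
`n ≥ N` and every root `(S, u₀)` of `P_n` in the DVR class, `p^t·G(T₁,u₀) ∈ ch_{S⟦T₁⟧}(X_S/(T₂-u₀))` — the output of a
ONE-variable Euler/Kolyvagin-system argument at the finite-order character `P_n` with bounded error. -/
def ClassicalFibreBounds (𝓟 : EisensteinSystem 𝒪 p) (X : Type) [AddCommGroup X] [Module (Lam₂ 𝒪) X]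
    (G : Lam₂ 𝒪) : Prop :=
  ∃ t N : ℕ, ∀ n, N ≤ n → ∀ (S : Type) [CommRing S] [IsDomain S] [IsDiscreteValuationRing S]
      [IsAdicComplete (IsLocalRing.maximalIdeal S) S] [CharZero S] [Algebra 𝒪 S] [Module.Finite 𝒪 S]
      (u₀ : S) (hu₀ : u₀ ∈ IsLocalRing.maximalIdeal S),
      evS hu₀ (PowerSeries.map (algebraMap 𝒪 S) (𝓟.P n).P) = 0 → FibreBoundOver 𝒪 p S X G u₀ t

/-- **Direction 2.** Classical fibre bounds along `𝓟` ⟹ `(F)^{ℓ_{(F)}(X)} ∣ (G)` for every VISIBLE prime `F`. -/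
theorem classical_dvd (𝓟 : EisensteinSystem 𝒪 p) (X : Type) [AddCommGroup X] [Module (Lam₂ 𝒪) X]
    [Module.Finite (Lam₂ 𝒪) X] (G : Lam₂ 𝒪) (hT : Module.IsTorsion (Lam₂ 𝒪) X)
    (hCF : ClassicalFibreBounds 𝒪 p 𝓟 X G) {F : Lam₂ 𝒪} (hF : Prime F) (hvis : Visible 𝒪 F) :
    (Ideal.span {F}) ^ (Module.lengthAt (Lam₂ 𝒪) X
        ⟨Ideal.span {F}, (Ideal.span_singleton_prime hF.ne_zero).mpr hF⟩).toNat ∣ Ideal.span {G} := by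
  classical
  haveI : UniqueFactorizationMonoid (Lam₂ 𝒪) :=
    Literature.NumberTheory.IwasawaTheory.uniqueFactorizationMonoid_powerSeries_powerSeries 𝒪
  by_cases hG0 : G = 0
  · rw [hG0, Ideal.span_singleton_eq_bot.mpr rfl, ← Ideal.zero_eq_bot]; exact dvd_zero _
  obtain ⟨g, G₁, hFG₁, hGfac⟩ := WfDvdMonoid.max_power_factor hG0 hF.irreducible
  obtain ⟨c, hc, hc0⟩ := Submodule.exists_mem_ne_zero_of_ne_bot (Module.annihilator_ne_bot_of_isTorsion X hT)
  have hcX : ∀ x : X, c • x = 0 := fun x => Module.mem_annihilator.mp hc x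
  obtain ⟨t, N₁, hFB⟩ := hCF
  obtain ⟨N₂, hbad⟩ := 𝓟.eventually_no_bad_prime hF hFG₁
  -- visibility data of `F`
  obtain ⟨i, hi⟩ := hvis
  have hitop : (PowerSeries.coeff i (PowerSeries.map (PowerSeries.map (IsLocalRing.residue 𝒪)) F)).order ≠ ⊤ :=
    ne_top_of_lt hi
  set lam := (PowerSeries.coeff i (PowerSeries.map (PowerSeries.map (IsLocalRing.residue 𝒪)) F)).order.toNat
  have hci : PowerSeries.map (IsLocalRing.residue 𝒪) (PowerSeries.coeff i F) =
      PowerSeries.coeff i (PowerSeries.map (PowerSeries.map (IsLocalRing.residue 𝒪)) F) :=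
    (PowerSeries.coeff_map _ _ _).symm
  have hcc : PowerSeries.map (IsLocalRing.residue 𝒪) (PowerSeries.constantCoeff F) =
      PowerSeries.constantCoeff (PowerSeries.map (PowerSeries.map (IsLocalRing.residue 𝒪)) F) :=
    (constantCoeff_map' _ F).symm
  have hlam : (PowerSeries.map (IsLocalRing.residue 𝒪) (PowerSeries.coeff i F)).order = lam := by
    rw [hci]; exact (ENat.coe_toNat hitop).symm
  have hvis' : (lam : ℕ∞) < (PowerSeries.map (IsLocalRing.residue 𝒪) (PowerSeries.constantCoeff F)).order := by
    rw [hcc, ← hlam, hci]; exact hi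
  -- fleeing data of the annihilator
  obtain ⟨j, hj⟩ := PowerSeries.exists_coeff_ne_zero_iff_ne_zero.mpr hc0
  obtain ⟨μ, c', hcfac, hc'⟩ := exists_eq_pow_mul_map_residue_ne_zero (𝒪 := 𝒪) (p := p) hj
  have hctop : (PowerSeries.map (IsLocalRing.residue 𝒪) c').order ≠ ⊤ := by
    rwa [Ne, PowerSeries.order_eq_top]
  set lc := (PowerSeries.map (IsLocalRing.residue 𝒪) c').order.toNat
  have hlc : (PowerSeries.map (IsLocalRing.residue 𝒪) c').order = lc := (ENat.coe_toNat hctop).symm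
  -- a deep level
  set n := max (max N₁ N₂) (max lam lc + 1)
  have hn₁ : N₁ ≤ n := le_trans (le_max_left _ _) (le_max_left _ _)
  have hn₂ : N₂ ≤ n := le_trans (le_max_right _ _) (le_max_left _ _)
  have hnl : lam < 𝓟.d n := lt_of_lt_of_le (by omega) (𝓟.le_d n)
  have hnc : lc < 𝓟.d n := lt_of_lt_of_le (by omega) (𝓟.le_d n)
  set P := 𝓟.P n
  obtain ⟨S, _, _, _, _, _, _, _, u₀, hu₀, hr⟩ := rootDatumS P (𝓟.d_pos n) (𝓟.isUnit_h n) (𝓟.shape n)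
  have hFBt := hFB n hn₁ S u₀ hu₀ hr
  rw [hGfac] at hFBt
  have hPc : ¬ (PowerSeries.C P.P : Lam₂ 𝒪) ∣ c := fun h =>
    𝓟.not_dvd_of_order_lt n hu₀ hr μ lc hlc hnc (hcfac ▸ dvd_coeff_of_C_dvd h j)
  obtain ⟨𝔔, h𝔔, hCP, hF𝔔, hp𝔔, hPF⟩ := 𝓟.exists_goodIdeal S n hu₀ hr F i lam hlam hvis' hnl
  haveI := h𝔔
  have hG₁𝔔 : G₁ ∉ 𝔔 := fun h => hbad n hn₂ 𝔔 h𝔔 hF𝔔 h hp𝔔 hCP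
  have hle := lengthAt_le_of_goodPointS S P hu₀ hr X hc0 hcX hPc hF hPF g 𝔔 hCP hF𝔔 hp𝔔 hG₁𝔔 hFBt
  have hk : (Module.lengthAt (Lam₂ 𝒪) X
      ⟨Ideal.span {F}, (Ideal.span_singleton_prime hF.ne_zero).mpr hF⟩).toNat ≤ g :=
    ENat.toNat_le_of_le_coe hle
  refine ⟨Ideal.span {F ^ (g - (Module.lengthAt (Lam₂ 𝒪) X
      ⟨Ideal.span {F}, (Ideal.span_singleton_prime hF.ne_zero).mpr hF⟩).toNat) * G₁}, ?_⟩
  rw [hGfac, Ideal.span_singleton_pow, Ideal.span_singleton_mul_span_singleton, ← mul_assoc, ← pow_add,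
    Nat.add_sub_cancel' hk]

/-! ### E14.8 The transpose twist and DOOR 5 -/

set_option linter.unusedVariables false in
/-- `X` with the action `r • x := Θ⁻¹(r) • x`; the identity `X → Twist Θ X` is `Θ`-semilinear (sketch §8.3, verbatim). -/
def Twist {R : Type*} [CommRing R] (Θ : R ≃+* R) (X : Type*) : Type _ := X

namespace Twist

variable {R : Type*} [CommRing R] (Θ : R ≃+* R) (X : Type*) [AddCommGroup X] [Module R X]

instance : AddCommGroup (Twist Θ X) := inferInstanceAs (AddCommGroup X)

noncomputable instance : Module R (Twist Θ X) := Module.compHom X Θ.symm.toRingHom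

/-- The identity `X ≃+ Twist Θ X`. -/
def of : X ≃+ Twist Θ X := AddEquiv.refl X

theorem smul_def (r : R) (x : Twist Θ X) : r • x = of Θ X (Θ.symm r • (of Θ X).symm x) := rfl

theorem of_smul (r : R) (x : X) : of Θ X (r • x) = Θ r • of Θ X x := by
  rw [smul_def, RingEquiv.symm_apply_apply]; rfl

/-- The identity as a `Θ`-semilinear map. -/
def ofₛₗ : X →ₛₗ[(Θ : R →+* R)] Twist Θ X where
  toFun := of Θ X
  map_add' _ _ := rfl
  map_smul' r x := of_smul Θ X r x

instance [Module.Finite R X] : Module.Finite R (Twist Θ X) := by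
  haveI : RingHomSurjective (Θ : R →+* R) := ⟨Θ.surjective⟩
  exact Module.Finite.of_surjective (ofₛₗ Θ X) (of Θ X).surjective

theorem isTorsion [IsDomain R] (h : Module.IsTorsion R X) : Module.IsTorsion R (Twist Θ X) := by
  intro x
  obtain ⟨⟨a, ha⟩, hax⟩ := @h ((of Θ X).symm x)
  refine ⟨⟨Θ a, mem_nonZeroDivisors_of_ne_zero
    ((map_ne_zero_iff _ Θ.injective).mpr (nonZeroDivisors.ne_zero ha))⟩, ?_⟩
  change Θ a • x = 0
  have hax' : a • (of Θ X).symm x = 0 := hax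
  rw [smul_def, RingEquiv.symm_apply_apply, hax', map_zero]

/-- `ℓ_𝔭(X) = ℓ_{Θ𝔭}(Twist Θ X)` (tree `Module.lengthAt_eq_of_semilinearEquiv`). -/
theorem lengthAt_eq (𝔭 : PrimeSpectrum R) :
    Module.lengthAt R X 𝔭 = Module.lengthAt R (Twist Θ X) (PrimeSpectrum.comapEquiv Θ 𝔭) :=
  Module.lengthAt_eq_of_semilinearEquiv Θ (of Θ X) (of_smul Θ X) 𝔭

end Twist

theorem comapEquiv_span_singleton {R : Type*} [CommRing R] (Θ : R ≃+* R) {F : R} (hF : Prime F) :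
    PrimeSpectrum.comapEquiv Θ ⟨Ideal.span {F}, (Ideal.span_singleton_prime hF.ne_zero).mpr hF⟩ =
      ⟨Ideal.span {Θ F}, (Ideal.span_singleton_prime ((MulEquiv.prime_iff Θ).mpr hF).ne_zero).mpr
        ((MulEquiv.prime_iff Θ).mpr hF)⟩ := by
  refine PrimeSpectrum.ext ?_
  show Ideal.comap Θ.symm.toRingHom (Ideal.span {F}) = Ideal.span {Θ F}
  rw [show Ideal.comap Θ.symm.toRingHom (Ideal.span {F}) = Ideal.comap Θ.symm (Ideal.span {F}) from rfl,
    ← Ideal.map_comap_of_equiv, Ideal.map_span, Set.image_singleton]; rfl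

theorem span_singleton_pow_dvd_of_map {R : Type*} [CommRing R] (Θ : R ≃+* R) {F G : R} {k : ℕ}
    (h : Ideal.span {Θ F} ^ k ∣ Ideal.span {Θ G}) : Ideal.span {F} ^ k ∣ Ideal.span {G} := by
  obtain ⟨J, hJ⟩ := h
  refine ⟨J.map (Θ.symm : R →+* R), ?_⟩
  have := congrArg (Ideal.map (Θ.symm : R →+* R)) hJ
  rwa [Ideal.map_mul, Ideal.map_pow, Ideal.map_span, Ideal.map_span, Set.image_singleton, Set.image_singleton,
    RingEquiv.coe_toRingHom, RingEquiv.symm_apply_apply, RingEquiv.symm_apply_apply] at this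

/-- **DOOR 5 (two-direction classical patching).** `PatchingTarget` + `Λ₂`-torsion + classical fibre bounds for
`(X, G)` along `𝓟₂` (cyclotomic lines at the anticyclotomic classical points) AND for the transpose twist
`(Xᵗ, Gᵗ)` along `𝓟₁` (anticyclotomic lines at the cyclotomic classical points) ⟹ `∃ a, (p^a·G) ⊆ ch_{Λ₂}(X)`.
No `DepthFibreBoundsDVR`, no Kato line, no vertical approximation. BSD is not proved here. -/
theorem engine_door5 (𝓟₁ 𝓟₂ : EisensteinSystem 𝒪 p) (X : Type) [AddCommGroup X] [Module (Lam₂ 𝒪) X]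
    [Module.Finite (Lam₂ 𝒪) X] (G : Lam₂ 𝒪) (hPT : PatchingTarget 𝒪 p X G)
    (hT : Module.IsTorsion (Lam₂ 𝒪) X) (h₂ : ClassicalFibreBounds 𝒪 p 𝓟₂ X G)
    (h₁ : ClassicalFibreBounds 𝒪 p 𝓟₁ (Twist (IntSeries.transposeRingEquiv 𝒪) X) (IntSeries.transpose G)) :
    ∃ a : ℕ, Ideal.span {(p : Lam₂ 𝒪) ^ a * G} ≤ Module.charIdeal (Lam₂ 𝒪) X := by
  classical
  haveI : UniqueFactorizationMonoid (Lam₂ 𝒪) :=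
    Literature.NumberTheory.IwasawaTheory.uniqueFactorizationMonoid_powerSeries_powerSeries 𝒪
  refine hPT hT fun 𝔓 hht hp𝔓 => ?_
  obtain ⟨F, hF𝔓, hF⟩ := Ideal.IsPrime.exists_mem_prime_of_ne_bot 𝔓.isPrime (Ideal.ne_bot_of_height_eq_one hht)
  have h𝔓F : 𝔓.asIdeal = Ideal.span {F} := Ideal.eq_span_singleton_of_height_eq_one hht hF𝔓 hF
  have hpt : 𝔓 = ⟨Ideal.span {F}, (Ideal.span_singleton_prime hF.ne_zero).mpr hF⟩ := PrimeSpectrum.ext h𝔓F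
  have hpF : ¬ (p : Lam₂ 𝒪) ∣ F := by
    rintro ⟨q, hq⟩
    have hdvd : F ∣ (p : Lam₂ 𝒪) * q := ⟨1, by rw [mul_one, hq]⟩
    rcases hF.dvd_or_dvd hdvd with h | ⟨r, hr⟩
    · exact hp𝔓 (by rw [h𝔓F]; exact Ideal.mem_span_singleton.mpr h)
    · have h1 : F * 1 = F * ((p : Lam₂ 𝒪) * r) := by
        rw [mul_one]; nth_rw 1 [hq]; rw [hr]; ring
      exact not_isUnit_natCast_p₂ (𝒪 := 𝒪) (p := p) (IsUnit.of_mul_eq_one r (mul_left_cancel₀ hF.ne_zero h1).symm)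
  rcases visible_or_visible_transpose hF.not_unit hpF with hv | hv
  · rw [hpt]; exact classical_dvd 𝓟₂ X G hT h₂ hF hv
  · set Θ := IntSeries.transposeRingEquiv 𝒪
    have hFt : Prime (Θ F) := (MulEquiv.prime_iff Θ).mpr hF
    have hd := classical_dvd 𝓟₁ (Twist Θ X) (IntSeries.transpose G) (Twist.isTorsion Θ X hT) h₁ hFt
      (by rw [IntSeries.transposeRingEquiv_apply]; exact hv)
    have hℓ : Module.lengthAt (Lam₂ 𝒪) X 𝔓 = Module.lengthAt (Lam₂ 𝒪) (Twist Θ X)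
        ⟨Ideal.span {Θ F}, (Ideal.span_singleton_prime hFt.ne_zero).mpr hFt⟩ := by
      rw [Twist.lengthAt_eq Θ X 𝔓, hpt, comapEquiv_span_singleton Θ hF]
    rw [hℓ, h𝔓F]
    exact span_singleton_pow_dvd_of_map Θ hd

/-- Door 5 with torsion from ONE classical fibre (§E8 `isTorsion_of_fibreTorsionAt'`). -/
theorem engine_door5' (𝓟₁ 𝓟₂ : EisensteinSystem 𝒪 p) (X : Type) [AddCommGroup X] [Module (Lam₂ 𝒪) X]
    [Module.Finite (Lam₂ 𝒪) X] (G : Lam₂ 𝒪) (hPT : PatchingTarget 𝒪 p X G)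
    (hFT : ∃ n, FibreTorsionAt 𝒪 p (𝓟₂.P n) X) (h₂ : ClassicalFibreBounds 𝒪 p 𝓟₂ X G)
    (h₁ : ClassicalFibreBounds 𝒪 p 𝓟₁ (Twist (IntSeries.transposeRingEquiv 𝒪) X) (IntSeries.transpose G)) :
    ∃ a : ℕ, Ideal.span {(p : Lam₂ 𝒪) ^ a * G} ≤ Module.charIdeal (Lam₂ 𝒪) X := by
  obtain ⟨n, hn⟩ := hFT
  exact engine_door5 𝓟₁ 𝓟₂ X G hPT (isTorsion_of_fibreTorsionAt' (𝓟₂.P n) X hn) h₂ h₁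

/-- `(F-h)` for ANY `h ~ p^m·W` (as §E12): a binder for `h·G` gives the conclusion for `W·G`. -/
theorem engine_door5_of_associated (𝓟₁ 𝓟₂ : EisensteinSystem 𝒪 p) (X : Type) [AddCommGroup X]
    [Module (Lam₂ 𝒪) X] [Module.Finite (Lam₂ 𝒪) X] (G h W : Lam₂ 𝒪) (m : ℕ)
    (hW : IsUnit W) (hh : h = (p : Lam₂ 𝒪) ^ m * W) (hPT : PatchingTarget 𝒪 p X (h * G))
    (hT : Module.IsTorsion (Lam₂ 𝒪) X) (h₂ : ClassicalFibreBounds 𝒪 p 𝓟₂ X (h * G))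
    (h₁ : ClassicalFibreBounds 𝒪 p 𝓟₁ (Twist (IntSeries.transposeRingEquiv 𝒪) X) (IntSeries.transpose (h * G))) :
    ∃ a : ℕ, Ideal.span {(p : Lam₂ 𝒪) ^ a * G} ≤ Module.charIdeal (Lam₂ 𝒪) X := by
  obtain ⟨a, ha⟩ := engine_door5 𝓟₁ 𝓟₂ X (h * G) hPT hT h₂ h₁
  obtain ⟨w, hw⟩ := hW
  refine ⟨a + m, le_trans (le_of_eq ?_) ha⟩
  rw [hh, ← hw, pow_add, show (p : Lam₂ 𝒪) ^ a * ((p : Lam₂ 𝒪) ^ m * ↑w * G) =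
    ((p : Lam₂ 𝒪) ^ a * (p : Lam₂ 𝒪) ^ m * G) * ↑w by ring,
    Ideal.span_singleton_mul_right_unit w.isUnit]

/-! ### E14.8b A vertical fudge factor dissolves at deep classical points -/

theorem pow_add_mul_mem_of_mul_mem {A : Type*} [CommRing A] (J : Ideal A) {V H H₀ c G π : A} {t s : ℕ}
    (hV : V ∈ J) (hH : V ∣ H - H₀) (hc : H₀ * c = π ^ s) (h : π ^ t * (H * G) ∈ J) : π ^ (t + s) * G ∈ J := by
  obtain ⟨d, hd⟩ := hH
  have hH₀ : H₀ = H - V * d := by rw [← hd]; ring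
  have : π ^ (t + s) * G = c * (π ^ t * (H * G)) - c * d * (π ^ t * G) * V := by
    rw [pow_add, ← hc, hH₀]; ring
  rw [this]
  exact J.sub_mem (J.mul_mem_left _ h) (J.mul_mem_left _ hV)

section VerticalFudge

variable (S : Type) [CommRing S] [IsDomain S] [IsDiscreteValuationRing S]
  [IsAdicComplete (IsLocalRing.maximalIdeal S) S] [CharZero S] [Algebra 𝒪 S] [Module.Finite 𝒪 S]

/-- `p^t·h₁(T₂)·G ∈ ch(fibre at u₀) + (T₂-u₀)` and `h₁(u₀)·c = p^s` ⟹ `p^{t+s}·G ∈ ch(fibre at u₀) + (T₂-u₀)`. -/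
theorem fibreBoundOver_of_C_mul (X : Type) [AddCommGroup X] [Module (Lam₂ 𝒪) X]
    {G : Lam₂ 𝒪} {h₁ : Lam₁ 𝒪} {u₀ : S} (hu₀ : u₀ ∈ IsLocalRing.maximalIdeal S) {t s : ℕ}
    {c : S} (hc : evS hu₀ (PowerSeries.map (algebraMap 𝒪 S) h₁) * c = (p : S) ^ s)
    (hFB : FibreBoundOver 𝒪 p S X (PowerSeries.C h₁ * G) u₀ t) : FibreBoundOver 𝒪 p S X G u₀ (t + s) := by
  have hV : verticalPrimeO S u₀ ∣ PowerSeries.C (PowerSeries.map (algebraMap 𝒪 S) h₁) -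
      PowerSeries.C (PowerSeries.C (evS hu₀ (PowerSeries.map (algebraMap 𝒪 S) h₁))) := by
    rw [← Ideal.mem_span_singleton, ← ker_ev₂ hu₀, RingHom.mem_ker, map_sub, ev₂_C, ev₂_C, evS_C, sub_self]
  have hc' : (PowerSeries.C (PowerSeries.C (evS hu₀ (PowerSeries.map (algebraMap 𝒪 S) h₁))) :
      PowerSeries (PowerSeries S)) * PowerSeries.C (PowerSeries.C c) = (p : PowerSeries (PowerSeries S)) ^ s := by
    rw [← map_mul, ← map_mul, hc, map_pow, map_pow, map_natCast, map_natCast]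
  unfold FibreBoundOver at hFB ⊢
  rw [map_mul, PowerSeries.map_C] at hFB
  exact pow_add_mul_mem_of_mul_mem _ (Ideal.mem_sup_right (Ideal.mem_span_singleton_self _)) hV hc' hFB

/-- **A VERTICAL fudge factor dissolves**: classical fibre bounds for `(C h₁)·G` along `𝓟` (`h₁ ∈ Λ₁ ∖ 0`, a
function of the twist variable `T₂` alone) give classical fibre bounds for `G` along `𝓟` — deep classical points flee
the zeros of `h₁` (§E14.3: `h₁(u₀) = p^μ·u₀^m·unit ∣ p^{μ+1}`). (Its transpose `h₁(T₁)` is horizontal in the other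
direction and does NOT dissolve there; general two-variable fudges stay in the conclusion as in §E12.) -/
theorem EisensteinSystem.classicalFibreBounds_of_C_mul (𝓟 : EisensteinSystem 𝒪 p) (X : Type) [AddCommGroup X]
    [Module (Lam₂ 𝒪) X] (G : Lam₂ 𝒪) {h₁ : Lam₁ 𝒪} (hh : h₁ ≠ 0)
    (hCF : ClassicalFibreBounds 𝒪 p 𝓟 X (PowerSeries.C h₁ * G)) : ClassicalFibreBounds 𝒪 p 𝓟 X G := by
  obtain ⟨t, N, hFB⟩ := hCF
  obtain ⟨μ, h', hfac, hh'⟩ := exists_eq_pow_mul_map_residue_ne_zero (𝒪 := 𝒪) (p := p) hh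
  have htop : (PowerSeries.map (IsLocalRing.residue 𝒪) h').order ≠ ⊤ := by rwa [Ne, PowerSeries.order_eq_top]
  set m := (PowerSeries.map (IsLocalRing.residue 𝒪) h').order.toNat
  have hm : (PowerSeries.map (IsLocalRing.residue 𝒪) h').order = m := (ENat.coe_toNat htop).symm
  refine ⟨t + (μ + 1), max N (m + 1), fun n hn S _ _ _ _ _ _ _ u₀ hu₀ hr => ?_⟩
  have hnN : N ≤ n := le_trans (le_max_left _ _) hn
  have hmn : m < 𝓟.d n := lt_of_lt_of_le (lt_of_lt_of_le (Nat.lt_succ_self m) (le_trans (le_max_right _ _) hn))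
    (𝓟.le_d n)
  obtain ⟨v, hv, hev⟩ := 𝓟.evS_eq_pow_mul_unit n hu₀ hr h' m hm hmn
  obtain ⟨c', hc'⟩ := (pow_dvd_pow u₀ hmn.le).trans (𝓟.pow_d_dvd_natCast n hu₀ hr)
  obtain ⟨w, hw⟩ := hv
  have key : u₀ ^ m * ↑w * (c' * ↑w⁻¹) = (p : S) := by
    rw [hc']; linear_combination (u₀ ^ m * c') * (Units.mul_inv w)
  refine fibreBoundOver_of_C_mul S X hu₀ (c := c' * ↑w⁻¹) ?_ (hFB n hnN S u₀ hu₀ hr)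
  rw [hfac, map_mul, map_pow, map_natCast, map_mul, map_pow, map_natCast, hev, ← hw, mul_assoc, key, pow_succ]

end VerticalFudge

/-! ### E14.9 The cyclotomic Eisenstein system `P_n = Φ_{p^{n+1}}(1+T)` -/

section Cyclotomic

open Polynomial

variable (𝒪 p) in
/-- `Φ_{p^{n+1}}(1+X) ∈ ℤ_p[X]`. -/
noncomputable def cycPoly (n : ℕ) : 𝒪[X] :=
  Polynomial.map (Int.castRingHom 𝒪) ((cyclotomic (p ^ (n + 1)) ℤ).comp (X + 1))

theorem cycPoly_monic (n : ℕ) : (cycPoly 𝒪 p n).Monic := by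
  have h : ((cyclotomic (p ^ (n + 1)) ℤ).comp (X + 1)).Monic := by
    rw [show (X + 1 : ℤ[X]) = X + C 1 by rw [C_1]]; exact (cyclotomic.monic _ ℤ).comp_X_add_C 1
  exact h.map _

theorem cycPoly_natDegree (n : ℕ) : (cycPoly 𝒪 p n).natDegree = p ^ n * (p - 1) := by
  have h : ((cyclotomic (p ^ (n + 1)) ℤ).comp (X + 1)).Monic := by
    rw [show (X + 1 : ℤ[X]) = X + C 1 by rw [C_1]]; exact (cyclotomic.monic _ ℤ).comp_X_add_C 1
  rw [cycPoly, h.natDegree_map, natDegree_comp, show (X + 1 : ℤ[X]) = X + C 1 by rw [C_1], natDegree_X_add_C,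
    mul_one, natDegree_cyclotomic, Nat.totient_prime_pow_succ (Fact.out : p.Prime)]

/-- `Φ_{p^{n+1}}(1+X) = X^{p^n(p-1)} + p·(1 + X·V)` over `ℤ_p` (tree `exists_cyclotomic_prime_pow_comp_X_add_one_eq`). -/
theorem cycPoly_spec (n : ℕ) : ∃ V : 𝒪[X], cycPoly 𝒪 p n = X ^ (p ^ n * (p - 1)) + C (p : 𝒪) * (1 + X * V) := by
  obtain ⟨Q, V, hQ, rfl⟩ := exists_cyclotomic_prime_pow_comp_X_add_one_eq p n
  refine ⟨Polynomial.map (Int.castRingHom 𝒪) V, ?_⟩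
  rw [cycPoly, hQ, Polynomial.map_add, Polynomial.map_pow, Polynomial.map_X, Polynomial.map_mul, Polynomial.map_C,
    map_natCast, Polynomial.map_add, Polynomial.map_one, Polynomial.map_mul, Polynomial.map_X]

variable (𝒪 p) in
/-- The cofactor `V_n` with `Φ_{p^{n+1}}(1+X) = X^{p^n(p-1)} + p·(1 + X·V_n)`. -/
noncomputable def cycV (n : ℕ) : 𝒪[X] := (cycPoly_spec (𝒪 := 𝒪) (p := p) n).choose

theorem cycPoly_eq (n : ℕ) : cycPoly 𝒪 p n = X ^ (p ^ n * (p - 1)) + C (p : 𝒪) * (1 + X * cycV 𝒪 p n) :=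
  (cycPoly_spec (𝒪 := 𝒪) (p := p) n).choose_spec

theorem coe_cycPoly (n : ℕ) : ((cycPoly 𝒪 p n : 𝒪[X]) : Lam₁ 𝒪) =
    PowerSeries.X ^ (p ^ n * (p - 1)) + (p : Lam₁ 𝒪) * (1 + PowerSeries.X * ((cycV 𝒪 p n : 𝒪[X]) : Lam₁ 𝒪)) := by
  rw [cycPoly_eq, Polynomial.coe_add, Polynomial.coe_pow, Polynomial.coe_X, Polynomial.coe_mul, Polynomial.coe_C,
    map_natCast, Polynomial.coe_add, Polynomial.coe_one, Polynomial.coe_mul, Polynomial.coe_X]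

/-- Eisenstein at `(p)` (Mathlib's `cyclotomic_prime_pow_comp_X_add_one_isEisensteinAt`, base-changed to `ℤ_p`). -/
theorem cycPoly_isEisensteinAt (n : ℕ) : (cycPoly 𝒪 p n).IsEisensteinAt (IsLocalRing.maximalIdeal 𝒪) := by
  have hp : p.Prime := Fact.out
  have hV := cycPoly_eq (𝒪 := 𝒪) (p := p) n
  have hd : 0 < p ^ n * (p - 1) := Nat.mul_pos (Nat.pow_pos hp.pos) (Nat.sub_pos_of_lt hp.one_lt)
  refine (cycPoly_monic n).isEisensteinAt_of_mem_of_notMem (IsLocalRing.maximalIdeal.isMaximal 𝒪).ne_top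
    (fun {i} hi => ?_) ?_
  · rw [cycPoly_natDegree] at hi
    rw [hV, coeff_add, coeff_X_pow, if_neg hi.ne, zero_add, coeff_C_mul, (maximalIdeal_eq_span_p𝒪 (𝒪 := 𝒪) (p := p))]
    exact Ideal.mul_mem_right _ _ (Ideal.mem_span_singleton_self _)
  · rw [hV, coeff_add, coeff_X_pow, if_neg hd.ne, zero_add, coeff_C_mul, coeff_add, coeff_one_zero, coeff_X_mul_zero,
      add_zero, mul_one, (maximalIdeal_eq_span_p𝒪 (𝒪 := 𝒪) (p := p)), Ideal.span_singleton_pow, Ideal.mem_span_singleton]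
    rintro ⟨c, hc⟩
    have h1 : (p : 𝒪) * 1 = (p : 𝒪) * ((p : 𝒪) * c) := by rw [mul_one, ← mul_assoc, ← pow_two]; exact hc
    have h2 := mul_left_cancel₀ (Nat.cast_ne_zero.mpr hp.ne_zero) h1
    exact (not_isUnit_p𝒪 (𝒪 := 𝒪) (p := p)) (IsUnit.of_mul_eq_one c h2.symm)

theorem prime_cycPoly (n : ℕ) : Prime (cycPoly 𝒪 p n) := by
  have hp : p.Prime := Fact.out
  refine ((cycPoly_isEisensteinAt n).irreducible (IsLocalRing.maximalIdeal.isMaximal 𝒪).isPrime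
    (cycPoly_monic n).isPrimitive ?_).prime
  rw [cycPoly_natDegree]; exact Nat.mul_pos (Nat.pow_pos hp.pos) (Nat.sub_pos_of_lt hp.one_lt)

/-- `Φ_{p^{n+1}}(1+T)` is PRIME in `Λ₁ = ℤ_p⟦T⟧` (Weierstrass: `Λ₁/(f) ≅ ℤ_p[T]/(f)` for distinguished `f`; tree
`span_coe_isPrime_of_dvd`). -/
theorem prime_coe_cycPoly (n : ℕ) : Prime ((cycPoly 𝒪 p n : 𝒪[X]) : Lam₁ 𝒪) := by
  haveI : (Ideal.span {cycPoly 𝒪 p n}).IsPrime :=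
    (Ideal.span_singleton_prime (prime_cycPoly n).ne_zero).mpr (prime_cycPoly n)
  have hdist : (cycPoly 𝒪 p n).IsDistinguishedAt (IsLocalRing.maximalIdeal 𝒪) :=
    Polynomial.IsDistinguishedAt.mk (cycPoly_isEisensteinAt n).isWeaklyEisensteinAt (cycPoly_monic n)
  have h := span_coe_isPrime_of_dvd hdist (dvd_refl (cycPoly 𝒪 p n))
  exact (Ideal.span_singleton_prime (by
    rw [Ne, Polynomial.coe_eq_zero_iff]; exact (prime_cycPoly n).ne_zero)).mp h

theorem map_residue_natCast₁ : PowerSeries.map (IsLocalRing.residue 𝒪) (p : Lam₁ 𝒪) = 0 := by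
  rw [map_natCast, ← map_natCast (PowerSeries.C (R := IsLocalRing.ResidueField 𝒪)),
    ← map_natCast (IsLocalRing.residue 𝒪), (IsLocalRing.residue_eq_zero_iff _).mpr, map_zero]
  rw [(maximalIdeal_eq_span_p𝒪 (𝒪 := 𝒪) (p := p))]; exact Ideal.mem_span_singleton_self _

/-- `Φ_{p^{n+1}}(1+T) ∤ p` in `Λ₁`. -/
theorem not_coe_cycPoly_dvd (n : ℕ) : ¬ ((cycPoly 𝒪 p n : 𝒪[X]) : Lam₁ 𝒪) ∣ (p : Lam₁ 𝒪) := by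
  rintro ⟨g, hg⟩
  have hf : PowerSeries.map (IsLocalRing.residue 𝒪) ((cycPoly 𝒪 p n : 𝒪[X]) : Lam₁ 𝒪) =
      PowerSeries.X ^ (p ^ n * (p - 1)) := by
    rw [coe_cycPoly, map_add, map_pow, PowerSeries.map_X, map_mul, map_residue_natCast₁, zero_mul, add_zero]
  have hgbar : PowerSeries.map (IsLocalRing.residue 𝒪) g = 0 := by
    have := congrArg (PowerSeries.map (IsLocalRing.residue 𝒪)) hg
    rw [map_residue_natCast₁, map_mul, hf] at this
    exact (mul_eq_zero.mp this.symm).resolve_left (pow_ne_zero _ PowerSeries.X_ne_zero)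
  obtain ⟨g', hg'⟩ := natCast_dvd_of_map_residue_eq_zero₁ (𝒪 := 𝒪) (p := p) hgbar
  have h1 : (p : Lam₁ 𝒪) * 1 = (p : Lam₁ 𝒪) * (((cycPoly 𝒪 p n : 𝒪[X]) : Lam₁ 𝒪) * g') := by
    rw [mul_one]; nth_rw 1 [hg]; rw [hg']; ring
  have h2 := mul_left_cancel₀ (prime_natCast_p₁ (𝒪 := 𝒪) (p := p)).ne_zero h1
  exact (prime_coe_cycPoly n).not_unit (IsUnit.of_mul_eq_one g' h2.symm)

variable (𝒪 p) in
/-- **The cyclotomic Eisenstein system** `P_n = Φ_{p^{n+1}}(1+T)`, `d_n = p^n(p-1)`, `h_n = 1 + T·V_n`. -/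
noncomputable def cyclotomicSystem : EisensteinSystem 𝒪 p where
  P n := ⟨((cycPoly 𝒪 p n : 𝒪[X]) : Lam₁ 𝒪), prime_coe_cycPoly n, not_coe_cycPoly_dvd n⟩
  d n := p ^ n * (p - 1)
  h n := ((1 + X * cycV 𝒪 p n : 𝒪[X]) : Lam₁ 𝒪)
  shape n := by
    show ((cycPoly 𝒪 p n : 𝒪[X]) : Lam₁ 𝒪) = _
    rw [coe_cycPoly, Polynomial.coe_add, Polynomial.coe_one, Polynomial.coe_mul, Polynomial.coe_X]
  isUnit_h n := by
    rw [PowerSeries.isUnit_iff_constantCoeff, Polynomial.coe_add, Polynomial.coe_one, Polynomial.coe_mul, Polynomial.coe_X,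
      map_add, map_one, map_mul, PowerSeries.constantCoeff_X, zero_mul, add_zero]
    exact isUnit_one
  strictMono_d := by
    have hp : p.Prime := Fact.out
    refine strictMono_nat_of_lt_succ fun n => ?_
    exact Nat.mul_lt_mul_of_pos_right (Nat.pow_lt_pow_right hp.one_lt (Nat.lt_succ_self n))
      (Nat.sub_pos_of_lt hp.one_lt)

end Cyclotomic

/-- **Door 5, cyclotomic–cyclotomic instance**: classical fibre bounds at the points `T₂ = ζ_{p^{n+1}}-1` for
`(X, G)` and at `T₁ = ζ_{p^{n+1}}-1` for `(Xᵗ, Gᵗ)` (all `n ≫ 0`) ⟹ `∃ a, (p^a·G) ⊆ ch_{Λ₂}(X)`. -/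
theorem engine_door5_cyclotomic (X : Type) [AddCommGroup X] [Module (Lam₂ 𝒪) X]
    [Module.Finite (Lam₂ 𝒪) X] (G : Lam₂ 𝒪) (hPT : PatchingTarget 𝒪 p X G)
    (hT : Module.IsTorsion (Lam₂ 𝒪) X) (h₂ : ClassicalFibreBounds 𝒪 p (cyclotomicSystem 𝒪 p) X G)
    (h₁ : ClassicalFibreBounds 𝒪 p (cyclotomicSystem 𝒪 p) (Twist (IntSeries.transposeRingEquiv 𝒪) X)
      (IntSeries.transpose G)) :
    ∃ a : ℕ, Ideal.span {(p : Lam₂ 𝒪) ^ a * G} ≤ Module.charIdeal (Lam₂ 𝒪) X :=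
  engine_door5 _ _ X G hPT hT h₂ h₁


/-! ### E15 (g22, v1.1). ANY TWO DISTINCT DIRECTIONS: the abstract second direction and the mod-`p` criterion  … (full section note: `QtameDoor5.lean` v1.1) -/

variable (𝒪 p) in
/-- A **patching direction**: a ring automorphism of `Λ₂` with the visibility dichotomy. -/
structure PatchDirection where
  /-- the coordinate change -/
  Θ : Lam₂ 𝒪 ≃+* Lam₂ 𝒪
  /-- every non-unit `F` with `p ∤ F` is visible in direction 2, or `Θ F` is -/
  dichotomy : ∀ F : Lam₂ 𝒪, ¬ IsUnit F → ¬ (p : Lam₂ 𝒪) ∣ F → Visible 𝒪 F ∨ Visible 𝒪 (Θ F)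

/-- **DOOR 5 for an abstract second direction.** -/
theorem engine_door5Θ (D : PatchDirection 𝒪 p) (𝓟₁ 𝓟₂ : EisensteinSystem 𝒪 p) (X : Type) [AddCommGroup X]
    [Module (Lam₂ 𝒪) X] [Module.Finite (Lam₂ 𝒪) X] (G : Lam₂ 𝒪)
    (hPT : PatchingTarget 𝒪 p X G) (hT : Module.IsTorsion (Lam₂ 𝒪) X)
    (h₂ : ClassicalFibreBounds 𝒪 p 𝓟₂ X G) (h₁ : ClassicalFibreBounds 𝒪 p 𝓟₁ (Twist D.Θ X) (D.Θ G)) :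
    ∃ a : ℕ, Ideal.span {(p : Lam₂ 𝒪) ^ a * G} ≤ Module.charIdeal (Lam₂ 𝒪) X := by
  classical
  haveI : UniqueFactorizationMonoid (Lam₂ 𝒪) :=
    Literature.NumberTheory.IwasawaTheory.uniqueFactorizationMonoid_powerSeries_powerSeries 𝒪
  refine hPT hT fun 𝔓 hht hp𝔓 => ?_
  obtain ⟨F, hF𝔓, hF⟩ := Ideal.IsPrime.exists_mem_prime_of_ne_bot 𝔓.isPrime (Ideal.ne_bot_of_height_eq_one hht)
  have h𝔓F : 𝔓.asIdeal = Ideal.span {F} := Ideal.eq_span_singleton_of_height_eq_one hht hF𝔓 hF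
  have hpt : 𝔓 = ⟨Ideal.span {F}, (Ideal.span_singleton_prime hF.ne_zero).mpr hF⟩ := PrimeSpectrum.ext h𝔓F
  have hpF : ¬ (p : Lam₂ 𝒪) ∣ F := by
    rintro ⟨q, hq⟩
    have hdvd : F ∣ (p : Lam₂ 𝒪) * q := ⟨1, by rw [mul_one, hq]⟩
    rcases hF.dvd_or_dvd hdvd with h | ⟨r, hr⟩
    · exact hp𝔓 (by rw [h𝔓F]; exact Ideal.mem_span_singleton.mpr h)
    · have h1 : F * 1 = F * ((p : Lam₂ 𝒪) * r) := by
        rw [mul_one]; nth_rw 1 [hq]; rw [hr]; ring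
      exact not_isUnit_natCast_p₂ (𝒪 := 𝒪) (p := p) (IsUnit.of_mul_eq_one r (mul_left_cancel₀ hF.ne_zero h1).symm)
  rcases D.dichotomy F hF.not_unit hpF with hv | hv
  · rw [hpt]; exact classical_dvd 𝓟₂ X G hT h₂ hF hv
  · have hFt : Prime (D.Θ F) := (MulEquiv.prime_iff D.Θ).mpr hF
    have hd := classical_dvd 𝓟₁ (Twist D.Θ X) (D.Θ G) (Twist.isTorsion D.Θ X hT) h₁ hFt hv
    have hℓ : Module.lengthAt (Lam₂ 𝒪) X 𝔓 = Module.lengthAt (Lam₂ 𝒪) (Twist D.Θ X)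
        ⟨Ideal.span {D.Θ F}, (Ideal.span_singleton_prime hFt.ne_zero).mpr hFt⟩ := by
      rw [Twist.lengthAt_eq D.Θ X 𝔓, hpt, comapEquiv_span_singleton D.Θ hF]
    rw [hℓ, h𝔓F]
    exact span_singleton_pow_dvd_of_map D.Θ hd

/-- Door 5 (abstract direction) with torsion from ONE classical fibre. -/
theorem engine_door5Θ' (D : PatchDirection 𝒪 p) (𝓟₁ 𝓟₂ : EisensteinSystem 𝒪 p) (X : Type) [AddCommGroup X]
    [Module (Lam₂ 𝒪) X] [Module.Finite (Lam₂ 𝒪) X] (G : Lam₂ 𝒪)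
    (hPT : PatchingTarget 𝒪 p X G) (hFT : ∃ n, FibreTorsionAt 𝒪 p (𝓟₂.P n) X)
    (h₂ : ClassicalFibreBounds 𝒪 p 𝓟₂ X G) (h₁ : ClassicalFibreBounds 𝒪 p 𝓟₁ (Twist D.Θ X) (D.Θ G)) :
    ∃ a : ℕ, Ideal.span {(p : Lam₂ 𝒪) ^ a * G} ≤ Module.charIdeal (Lam₂ 𝒪) X := by
  obtain ⟨n, hn⟩ := hFT
  exact engine_door5Θ D 𝓟₁ 𝓟₂ X G hPT (isTorsion_of_fibreTorsionAt' (𝓟₂.P n) X hn) h₂ h₁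

/-- `T₂ = C X` is prime in `k⟦T₂⟧⟦T₁⟧` (it is the transpose of the prime outer variable). -/
theorem prime_C_X_residueField₂ {k : Type*} [Field k] :
    Prime (PowerSeries.C PowerSeries.X : PowerSeries (PowerSeries k)) := by
  rw [← IntSeries.transpose_X, ← IntSeries.transposeRingEquiv_apply, MulEquiv.prime_iff]
  exact PowerSeries.X_prime

theorem not_isUnit_C_X₂ {k : Type*} [Field k] : ¬ IsUnit (PowerSeries.C PowerSeries.X : PowerSeries (PowerSeries k)) :=
  prime_C_X_residueField₂.not_unit

/-- **The mod-`p` criterion for the dichotomy.** `Θb` = the reduction of `Θ`; hypothesis: the reduced new line variable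
`Θb⁻¹(T₂)` is not an associate of `T₂`. -/
theorem dichotomy_of_reduction (Θ : Lam₂ 𝒪 ≃+* Lam₂ 𝒪)
    (Θb : PowerSeries (PowerSeries (IsLocalRing.ResidueField 𝒪)) ≃+*
      PowerSeries (PowerSeries (IsLocalRing.ResidueField 𝒪)))
    (hcomm : ∀ F : Lam₂ 𝒪, PowerSeries.map (PowerSeries.map (IsLocalRing.residue 𝒪)) (Θ F) =
      Θb (PowerSeries.map (PowerSeries.map (IsLocalRing.residue 𝒪)) F))
    (hna : ¬ Associated (Θb.symm (PowerSeries.C PowerSeries.X)) (PowerSeries.C PowerSeries.X))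
    (F : Lam₂ 𝒪) (hFu : ¬ IsUnit F) (hpF : ¬ (p : Lam₂ 𝒪) ∣ F) :
    Visible 𝒪 F ∨ Visible 𝒪 (Θ F) := by
  by_contra h
  push Not at h
  have hpFt : ¬ (p : Lam₂ 𝒪) ∣ Θ F := by
    rintro ⟨q, hq⟩
    refine hpF ⟨Θ.symm q, ?_⟩
    have := congrArg Θ.symm hq
    rwa [RingEquiv.symm_apply_apply, map_mul, map_natCast] at this
  obtain ⟨n, U, hU, hFU⟩ := exists_eq_C_X_pow_mul_unit_of_not_visible hpF h.1
  obtain ⟨m, V, hV, hFV⟩ := exists_eq_C_X_pow_mul_unit_of_not_visible hpFt h.2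
  rw [hcomm] at hFV
  -- pull back along `Θb`: `F̄ = S^m · W`, `S = Θb⁻¹(T₂)`, `W` a unit
  set S := Θb.symm (PowerSeries.C PowerSeries.X) with hS
  have hFS : PowerSeries.map (PowerSeries.map (IsLocalRing.residue 𝒪)) F = S ^ m * Θb.symm V := by
    have := congrArg Θb.symm hFV
    rwa [RingEquiv.symm_apply_apply, map_mul, map_pow, map_pow] at this
  have hW : IsUnit (Θb.symm V) := hV.map _
  rw [map_pow] at hFU
  rcases Nat.eq_zero_or_pos n with hn | hn
  · rw [hn, pow_zero, one_mul] at hFU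
    exact hFu (isUnit_of_isUnit_map_residue₂ (hFU ▸ hU))
  rcases Nat.eq_zero_or_pos m with hm | hm
  · rw [hm, pow_zero, one_mul] at hFS
    exact hFu (isUnit_of_isUnit_map_residue₂ (hFS ▸ hW))
  have hT₂ : Prime (PowerSeries.C PowerSeries.X : PowerSeries (PowerSeries (IsLocalRing.ResidueField 𝒪))) :=
    prime_C_X_residueField₂
  have hSp : Prime S := by rw [hS, MulEquiv.prime_iff]; exact hT₂
  -- `T₂ ∣ S`
  have h1 : PowerSeries.C PowerSeries.X ∣ S := by
    have hdvd : PowerSeries.C PowerSeries.X ∣ S ^ m * Θb.symm V := by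
      rw [← hFS, hFU]; exact Dvd.dvd.mul_right (dvd_pow_self _ hn.ne') _
    rcases hT₂.dvd_or_dvd hdvd with h' | h'
    · exact hT₂.dvd_of_dvd_pow h'
    · exact absurd (isUnit_of_dvd_unit h' hW) hT₂.not_unit
  -- `S ∣ T₂`
  have h2 : S ∣ PowerSeries.C PowerSeries.X := by
    have hdvd : S ∣ PowerSeries.C PowerSeries.X ^ n * U := by
      rw [← hFU, hFS]; exact Dvd.dvd.mul_right (dvd_pow_self _ hm.ne') _
    rcases hSp.dvd_or_dvd hdvd with h' | h'
    · exact hSp.dvd_of_dvd_pow h'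
    · exact absurd (isUnit_of_dvd_unit h' hU) hSp.not_unit
  exact hna (associated_of_dvd_dvd h2 h1)

/-- A patching direction from the mod-`p` criterion. -/
def PatchDirection.ofReduction (Θ : Lam₂ 𝒪 ≃+* Lam₂ 𝒪)
    (Θb : PowerSeries (PowerSeries (IsLocalRing.ResidueField 𝒪)) ≃+*
      PowerSeries (PowerSeries (IsLocalRing.ResidueField 𝒪)))
    (hcomm : ∀ F : Lam₂ 𝒪, PowerSeries.map (PowerSeries.map (IsLocalRing.residue 𝒪)) (Θ F) =
      Θb (PowerSeries.map (PowerSeries.map (IsLocalRing.residue 𝒪)) F))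
    (hna : ¬ Associated (Θb.symm (PowerSeries.C PowerSeries.X)) (PowerSeries.C PowerSeries.X)) : PatchDirection 𝒪 p :=
  ⟨Θ, dichotomy_of_reduction Θ Θb hcomm hna⟩

/-- In `k⟦T₂⟧⟦T₁⟧` the two axis variables are not associates: `T₁ = X ≁ T₂ = C X`. -/
theorem not_associated_X_C_X₂ {k : Type*} [Field k] :
    ¬ Associated (PowerSeries.X : PowerSeries (PowerSeries k)) (PowerSeries.C PowerSeries.X) := by
  intro h
  obtain ⟨W, hW⟩ := h.symm.dvd
  have h1 := congrArg (PowerSeries.coeff 1) hW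
  rw [PowerSeries.coeff_one_X, PowerSeries.coeff_C_mul] at h1
  have hu : IsUnit (PowerSeries.X : PowerSeries k) := IsUnit.of_mul_eq_one _ h1.symm
  rw [PowerSeries.isUnit_iff_constantCoeff, PowerSeries.constantCoeff_X] at hu
  exact not_isUnit_zero hu

/-- The transpose direction, obtained through the criterion (`Θb` = transpose over `k`; `Θb⁻¹(T₂) = T₁`). -/
noncomputable def PatchDirection.transpose : PatchDirection 𝒪 p :=
  PatchDirection.ofReduction (IntSeries.transposeRingEquiv 𝒪)
    (IntSeries.transposeRingEquiv (IsLocalRing.ResidueField 𝒪))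
    (fun F => by
      rw [IntSeries.transposeRingEquiv_apply, IntSeries.transposeRingEquiv_apply, IntSeries.map_map_transpose])
    (by
      intro h
      refine not_associated_X_C_X₂ (k := IsLocalRing.ResidueField 𝒪) ?_
      have hS : (IntSeries.transposeRingEquiv (IsLocalRing.ResidueField 𝒪)).symm (PowerSeries.C PowerSeries.X) =
          PowerSeries.X := by
        show IntSeries.transpose (PowerSeries.C PowerSeries.X) = PowerSeries.X
        rw [← IntSeries.transpose_X, IntSeries.transpose_transpose]
      rwa [hS] at h)

/-- `engine_door5` re-derived from the abstract engine at the transpose direction. -/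
theorem engine_door5_via_direction (𝓟₁ 𝓟₂ : EisensteinSystem 𝒪 p) (X : Type) [AddCommGroup X]
    [Module (Lam₂ 𝒪) X] [Module.Finite (Lam₂ 𝒪) X] (G : Lam₂ 𝒪)
    (hPT : PatchingTarget 𝒪 p X G) (hT : Module.IsTorsion (Lam₂ 𝒪) X)
    (h₂ : ClassicalFibreBounds 𝒪 p 𝓟₂ X G)
    (h₁ : ClassicalFibreBounds 𝒪 p 𝓟₁ (Twist (IntSeries.transposeRingEquiv 𝒪) X) (IntSeries.transpose G)) :
    ∃ a : ℕ, Ideal.span {(p : Lam₂ 𝒪) ^ a * G} ≤ Module.charIdeal (Lam₂ 𝒪) X :=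
  engine_door5Θ PatchDirection.transpose 𝓟₁ 𝓟₂ X G hPT hT h₂ (by
    show ClassicalFibreBounds 𝒪 p 𝓟₁ (Twist (IntSeries.transposeRingEquiv 𝒪) X)
      (IntSeries.transposeRingEquiv 𝒪 G)
    rw [IntSeries.transposeRingEquiv_apply]; exact h₁)

end Door5

/-! ### E16 `PatchingTarget` PROVED over `𝒪` (sketch §7 `Patch.*` verbatim, any Noetherian UFD) + hypothesis-free engines -/

section PatchingTargetProved

namespace Patch

/-- **Final patching over a Noetherian UFD, with exponent bound**: if every height-one prime `𝔓 ∌ ϖ` satisfies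
`𝔓 ^ n(𝔓) ∣ (G)`, then `(ϖ^a · G) ⊆ ∏ᶠ_{ht 𝔓 = 1} 𝔓 ^ n(𝔓)` for some `a`, with `a ≤ n(𝔓₀)` whenever `𝔓₀` is the only
height-one prime containing `ϖ` (the proof takes `a = Σ_{𝔓 ∋ ϖ} n(𝔓)` over the support). -/
theorem span_pow_mul_le_finprod_bound {R : Type*} [CommRing R] [IsDomain R] [IsNoetherianRing R]
    [UniqueFactorizationMonoid R] (ϖ G : R) (n : PrimeSpectrum R → ℕ)
    (hdiv : ∀ 𝔓 : PrimeSpectrum R, 𝔓.asIdeal.height = 1 → ϖ ∉ 𝔓.asIdeal →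
      𝔓.asIdeal ^ n 𝔓 ∣ Ideal.span {G}) :
    ∃ a : ℕ, (∀ 𝔓₀ : PrimeSpectrum R,
        (∀ 𝔓 : PrimeSpectrum R, 𝔓.asIdeal.height = 1 → ϖ ∈ 𝔓.asIdeal → 𝔓 = 𝔓₀) → a ≤ n 𝔓₀) ∧
      Ideal.span {ϖ ^ a * G} ≤
        ∏ᶠ 𝔓 ∈ {𝔓 : PrimeSpectrum R | 𝔓.asIdeal.height = 1}, 𝔓.asIdeal ^ n 𝔓 := by
  classical
  set g : PrimeSpectrum R → Ideal R :=
    Set.mulIndicator {𝔓 : PrimeSpectrum R | 𝔓.asIdeal.height = 1} (fun 𝔓 => 𝔓.asIdeal ^ n 𝔓)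
    with hg_def
  rw [finprod_mem_def]
  by_cases hfin : (Function.mulSupport g).Finite
  swap
  · refine ⟨0, fun _ _ => Nat.zero_le _, ?_⟩
    rw [finprod_of_infinite_mulSupport hfin, Ideal.one_eq_top]
    exact le_top
  set s : Finset (PrimeSpectrum R) := hfin.toFinset with hs_def
  have hprod : ∏ᶠ 𝔓, g 𝔓 = ∏ 𝔓 ∈ s, g 𝔓 :=
    finprod_eq_prod_of_mulSupport_subset g (by simp [hs_def])
  rw [hprod]
  -- members of `s` are height-one primes and `g` is the honest power there
  have hs_ht : ∀ 𝔓 ∈ s, 𝔓.asIdeal.height = 1 := by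
    intro 𝔓 h𝔓
    have hmem : 𝔓 ∈ Function.mulSupport g := by simpa [hs_def] using h𝔓
    by_contra hne
    exact hmem (Set.mulIndicator_of_notMem
      (show 𝔓 ∉ {𝔓 : PrimeSpectrum R | 𝔓.asIdeal.height = 1} from hne)
      (fun 𝔓 : PrimeSpectrum R => 𝔓.asIdeal ^ n 𝔓))
  have hg_eq : ∀ 𝔓 ∈ s, g 𝔓 = 𝔓.asIdeal ^ n 𝔓 := fun 𝔓 h𝔓 =>
    Set.mulIndicator_of_mem
      (show 𝔓 ∈ {𝔓 : PrimeSpectrum R | 𝔓.asIdeal.height = 1} from hs_ht 𝔓 h𝔓)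
      (fun 𝔓 : PrimeSpectrum R => 𝔓.asIdeal ^ n 𝔓)
  -- generators of the height-one primes (UFD)
  have hgen : ∀ 𝔓 : PrimeSpectrum R, 𝔓.asIdeal.height = 1 →
      ∃ π : R, Prime π ∧ 𝔓.asIdeal = Ideal.span {π} := by
    intro 𝔓 h
    obtain ⟨x, hx, hxp⟩ :=
      Ideal.IsPrime.exists_mem_prime_of_ne_bot 𝔓.isPrime (Ideal.ne_bot_of_height_eq_one h)
    exact ⟨x, hxp, Ideal.eq_span_singleton_of_height_eq_one h hx hxp⟩
  choose! π hπ using hgen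
  -- split `s` by `ϖ ∈ 𝔓`
  rw [← Finset.prod_filter_mul_prod_filter_not s (fun 𝔓 => ϖ ∈ 𝔓.asIdeal)]
  set s₀ := s.filter (fun 𝔓 => ϖ ∈ 𝔓.asIdeal) with hs₀
  set s₁ := s.filter (fun 𝔓 => ¬ ϖ ∈ 𝔓.asIdeal) with hs₁
  -- the `ϖ`-part
  have h0 : Ideal.span {ϖ ^ (∑ 𝔓 ∈ s₀, n 𝔓)} ≤ ∏ 𝔓 ∈ s₀, g 𝔓 := by
    rw [← Ideal.span_singleton_pow, ← Finset.prod_pow_eq_pow_sum]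
    refine Finset.prod_le_prod' fun 𝔓 h𝔓 => ?_
    have h𝔓s : 𝔓 ∈ s := (Finset.mem_filter.mp h𝔓).1
    rw [hg_eq 𝔓 h𝔓s]
    exact Ideal.pow_right_mono ((Ideal.span_singleton_le_iff_mem _).mpr (Finset.mem_filter.mp h𝔓).2) _
  -- the prime-to-`ϖ` part
  have h1 : Ideal.span {G} ≤ ∏ 𝔓 ∈ s₁, g 𝔓 := by
    have hπdvd : ∀ 𝔓 ∈ s₁, π 𝔓 ^ n 𝔓 ∣ G := by
      intro 𝔓 h𝔓
      obtain ⟨h𝔓s, hϖ⟩ := Finset.mem_filter.mp h𝔓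
      have hd := hdiv 𝔓 (hs_ht 𝔓 h𝔓s) hϖ
      rw [(hπ 𝔓 (hs_ht 𝔓 h𝔓s)).2, Ideal.span_singleton_pow] at hd
      exact Ideal.span_singleton_le_span_singleton.mp (Ideal.le_of_dvd hd)
    have hpair : (↑s₁ : Set (PrimeSpectrum R)).Pairwise
        (Function.onFun IsRelPrime fun 𝔓 => π 𝔓 ^ n 𝔓) := by
      intro 𝔓 h𝔓 𝔔 h𝔔 hne
      have h𝔓1 := hs_ht 𝔓 (Finset.mem_filter.mp h𝔓).1
      have h𝔔1 := hs_ht 𝔔 (Finset.mem_filter.mp h𝔔).1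
      refine (IsRelPrime.pow_left ?_).pow_right
      refine ((hπ 𝔓 h𝔓1).1.irreducible.isRelPrime_iff_not_dvd).mpr fun hdvd => hne ?_
      have hassoc : Associated (π 𝔓) (π 𝔔) := (hπ 𝔓 h𝔓1).1.associated_of_dvd (hπ 𝔔 h𝔔1).1 hdvd
      apply PrimeSpectrum.ext
      rw [(hπ 𝔓 h𝔓1).2, (hπ 𝔔 h𝔔1).2, Ideal.span_singleton_eq_span_singleton]
      exact hassoc
    have hprod_dvd : (∏ 𝔓 ∈ s₁, π 𝔓 ^ n 𝔓) ∣ G := Finset.prod_dvd_of_isRelPrime hpair hπdvd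
    have hprod_eq : ∏ 𝔓 ∈ s₁, g 𝔓 = Ideal.span {∏ 𝔓 ∈ s₁, π 𝔓 ^ n 𝔓} := by
      rw [← Ideal.prod_span_singleton]
      refine Finset.prod_congr rfl fun 𝔓 h𝔓 => ?_
      have h𝔓s : 𝔓 ∈ s := (Finset.mem_filter.mp h𝔓).1
      rw [hg_eq 𝔓 h𝔓s, (hπ 𝔓 (hs_ht 𝔓 h𝔓s)).2, Ideal.span_singleton_pow]
    rw [hprod_eq]
    exact Ideal.span_singleton_le_span_singleton.mpr hprod_dvd
  refine ⟨∑ 𝔓 ∈ s₀, n 𝔓, fun 𝔓₀ huniq => ?_, ?_⟩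
  · have hsub : s₀ ⊆ {𝔓₀} := fun 𝔓 h𝔓 => Finset.mem_singleton.mpr
      (huniq 𝔓 (hs_ht 𝔓 (Finset.mem_filter.mp h𝔓).1) (Finset.mem_filter.mp h𝔓).2)
    calc ∑ 𝔓 ∈ s₀, n 𝔓 ≤ ∑ 𝔓 ∈ {𝔓₀}, n 𝔓 := Finset.sum_le_sum_of_subset hsub
      _ = n 𝔓₀ := Finset.sum_singleton _ _
  · rw [← Ideal.span_singleton_mul_span_singleton]
    exact Ideal.mul_mono h0 h1

/-- **Final patching over a Noetherian UFD** (generic form of `PatchingTarget`): if every height-one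
prime `𝔓 ∌ ϖ` satisfies `𝔓 ^ n(𝔓) ∣ (G)`, then `(ϖ^a · G) ⊆ ∏ᶠ_{ht 𝔓 = 1} 𝔓 ^ n(𝔓)` for some `a`. -/
theorem span_pow_mul_le_finprod {R : Type*} [CommRing R] [IsDomain R] [IsNoetherianRing R]
    [UniqueFactorizationMonoid R] (ϖ G : R) (n : PrimeSpectrum R → ℕ)
    (hdiv : ∀ 𝔓 : PrimeSpectrum R, 𝔓.asIdeal.height = 1 → ϖ ∉ 𝔓.asIdeal →
      𝔓.asIdeal ^ n 𝔓 ∣ Ideal.span {G}) :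
    ∃ a : ℕ, Ideal.span {ϖ ^ a * G} ≤
      ∏ᶠ 𝔓 ∈ {𝔓 : PrimeSpectrum R | 𝔓.asIdeal.height = 1}, 𝔓.asIdeal ^ n 𝔓 := by
  obtain ⟨a, -, h⟩ := span_pow_mul_le_finprod_bound ϖ G n hdiv
  exact ⟨a, h⟩

/-- **Explicit exponent.** For a PRIME `ϖ` the exponent may be taken to be `n((ϖ))`: the only height-one prime
containing `ϖ` is `(ϖ)` itself (UFD: height-one primes are principal, generated by a prime dividing `ϖ`). -/
theorem span_pow_mul_le_finprod_of_prime {R : Type*} [CommRing R] [IsDomain R] [IsNoetherianRing R]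
    [UniqueFactorizationMonoid R] {ϖ : R} (hϖ : Prime ϖ) (G : R) (n : PrimeSpectrum R → ℕ)
    (hdiv : ∀ 𝔓 : PrimeSpectrum R, 𝔓.asIdeal.height = 1 → ϖ ∉ 𝔓.asIdeal →
      𝔓.asIdeal ^ n 𝔓 ∣ Ideal.span {G}) :
    Ideal.span {ϖ ^ n ⟨Ideal.span {ϖ}, (Ideal.span_singleton_prime hϖ.ne_zero).mpr hϖ⟩ * G} ≤
      ∏ᶠ 𝔓 ∈ {𝔓 : PrimeSpectrum R | 𝔓.asIdeal.height = 1}, 𝔓.asIdeal ^ n 𝔓 := by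
  obtain ⟨a, hb, h⟩ := span_pow_mul_le_finprod_bound ϖ G n hdiv
  have ha : a ≤ n ⟨Ideal.span {ϖ}, (Ideal.span_singleton_prime hϖ.ne_zero).mpr hϖ⟩ := by
    refine hb _ fun 𝔓 hht hmem => ?_
    obtain ⟨π, hπ𝔓, hπ⟩ :=
      Ideal.IsPrime.exists_mem_prime_of_ne_bot 𝔓.isPrime (Ideal.ne_bot_of_height_eq_one hht)
    have h𝔓 : 𝔓.asIdeal = Ideal.span {π} := Ideal.eq_span_singleton_of_height_eq_one hht hπ𝔓 hπ
    rw [h𝔓] at hmem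
    apply PrimeSpectrum.ext
    rw [h𝔓, Ideal.span_singleton_eq_span_singleton]
    exact hπ.associated_of_dvd hϖ (Ideal.mem_span_singleton.mp hmem)
  exact le_trans (Ideal.span_singleton_le_span_singleton.mpr (mul_dvd_mul_right (pow_dvd_pow ϖ ha) G)) h

end Patch

variable {𝒪 : Type} [CommRing 𝒪] [IsDomain 𝒪] [IsDiscreteValuationRing 𝒪] [IsAdicComplete (IsLocalRing.maximalIdeal 𝒪) 𝒪] [CharZero 𝒪]
  {p : ℕ} [Fact p.Prime] [Fact (Irreducible (p : 𝒪))]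

variable (𝒪 p) in
/-- **`PatchingTarget 𝒪 p X G` holds** for every finitely generated `Λ_{2,𝒪}`-module `X` and every `G` (final patching over
the UFD `Λ_{2,𝒪} = 𝒪⟦T₁⟧⟦T₂⟧`, tree `uniqueFactorizationMonoid_powerSeries_powerSeries`). -/
theorem patchingTarget_holds (X : Type*) [AddCommGroup X] [Module (Lam₂ 𝒪) X] [Module.Finite (Lam₂ 𝒪) X]
    (G : Lam₂ 𝒪) : PatchingTarget 𝒪 p X G := by
  intro _ hdiv
  haveI : UniqueFactorizationMonoid (Lam₂ 𝒪) :=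
    Literature.NumberTheory.IwasawaTheory.uniqueFactorizationMonoid_powerSeries_powerSeries 𝒪
  exact Patch.span_pow_mul_le_finprod (p : Lam₂ 𝒪) G _ hdiv

/-- **DOOR 5 over `𝒪`, hypothesis-free form**: two Eisenstein systems, torsion, classical fibre bounds in direction 2 for
`(X, G)` and in an abstract second direction `D` for `(Twist D.Θ X, D.Θ G)` ⟹ `∃ a, (p^a·G) ⊆ ch_{Λ_{2,𝒪}}(X)`. -/
theorem door5 (D : PatchDirection 𝒪 p) (𝓟₁ 𝓟₂ : EisensteinSystem 𝒪 p) (X : Type) [AddCommGroup X]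
    [Module (Lam₂ 𝒪) X] [Module.Finite (Lam₂ 𝒪) X] (G : Lam₂ 𝒪) (hT : Module.IsTorsion (Lam₂ 𝒪) X)
    (h₂ : ClassicalFibreBounds 𝒪 p 𝓟₂ X G) (h₁ : ClassicalFibreBounds 𝒪 p 𝓟₁ (Twist D.Θ X) (D.Θ G)) :
    ∃ a : ℕ, Ideal.span {(p : Lam₂ 𝒪) ^ a * G} ≤ Module.charIdeal (Lam₂ 𝒪) X :=
  engine_door5Θ D 𝓟₁ 𝓟₂ X G (patchingTarget_holds 𝒪 p X G) hT h₂ h₁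

/-- The same with both systems cyclotomic and the second direction the transpose (axis directions). -/
theorem door5_cyclotomic_transpose (X : Type) [AddCommGroup X] [Module (Lam₂ 𝒪) X] [Module.Finite (Lam₂ 𝒪) X]
    (G : Lam₂ 𝒪) (hT : Module.IsTorsion (Lam₂ 𝒪) X)
    (h₂ : ClassicalFibreBounds 𝒪 p (cyclotomicSystem 𝒪 p) X G)
    (h₁ : ClassicalFibreBounds 𝒪 p (cyclotomicSystem 𝒪 p) (Twist (IntSeries.transposeRingEquiv 𝒪) X)
      (IntSeries.transpose G)) :
    ∃ a : ℕ, Ideal.span {(p : Lam₂ 𝒪) ^ a * G} ≤ Module.charIdeal (Lam₂ 𝒪) X :=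
  engine_door5_cyclotomic X G (patchingTarget_holds 𝒪 p X G) hT h₂ h₁

/-! #### E16.2 (v1.1) THE OPTIMAL EXPONENT `a = ℓ_{(p)}(X)` — door 5 without `∃`, and the crux shape when `μ_{(p)}(X) = 0` -/

variable (𝒪 p) in
/-- `p` is prime in `Λ_{2,𝒪}` (`= C (C p)`). -/
theorem prime_natCast_p₂ : Prime (p : Lam₂ 𝒪) := by
  rw [← map_natCast (PowerSeries.C (R := Lam₁ 𝒪)) p]
  exact prime_C_of_prime (prime_natCast_p₁ (𝒪 := 𝒪) (p := p))

variable (𝒪 p) in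
/-- The height-one prime `(p)` of `Λ_{2,𝒪}` — the `μ`-prime. -/
noncomputable def primeP : PrimeSpectrum (Lam₂ 𝒪) :=
  ⟨Ideal.span {(p : Lam₂ 𝒪)},
    (Ideal.span_singleton_prime (prime_natCast_p₂ 𝒪 p).ne_zero).mpr (prime_natCast_p₂ 𝒪 p)⟩

/-- **What the engine proves before final patching**: under the hypotheses of `engine_door5Θ` (minus `PatchingTarget`),
EVERY height-one prime `𝔓 ∌ p` of `Λ_{2,𝒪}` satisfies `𝔓 ^ ℓ_𝔓(X) ∣ (G)` (visibility dichotomy + `classical_dvd` in the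
visible direction + transport of lengths through `Θ`; the body of `engine_door5Θ` with the divisibility as conclusion). -/
theorem engine_door5Θ_dvd (D : PatchDirection 𝒪 p) (𝓟₁ 𝓟₂ : EisensteinSystem 𝒪 p) (X : Type) [AddCommGroup X]
    [Module (Lam₂ 𝒪) X] [Module.Finite (Lam₂ 𝒪) X] (G : Lam₂ 𝒪) (hT : Module.IsTorsion (Lam₂ 𝒪) X)
    (h₂ : ClassicalFibreBounds 𝒪 p 𝓟₂ X G) (h₁ : ClassicalFibreBounds 𝒪 p 𝓟₁ (Twist D.Θ X) (D.Θ G)) :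
    ∀ 𝔓 : PrimeSpectrum (Lam₂ 𝒪), 𝔓.asIdeal.height = 1 → (p : Lam₂ 𝒪) ∉ 𝔓.asIdeal →
      𝔓.asIdeal ^ (Module.lengthAt (Lam₂ 𝒪) X 𝔓).toNat ∣ Ideal.span {G} := by
  classical
  haveI : UniqueFactorizationMonoid (Lam₂ 𝒪) :=
    Literature.NumberTheory.IwasawaTheory.uniqueFactorizationMonoid_powerSeries_powerSeries 𝒪
  intro 𝔓 hht hp𝔓
  obtain ⟨F, hF𝔓, hF⟩ := Ideal.IsPrime.exists_mem_prime_of_ne_bot 𝔓.isPrime (Ideal.ne_bot_of_height_eq_one hht)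
  have h𝔓F : 𝔓.asIdeal = Ideal.span {F} := Ideal.eq_span_singleton_of_height_eq_one hht hF𝔓 hF
  have hpt : 𝔓 = ⟨Ideal.span {F}, (Ideal.span_singleton_prime hF.ne_zero).mpr hF⟩ := PrimeSpectrum.ext h𝔓F
  have hpF : ¬ (p : Lam₂ 𝒪) ∣ F := by
    rintro ⟨q, hq⟩
    have hdvd : F ∣ (p : Lam₂ 𝒪) * q := ⟨1, by rw [mul_one, hq]⟩
    rcases hF.dvd_or_dvd hdvd with h | ⟨r, hr⟩
    · exact hp𝔓 (by rw [h𝔓F]; exact Ideal.mem_span_singleton.mpr h)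
    · have h1 : F * 1 = F * ((p : Lam₂ 𝒪) * r) := by
        rw [mul_one]; nth_rw 1 [hq]; rw [hr]; ring
      exact not_isUnit_natCast_p₂ (𝒪 := 𝒪) (p := p) (IsUnit.of_mul_eq_one r (mul_left_cancel₀ hF.ne_zero h1).symm)
  rcases D.dichotomy F hF.not_unit hpF with hv | hv
  · rw [hpt]; exact classical_dvd 𝓟₂ X G hT h₂ hF hv
  · have hFt : Prime (D.Θ F) := (MulEquiv.prime_iff D.Θ).mpr hF
    have hd := classical_dvd 𝓟₁ (Twist D.Θ X) (D.Θ G) (Twist.isTorsion D.Θ X hT) h₁ hFt hv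
    have hℓ : Module.lengthAt (Lam₂ 𝒪) X 𝔓 = Module.lengthAt (Lam₂ 𝒪) (Twist D.Θ X)
        ⟨Ideal.span {D.Θ F}, (Ideal.span_singleton_prime hFt.ne_zero).mpr hFt⟩ := by
      rw [Twist.lengthAt_eq D.Θ X 𝔓, hpt, comapEquiv_span_singleton D.Θ hF]
    rw [hℓ, h𝔓F]
    exact span_singleton_pow_dvd_of_map D.Θ hd

/-- **DOOR 5 WITH THE OPTIMAL EXPONENT** `a = ℓ_{(p)}(X)` = `Module.lengthAt (Lam₂ 𝒪) X (primeP 𝒪 p)`, the `μ`-type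
multiplicity of `X` at the height-one prime `(p)`: same hypotheses as `door5` ⟹ `(p ^ ℓ_{(p)}(X) · G) ⊆ ch_{Λ_{2,𝒪}}(X)`.
(`door5`'s `∃ a` is this `a`; it is optimal for the method: the classical fibres never see the prime `(p)`.) -/
theorem door5_explicit (D : PatchDirection 𝒪 p) (𝓟₁ 𝓟₂ : EisensteinSystem 𝒪 p) (X : Type) [AddCommGroup X]
    [Module (Lam₂ 𝒪) X] [Module.Finite (Lam₂ 𝒪) X] (G : Lam₂ 𝒪) (hT : Module.IsTorsion (Lam₂ 𝒪) X)
    (h₂ : ClassicalFibreBounds 𝒪 p 𝓟₂ X G) (h₁ : ClassicalFibreBounds 𝒪 p 𝓟₁ (Twist D.Θ X) (D.Θ G)) :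
    Ideal.span {(p : Lam₂ 𝒪) ^ (Module.lengthAt (Lam₂ 𝒪) X (primeP 𝒪 p)).toNat * G} ≤
      Module.charIdeal (Lam₂ 𝒪) X := by
  haveI : UniqueFactorizationMonoid (Lam₂ 𝒪) :=
    Literature.NumberTheory.IwasawaTheory.uniqueFactorizationMonoid_powerSeries_powerSeries 𝒪
  exact Patch.span_pow_mul_le_finprod_of_prime (prime_natCast_p₂ 𝒪 p) G
    (fun 𝔓 => (Module.lengthAt (Lam₂ 𝒪) X 𝔓).toNat) (engine_door5Θ_dvd D 𝓟₁ 𝓟₂ X G hT h₂ h₁)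

/-- **`μ_{(p)}(X) = 0` ⟹ the crux shape (no `p`-power)**: if `(p)` is not in the height-one support of `X`
(`ℓ_{(p)}(X) = 0`), door 5 gives `(G) ⊆ ch_{Λ_{2,𝒪}}(X)` on the nose — the shape of crux 20728 AS TYPED
(modulo the coefficient seam (G0)(i)/(bc) of `Door5.md` §4 and `QtameBaseChange.lean`). -/
theorem door5_mu_zero (D : PatchDirection 𝒪 p) (𝓟₁ 𝓟₂ : EisensteinSystem 𝒪 p) (X : Type) [AddCommGroup X]
    [Module (Lam₂ 𝒪) X] [Module.Finite (Lam₂ 𝒪) X] (G : Lam₂ 𝒪) (hT : Module.IsTorsion (Lam₂ 𝒪) X)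
    (h₂ : ClassicalFibreBounds 𝒪 p 𝓟₂ X G) (h₁ : ClassicalFibreBounds 𝒪 p 𝓟₁ (Twist D.Θ X) (D.Θ G))
    (hμ : Module.lengthAt (Lam₂ 𝒪) X (primeP 𝒪 p) = 0) :
    Ideal.span {G} ≤ Module.charIdeal (Lam₂ 𝒪) X := by
  have h := door5_explicit D 𝓟₁ 𝓟₂ X G hT h₂ h₁
  rwa [hμ, ENat.toNat_zero, pow_zero, one_mul] at h

end PatchingTargetProved

/-! ### E17 THE COEFFICIENT CLASS IS INHABITED BY `W(k)` (`k` perfect, char `p`), in particular `Ŵ′ = W(𝔽̄_p)` -/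

section WittVectors

variable (p : ℕ) [Fact p.Prime] (k : Type) [Field k] [CharP k p] [PerfectRing k p]

/-- `𝔪_{W(k)} = (p)` (kernel of the surjection `W(k) → k`, first Witt component). -/
theorem maximalIdeal_wittVector_eq :
    IsLocalRing.maximalIdeal (WittVector p k) = Ideal.span {(p : WittVector p k)} := by
  rw [← WittVector.ker_constantCoeff]
  exact (IsLocalRing.eq_maximalIdeal (RingHom.ker_isMaximal_of_surjective _
    (WittVector.constantCoeff_surjective (p := p) (R := k)))).symm

/-- `W(k)` is `𝔪`-adically complete (Mathlib: `p`-adically complete). -/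
theorem isAdicComplete_wittVector :
    IsAdicComplete (IsLocalRing.maximalIdeal (WittVector p k)) (WittVector p k) := by
  rw [maximalIdeal_wittVector_eq]
  exact WittVector.isAdicCompleteIdealSpanP

/-- `W(k)` has characteristic zero. -/
theorem charZero_wittVector : CharZero (WittVector p k) := by
  obtain ⟨q, hq⟩ := CharP.exists (WittVector p k)
  rcases CharP.char_is_prime_or_zero (WittVector p k) q with hqp | hq0
  · exfalso
    have h1 : (q : WittVector p k) = 0 := CharP.cast_eq_zero (WittVector p k) q
    have h2 : (q : k) = 0 := by
      have := congrArg WittVector.constantCoeff h1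
      rwa [map_natCast, map_zero] at this
    rw [CharP.cast_eq_zero_iff k p q] at h2
    have hqp' : q = p := ((Nat.prime_dvd_prime_iff_eq (Fact.out) hqp).mp h2).symm
    subst hqp'
    exact WittVector.p_nonzero q k h1
  · subst hq0
    exact CharP.charP_to_charZero (WittVector p k)

theorem fact_irreducible_wittVector : Fact (Irreducible (p : WittVector p k)) := ⟨WittVector.irreducible p⟩

attribute [local instance] isAdicComplete_wittVector charZero_wittVector fact_irreducible_wittVector

/-- **DOOR 5 over `W(k)`** (`k` any perfect field of characteristic `p`; `k = 𝔽̄_p` gives `Ŵ′`): `door5` with `𝒪 = WittVector p k`,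
all five coefficient hypotheses DISCHARGED. -/
theorem door5_wittVector (D : PatchDirection (WittVector p k) p) (𝓟₁ 𝓟₂ : EisensteinSystem (WittVector p k) p)
    (X : Type) [AddCommGroup X] [Module (Lam₂ (WittVector p k)) X] [Module.Finite (Lam₂ (WittVector p k)) X]
    (G : Lam₂ (WittVector p k)) (hT : Module.IsTorsion (Lam₂ (WittVector p k)) X)
    (h₂ : ClassicalFibreBounds (WittVector p k) p 𝓟₂ X G)
    (h₁ : ClassicalFibreBounds (WittVector p k) p 𝓟₁ (Twist D.Θ X) (D.Θ G)) :
    ∃ a : ℕ, Ideal.span {(p : Lam₂ (WittVector p k)) ^ a * G} ≤ Module.charIdeal (Lam₂ (WittVector p k)) X :=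
  door5 D 𝓟₁ 𝓟₂ X G hT h₂ h₁

/-- `door5_explicit` over `W(k)`: `(p ^ ℓ_{(p)}(X) · G) ⊆ ch(X)`. -/
theorem door5_explicit_wittVector (D : PatchDirection (WittVector p k) p) (𝓟₁ 𝓟₂ : EisensteinSystem (WittVector p k) p)
    (X : Type) [AddCommGroup X] [Module (Lam₂ (WittVector p k)) X] [Module.Finite (Lam₂ (WittVector p k)) X]
    (G : Lam₂ (WittVector p k)) (hT : Module.IsTorsion (Lam₂ (WittVector p k)) X)
    (h₂ : ClassicalFibreBounds (WittVector p k) p 𝓟₂ X G)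
    (h₁ : ClassicalFibreBounds (WittVector p k) p 𝓟₁ (Twist D.Θ X) (D.Θ G)) :
    Ideal.span {(p : Lam₂ (WittVector p k)) ^
        (Module.lengthAt (Lam₂ (WittVector p k)) X (primeP (WittVector p k) p)).toNat * G} ≤
      Module.charIdeal (Lam₂ (WittVector p k)) X :=
  door5_explicit D 𝓟₁ 𝓟₂ X G hT h₂ h₁

end WittVectors

end Summit.BirchSwinnertonDyer.BirchSwinnertonDyer.Cruxes.TwoVariableEulerSystemDivisibility.QtameDoor5O
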